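import Literature.Geometry.Lorentzian.AxisymmetricBlackHoleUniqueness
import Literature.Geometry.Lorentzian.StationaryBlackHoleUniquenessProofs
import Literature.Geometry.Lorentzian.LorentzianMetricProofs
import Literature.Geometry.Lorentzian.KillingAlgebraAsymptoticallyFlatProofs
import Literature.Geometry.Lorentzian.StaticBlackHoleUniquenessProofs
import Literature.Geometry.Lorentzian.StationaryAsymptoticRegionOpen
import HarnessLib

/-!
# Uniqueness of `I⁺`-regular stationary axisymmetric vacuum black holes — proofs file

Companion (proofs-only) file of `Literature.Geometry.Lorentzian.AxisymmetricBlackHoleUniqueness`,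
which vendors Chruściel–Costa–Heusler's axisymmetric uniqueness theorem (*Stationary black holes:
uniqueness and beyond*, Living Rev. Relativity 15 (2012) 7 = arXiv:1205.6112, **Theorem 3.2**,
§3.2.7) as the named fact `ChruscielCostaHeusler2012_axisymmetricUniqueness`. The theorem itself is
not proved in the tree: its printed proof (loc. cit. §3.2.1–§3.2.6; Chruściel–Costa, Astérisque 321
(2008) = arXiv:0806.0016, §§4–7) is the chain "smoothness of `𝓔⁺` (Chruściel–Delay–Galloway–Howard)
→ horizon topology and simple connectedness of `⟨⟨M_ext⟩⟩` (topological censorship) → structure of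
the orbit space of the `ℝ × U(1)` action (Orlik, Raymond) → circularity (Papapetrou, Kundt–Trümper)
and Carter's reduction with global Weyl coordinates `(ρ, z)`, non-negativity of the area function and
absence of prehorizons in `⟨⟨M_ext⟩⟩` (Chruściel–Costa Thms. 5.4, 5.6; Chruściel–Galloway 2010)
→ uniqueness for the singular harmonic-map problem into `ℍ²` (Robinson, Bunting–Mazur, Weinstein,
Chruściel–Li–Weinstein) → the Weinstein/Kerr candidate metrics", none of which is a theorem of the
tree (Mathlib has no Lorentzian geometry). This file collects the first steps of Chruściel–Costa's
§5 ("Stationary axisymmetric black hole space-times: the area function") which *are* provable on the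
Lorentz prelude, for the four-dimensional case `s = 2` of their commutative isometry group
`ℝ × 𝕋^{s-1}` with Killing generators `K₀ = T` (stationary) and `K₁ = Y` (axial, `2π`-periodic):

* **causal character of an axial Killing field.** Chruściel–Costa work throughout §5.2 under the
  standing assumption "the `K_i`'s are spacelike (… away from their zero sets)", which on the
  domain of outer communications is a consequence of causality (their footnote: for a torus action
  on a stably causal region the `K_i`'s are tangent to the level sets of an averaged time function).
  We prove the elementary version that needs only strong causality at the point considered: along
  an integral curve of a Killing field `Y` the causal character *and the time orientation* of `Y`
  are constant (`IsKillingField.isFutureDirected_apply_of_isMIntegralCurve`), so a non-trivial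
  closed orbit through a point where `Y` is causal is a closed causal curve; hence at a strongly
  causal point of a `T`-periodic orbit (`T > 0`) the field is spacelike or zero
  (`IsKillingField.isSpacelike_apply_of_periodic_of_isStronglyCausalAt`). For an `I⁺`-regular
  stationary AF black hole (strong causality holds on `⟨⟨M_ext⟩⟩`, Chruściel–Costa Def. 1.1) and an
  axisymmetric Killing field `Y` (`Spacetime.IsAxisymmetricKilling`: complete, all orbits
  `2π`-periodic) this gives: **`Y` is spacelike or zero at every point of `⟨⟨M_ext⟩⟩`**, i.e.
  `{g(Y, Y) = 0} ∩ ⟨⟨M_ext⟩⟩` is the axis `{Y = 0} ∩ ⟨⟨M_ext⟩⟩`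
  (`StationaryAFBlackHole.isSpacelike_of_isAxisymmetricKilling_of_mem_doc`,
  `….val_self_nonneg_of_isAxisymmetricKilling_of_mem_doc`,
  `….val_self_eq_zero_iff_of_isAxisymmetricKilling_of_mem_doc`);
* **the area function** `W := -det (g(K_μ, K_ν))_{μ,ν=0,1} = g(T, Y)² - g(T, T) g(Y, Y)`
  (Chruściel–Costa (5.1)): "The function `W` is clearly positive in a region where `K₀` is timelike
  and `K₁` is spacelike, in particular it is non-negative on `M_ext`" (loc. cit. p. 18) — pointwise
  `W ≥ 0` wherever `T` is timelike (reverse Cauchy–Schwarz), `W > 0` where moreover `Y` is spacelike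
  and non-zero, `W = 0` on the axis; whence `W ≥ 0` on `M_ext`, with `W > 0` on `M_ext` off the axis,
  for an `I⁺`-regular stationary AF black hole with an axisymmetric Killing field
  (`StationaryAFBlackHole.areaFunction_nonneg_of_mem_Mext`, `….areaFunction_pos_of_mem_Mext`).
  The area function is written out explicitly (no new definition is introduced);
* **invariance under the group.** For commuting Killing fields `T`, `Y` (`[T, Y] = 0`, part of the
  hypothesis `IsStationaryAxisymmetric`) the Gram matrix `g(K_μ, K_ν)` and hence `W` are constant
  along the integral curves of `T` and of `Y` — they are functions on the orbit space of
  `ℝ × U(1)`, the starting point of Carter's reduction (Chruściel–Costa §5.2, §6.2–6.4): metric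
  compatibility and torsion-freeness of the Levi-Civita connection (`∇_T Y = ∇_Y T`) reduce the four
  derivatives `T g(Y,Y)`, `T g(T,Y)`, `Y g(T,T)`, `Y g(T,Y)` to instances of the Killing equation
  (`IsKillingField.gram_apply_eq_of_isMIntegralCurve_left/right`,
  `StationaryAFBlackHole.gram_invariant_of_isAxisymmetricKilling`,
  `….areaFunction_invariant_of_isAxisymmetricKilling`);
* **the null vector `ℓ` of the orbit planes** (proof of Chruściel–Costa's Thm. 5.8,
  `ℓ = K₀ - h^{ij} g(K₀, K_j) K_i`; here `ℓ = T - (g(T, Y)/g(Y, Y)) Y`): pointwise, `ℓ ⊥ Y`,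
  `g(ℓ, ℓ) g(Y, Y) = -W`, so that off the axis `ℓ` is null exactly on `{W = 0}` and timelike exactly
  on `{W > 0}`; `W = 0` on `𝒵_dgt = {T ∧ Y = 0}` and `W ≠ 0` forces `T, Y` linearly independent
  (`LorentzianMetric.val_ell_apply_eq_zero`, `….val_ell_self_mul_eq_neg_areaFunction`,
  `….val_ell_self_eq_zero_iff`, `….isTimelike_ell_iff_areaFunction_pos`,
  `….linearIndependent_of_areaFunction_ne_zero`,
  `StationaryAFBlackHole.ell_orthogonal_and_causalCharacter_of_mem_doc`,
  `….areaFunction_eq_zero_iff_of_mem_Mext`, `….linearIndependent_killing_axial_of_mem_Mext`);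
* **constant combinations of commuting Killing fields commute with both** (the frozen-coefficient
  field `ℓ_p` of Thm. 5.8 and the candidate horizon fields `K₀ + Ω K₁` of §4.4; that they are Killing
  is `IsKillingField.linearCombination` of `KillingAlgebraAsymptoticallyFlat.lean`):
  `mlieBracket_combination_left/right`, `IsKillingField.mlieBracket_combination_eq_zero`;
* **off the ergoset and on the axis** (Chruściel–Costa §5.3): `W ≥ 0` wherever `g(T, T) ≤ 0` and
  `Y` is spacelike, hence on `⟨⟨M_ext⟩⟩` away from the open ergoregion — the content of Thms.
  5.1/5.4 lies in the ergoset `E = {g(K₀, K₀) ≥ 0}` ((5.37)); and at the zeros of `Y`: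
  `∇_T Y = 0`, `g(∇_v Y, T) = 0` ("`X^α ∇_ν Y_α|_𝒜 = 0`") and `∇W|_𝒜 = 0` (p. 25), the opening
  of the proof of Lemma 5.23 / the Ergoset Theorem 5.24
  (`LorentzianMetric.areaFunction_nonneg_of_val_self_nonpos_of_isSpacelike`,
  `IsKillingField.leviCivita_apply_eq_zero_of_apply_eq_zero`,
  `….val_leviCivita_apply_eq_zero_of_apply_eq_zero`,
  `….mfderiv_areaFunction_eq_zero_of_apply_eq_zero`,
  `StationaryAFBlackHole.areaFunction_nonneg_of_mem_doc_of_val_killing_nonpos`,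
  `….axis_leviCivita_and_mfderiv_areaFunction`).

* **the `ℝ × U(1)` action on `⟨⟨M_ext⟩⟩`, `𝓑`, `𝓔⁺`** (Chruściel–Costa §3, p. 9: "a commutative
  group of isometries `ℝ × 𝕋^{s-1}`"; §6.1): the axial field generates a `2π`-periodic global flow
  `ψ` by time-orientation-preserving isometries commuting with the stationary flow `φ`
  (`StationaryAFBlackHole.exists_axial_flow`, `….flow_comm_and_axis_fixed`), the axis is
  `φ`-invariant (`….apply_flow_eq_zero_iff`, `….image_flow_axis`), and — for ANY Killing field `K`
  with `[T, K] = 0` and complete flow `ψ`, with no asymptotic hypothesis — `ψₛ(M_ext) ⊆ ⟨⟨M_ext⟩⟩`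
  (`….flow_apply_mem_doc_of_mem_Mext`: `T` stays future timelike along `s ↦ ψₛ p`, while on the
  `φ`-invariant achronal boundaries `𝓗^± = ∂I^∓(M_ext)` it cannot be, Hawking–Ellis Prop. 6.3.1;
  a clopen argument in `s`), whence `ψₛ(I^±(M_ext)) = I^±(M_ext)`, `ψₛ(⟨⟨M_ext⟩⟩) = ⟨⟨M_ext⟩⟩`,
  `ψₛ(𝓑) = 𝓑`, `ψₛ(𝓔⁺) = 𝓔⁺` (`….image_flow_chronological`, `….image_flow_doc`,
  `….image_flow_blackHoleRegion`, `….image_flow_horizon`, `….flow_mem_iff`,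
  `….exists_axial_flow_preserving`) and `K` is nowhere timelike on `𝓗^±`
  (`….not_isTimelike_of_mem_frontier`, `….not_isTimelike_of_mem_horizon`). In the source the
  invariance of `⟨⟨M_ext⟩⟩` under the axial flows rests on the asymptotics of Killing vectors
  (Chruściel–Maerten; §4.2, p. 13); the earlier conditional forms `…_of_image_Mext` are kept;
* **Chruściel–Costa's §3 for the group `ℝ × U(1)`**: for the Killing fields `K = a T + b Y`,
  `a > 0` (`K₀ + Σ αᵢ Kᵢ` in the source), with flow `Φₜ = φ_{a t} ∘ ψ_{b t}`
  (`….exists_combination_flow`): the orbits through `M_ext` are future-oriented — **Lemma 3.4**,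
  by periodicity, `φ_τ[K₀ + Y] = φ_τ[K₀] ∘ φ_τ[Y] = φ_τ[K₀]` when `φ_τ[Y] = id`
  (`….apply_mem_chronologicalFuture_of_isMIntegralCurve_combination`), and so are those through
  `⟨⟨M_ext⟩⟩` — **Lemma 3.5** (`….exists_pos_apply_mem_chronologicalFuture_of_mem_doc_combination`);
  **Lemma 3.6** — a
  `K`-invariant set `C` meeting `I^±(M_ext)` has `M_ext ⊆ I^∓(C)`
  (`….Mext_subset_chronologicalPast/Future_of_combination_invariant`); **Lemma 3.7** — no
  non-empty `K`-invariant set in a compact subset of a chronological `⟨⟨M_ext⟩⟩`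
  (`….not_nonempty_combination_invariant_subset_compact`); **Corollary 3.8** — `K` has no zeros in
  `⟨⟨M_ext⟩⟩`, in particular the candidate horizon Killing fields `T + Ω Y` of an `I⁺`-regular
  stationary-axisymmetric hole have none (`….combination_apply_ne_zero_of_mem_doc`,
  `….IsIPlusRegular.killing_add_smul_ne_zero_of_mem_doc`); whence on `⟨⟨M_ext⟩⟩` the fields `T`, `Y`
  are linearly independent off the axis ("`𝒵̃ ∩ ⟨⟨M_ext⟩⟩ = 𝒵_dgt ∩ ⟨⟨M_ext⟩⟩`", §5.2, p. 19;
  `….IsIPlusRegular.linearIndependent_killing_axial_of_mem_doc`) and the orbits of `a T + b Y`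
  through `⟨⟨M_ext⟩⟩` are lines (`….IsIPlusRegular.injective_of_isMIntegralCurve_combination`);
* **`W ≤ 0` on the event horizons** `𝓗^± ⊇ ∂⟨⟨M_ext⟩⟩`, unconditionally (no `T + Ω Y` is timelike
  there, so the discriminant of `Ω ↦ g(T + Ω Y, T + Ω Y)` is non-positive:
  `LorentzianMetric.areaFunction_nonpos_of_forall_not_isTimelike`,
  `StationaryAFBlackHole.areaFunction_nonpos_of_mem_frontier/horizon/frontier_doc`), and hence
  **`W = 0` at the horizon points in the closure of the non-ergo part `{g(T,T) ≤ 0}` of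
  `⟨⟨M_ext⟩⟩`** (`….areaFunction_eq_zero_of_mem_horizon_of_mem_closure`) — the provable part of the
  boundary clause "`W` vanishing on `∂⟨⟨M_ext⟩⟩ ∪ 𝒵̃`" of Thms. 5.1/5.4;
* **the axial field on the open asymptotic region** (`isOpen_Mext`, `StationaryAsymptoticRegionOpen.lean`):
  `Y ≢ 0` on `M_ext` and `W > 0` somewhere in `M_ext` (`StationaryAFBlackHole.exists_mem_Mext_apply_ne_zero`,
  `….exists_mem_Mext_areaFunction_pos`; Chruściel–Costa §5, p. 18);
* **the linear isotropy at axis points** (Chruściel–Costa §6.1; Beig–Chruściel 1997, Thm. 1.1 (3)):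
  `∇Y(p) ≠ 0` at the zeros of `Y` (one-jet rigidity), `exp(2π ∇Y(p)) = 1` (periodic isotropy
  `dψₛ|_p = exp(s ∇Y(p))`), `exp(s ∇Y(p)) T_p = T_p`
  (`StationaryAFBlackHole.leviCivita_ne_zero_of_apply_eq_zero`, `….exp_two_pi_smul_leviCivita_eq_one`,
  `….exp_smul_leviCivita_apply_killing`); and along `𝓗^±` the orbit planes contain no timelike
  vector, `T` itself being nowhere timelike there (`….not_isTimelike_combination_of_mem_frontier`,
  `….not_isTimelike_killing_of_mem_horizon`);
* **Thm. 3.2 under the printed symmetry hypothesis** "a second Killing vector field"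
  (`ChruscielCostaHeusler2012_axisymmetricUniqueness.of_secondKilling`, via the named fact
  `BeigChrusciel1997_axisymmetricCombination` of `KillingAlgebraAsymptoticallyFlat.lean`).

The deep part of §5 — `W ≥ 0` on all of `⟨⟨M_ext⟩⟩`, vanishing exactly on `∂⟨⟨M_ext⟩⟩ ∪ {Y = 0}`
(Thms. 5.1–5.2, 5.4, 5.6) — is not attempted here.

## References

* P. T. Chruściel, J. L. Costa, M. Heusler, *Stationary black holes: uniqueness and beyond*,
  Living Rev. Relativity 15 (2012) 7, arXiv:1205.6112, §3.2.1 (p. 10), Thm. 3.2 (§3.2.7, p. 11)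
  (key `ChruscielCostaHeusler2012`).
* P. T. Chruściel, J. L. Costa, *On uniqueness of stationary vacuum black holes*, Astérisque 321
  (2008) 195–265, arXiv:0806.0016, Def. 1.1, §3 (p. 9: the group `ℝ × 𝕋^{s-1}`; Lemmas 3.4, 3.6,
  3.7, Cor. 3.8, pp. 9–10), §4.1–4.2 (p. 13), §5 (p. 18: (5.1) and the sentence following it),
  §5.2 (p. 19: "the `K_i`'s are spacelike" and footnote), §6.1 (key `ChruscielCosta2008`).
* B. O'Neill, *Semi-Riemannian geometry*, Academic Press 1983, Ch. 5, Prop. 5.30 (reverse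
  Cauchy–Schwarz), Ch. 9, Prop. 9.25 (Killing equation), Ch. 14, Def. 14.11 (strong causality)
  (key `ONeillSemiRiemannian1983`).
* S. W. Hawking, G. F. R. Ellis, *The large scale structure of space-time*, CUP 1973, §6.3,
  Prop. 6.3.1 (achronal boundaries) (key `HawkingEllis1973`).
* J. M. Lee, *Introduction to Smooth Manifolds*, 2nd ed., Springer 2013, Thms. 9.42, 9.44
  (invariance under flows, commuting flows) (key `LeeSmoothManifolds2013`).
-/

noncomputable section

open Bundle Set Manifold
open scoped ContDiff Topology Manifold

universe u

namespace Literature.Geometry.Lorentzian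

section KillingOrbits

variable {E : Type*} [NormedAddCommGroup E] [NormedSpace ℝ E] {H : Type*} [TopologicalSpace H]
  {I : ModelWithCorners ℝ E H} {M : Type*} [TopologicalSpace M] [ChartedSpace H M]
  [IsManifold I ∞ M] {n : ℕ∞ω}

/-! ### A vector field does not acquire zeros along its own integral curves -/

/-- **A `C¹` vector field which is non-zero at the initial point of an integral curve is non-zero
all along it** (Hausdorff manifold without boundary): if `X (γ t) = 0`, the constant curve at
`γ t` is the integral curve through that point, so by uniqueness of integral curves (flow law
`apply_eq_apply_add_of_isMIntegralCurve`) `γ` is constant and `X (γ 0) = X (γ t) = 0`. Used below in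
the form: the axial Killing field has no zeros on a non-trivial orbit (Chruściel–Costa 2008, §6.1:
the isotropy groups of the `U(1)` action are trivial or all of `U(1)`). [folklore] -/
theorem apply_ne_zero_of_isMIntegralCurve [T2Space M] [BoundarylessManifold I M]
    {X : Π x : M, TangentSpace I x} (hX : CMDiff 1 (T% X)) {γ : ℝ → M}
    (hγ : IsMIntegralCurve γ X) (h0 : X (γ 0) ≠ 0) (t : ℝ) : X (γ t) ≠ 0 := by
  intro ht
  have key : γ t = γ (-t + t) :=
    apply_eq_apply_add_of_isMIntegralCurve (s := t) hX hγ (isMIntegralCurve_const ht) rfl (-t)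
  rw [neg_add_cancel] at key
  rw [key] at ht
  exact h0 ht

/-! ### Causal character and time orientation are constant along Killing orbits

The Killing notion is `PseudoRiemannianMetric.IsKillingField` (for a Lorentzian metric `g`,
`g.IsKillingField` is that of `g.toPseudoRiemannianMetric`), so the statements about Killing fields
of a *time-oriented Lorentzian* metric below are placed in the namespace
`PseudoRiemannianMetric.IsKillingField` for the sake of dot notation. -/

namespace PseudoRiemannianMetric

variable [FiniteDimensional ℝ E] [CompleteSpace E] [Fact (1 ≤ n)]
  {g : LorentzianMetric I n M} [g.HasLeviCivita] {τ : TimeOrientation g}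
  {Y : Π x : M, TangentSpace I x}

omit [FiniteDimensional ℝ E] [CompleteSpace E] in
/-- A Killing field of a `C^n` metric, `n ≥ 1`, is a `C¹` section (it is `C^n`). O'Neill 1983,
Ch. 9, Def. 9.22. [cite: ONeillSemiRiemannian1983, Ch. 9, Def. 9.22] -/
theorem IsKillingField.contMDiff_one (hY : g.IsKillingField Y) : CMDiff 1 (T% Y) :=
  hY.contMDiff.of_le Fact.out

/-- **Along a Killing orbit the field stays future-directed.** Let `Y` be a Killing field and `γ` an
integral curve of `Y` (Hausdorff manifold without boundary). If `Y (γ 0)` is future-directed causal,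
then so is `Y (γ t)` for every `t`: `g(Y, Y)` is constant along `γ` (Killing equation,
`IsKillingField.val_self_apply_eq_of_isMIntegralCurve`) and `Y` has no zero on `γ`
(`apply_ne_zero_of_isMIntegralCurve`), so `Y (γ t)` is causal for all `t`; the continuous function
`t ↦ g(τ, Y)(γ t)` never vanishes (a causal vector is never orthogonal to the timelike orienting
field, O'Neill 1983, Ch. 5, Lemma 5.26) and is negative at `t = 0`, hence negative everywhere
(intermediate value theorem on `ℝ`). This is the infinitesimal content of "the orbits of a Killing
field have constant causal type", as used for the axial field in Chruściel–Costa 2008, §5.2 (p. 19)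
and §6.1. [cite: ONeillSemiRiemannian1983, Ch. 5, Lemma 5.26 and Ch. 9, Prop. 9.25] -/
theorem IsKillingField.isFutureDirected_apply_of_isMIntegralCurve [T2Space M]
    [BoundarylessManifold I M] (hY : g.IsKillingField Y) {γ : ℝ → M} (hγ : IsMIntegralCurve γ Y)
    (h0 : τ.IsFutureDirected (Y (γ 0))) (t : ℝ) : τ.IsFutureDirected (Y (γ t)) := by
  have hcausal : ∀ s, g.IsCausal (Y (γ s)) := fun s ↦
    ⟨by
      rw [hY.val_self_apply_eq_of_isMIntegralCurve hγ s 0]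
      exact h0.1.1,
     apply_ne_zero_of_isMIntegralCurve hY.contMDiff_one hγ h0.1.2 s⟩
  set f : ℝ → ℝ := fun s ↦ g.val (γ s) (τ.vectorField (γ s)) (Y (γ s)) with hf
  have h1 : Continuous fun x : M ↦ g.val x (τ.vectorField x) (Y x) :=
    continuous_iff_continuousAt.2 fun x ↦
      (g.contMDiffAt_val_apply le_rfl (τ.contMDiff x) (hY.contMDiff x)).continuousAt
  have hfc : Continuous f := h1.comp hγ.continuous
  have hfne : ∀ s, f s ≠ 0 := fun s ↦
    g.val_ne_zero_of_isTimelike_of_isCausal (τ.isTimelike _) (hcausal s)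
  have hf0 : f 0 < 0 := h0.2
  refine ⟨hcausal t, ?_⟩
  by_contra hft
  have hft' : 0 ≤ f t := le_of_not_gt hft
  have hmem : (0 : ℝ) ∈ Set.Icc (f 0) (f t) := ⟨hf0.le, hft'⟩
  obtain ⟨s, hs⟩ := intermediate_value_univ (a := 0) (b := t) hfc hmem
  exact hfne s hs

/-- **Along a Killing orbit the field stays past-directed** (the previous statement for the reversed
time orientation). O'Neill 1983, Ch. 5, Lemma 5.26 and p. 145. [cite: ONeillSemiRiemannian1983, Ch. 5, Lemma 5.26 and p. 145] -/
theorem IsKillingField.isPastDirected_apply_of_isMIntegralCurve [T2Space M]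
    [BoundarylessManifold I M] (hY : g.IsKillingField Y) {γ : ℝ → M} (hγ : IsMIntegralCurve γ Y)
    (h0 : τ.IsPastDirected (Y (γ 0))) (t : ℝ) : τ.IsPastDirected (Y (γ t)) := by
  rw [← TimeOrientation.isFutureDirected_reverse_iff] at h0 ⊢
  exact hY.isFutureDirected_apply_of_isMIntegralCurve hγ h0 t

/-! ### Closed Killing orbits through strongly causal points are spacelike -/

/-- **A Killing field with a closed orbit through a strongly causal point is spacelike (or zero)
there.** Let `Y` be a Killing field, `γ` an integral curve of `Y` which is `T`-periodic for some
`T > 0`, and suppose strong causality holds at `γ 0` (Hausdorff manifold without boundary). Then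
`Y (γ 0)` is spacelike or zero. Otherwise `Y (γ 0)` is causal, hence future- or past-directed;
in the first case `Y` is future-directed all along `γ`
(`isFutureDirected_apply_of_isMIntegralCurve`), so `γ|[0, T]` is a closed future causal curve
through `γ 0`, which strong causality at `γ 0` forbids
(`IsStronglyCausalAt.apply_ne_of_isFutureCausalCurveOn`); in the second case the same holds for the
reversed curve `t ↦ γ (-t)`, an integral curve of `-Y`. This is why the axial Killing field of a
stationary axisymmetric space-time is spacelike away from its zero set on any strongly causal
(e.g. globally hyperbolic) region — the standing assumption "the `K_i`'s are spacelike" of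
Chruściel–Costa 2008, §5.2 (p. 19, with the footnote on torus actions on stably causal manifolds),
on the domain of outer communications. [cite: ChruscielCosta2008, §5.2 (p. 19, "the K_i's are spacelike", footnote)] -/
theorem IsKillingField.isSpacelike_apply_of_periodic_of_isStronglyCausalAt [T2Space M]
    [BoundarylessManifold I M] (hY : g.IsKillingField Y) {γ : ℝ → M} (hγ : IsMIntegralCurve γ Y)
    {T : ℝ} (hT : 0 < T) (hper : Function.Periodic γ T) (hsc : g.IsStronglyCausalAt τ (γ 0)) :
    g.IsSpacelike (Y (γ 0)) := by
  rw [g.isSpacelike_iff_not_isCausal]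
  intro hc
  rcases τ.isFutureDirected_or_isPastDirected_of_isCausal hc with hfut | hpast
  · -- `γ|[0, T]` is a closed future causal curve through `γ 0`
    have hcurve : g.IsFutureCausalCurveOn τ γ (Set.Icc 0 T) := fun t _ ↦
      ⟨(hγ t).mdifferentiableAt, by
        rw [velocity_eq_of_isMIntegralCurve hγ t]
        exact hY.isFutureDirected_apply_of_isMIntegralCurve hγ hfut t⟩
    have hclosed : γ T = γ 0 := by simpa using hper 0
    exact hsc.apply_ne_of_isFutureCausalCurveOn hT hcurve rfl hclosed
  · -- the reversed curve `t ↦ γ (-t)`, an integral curve of `-Y`, is a closed future causal curve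
    have hδ : IsMIntegralCurve (γ ∘ (· * (-1 : ℝ))) ((-1 : ℝ) • Y) := hγ.comp_mul (-1)
    have hcurve : g.IsFutureCausalCurveOn τ (γ ∘ (· * (-1 : ℝ))) (Set.Icc 0 T) := fun t _ ↦
      ⟨(hδ t).mdifferentiableAt, by
        rw [velocity_eq_of_isMIntegralCurve hδ t, Pi.smul_apply, neg_one_smul,
          TimeOrientation.isFutureDirected_neg_iff]
        exact hY.isPastDirected_apply_of_isMIntegralCurve hγ hpast _⟩
    have h0 : (γ ∘ (· * (-1 : ℝ))) 0 = γ 0 := by simp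
    have hclosed : (γ ∘ (· * (-1 : ℝ))) T = γ 0 := by
      have h := hper (-T)
      rw [neg_add_cancel] at h
      simpa using h.symm
    exact hsc.apply_ne_of_isFutureCausalCurveOn hT hcurve h0 hclosed

end PseudoRiemannianMetric

/-! ### Functions annihilated by a vector field are constant along its integral curves -/

omit [IsManifold I ∞ M] in
/-- If a real function `f` on `M` is differentiable and `df(X) = 0` everywhere, then `f` is
constant along every integral curve `γ` of `X`: `(f ∘ γ)' = df_{γ t}(γ' t) = df(X)(γ t) = 0`
(chain rule `hasDerivAt_comp_curve`; Mathlib's `is_const_of_deriv_eq_zero`). This is the mechanism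
by which group-invariant functions descend to the orbit space (Chruściel–Costa 2008, §6.2–6.4).
[folklore] -/
theorem apply_eq_apply_of_isMIntegralCurve_of_mvfderiv_eq_zero {X : Π x : M, TangentSpace I x}
    {f : M → ℝ} (hf : ∀ x, MDiffAt f x) (h0 : ∀ x, mvfderiv I f x (X x) = 0) {γ : ℝ → M}
    (hγ : IsMIntegralCurve γ X) (s t : ℝ) : f (γ s) = f (γ t) := by
  have hd : ∀ t, HasDerivAt (fun t' ↦ f (γ t')) 0 t := by
    intro t
    have h1 := hasDerivAt_comp_curve (hf (γ t)) (hγ t).mdifferentiableAt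
    rw [velocity_eq_of_isMIntegralCurve hγ t] at h1
    have h2 : mfderiv I 𝓘(ℝ, ℝ) f (γ t) (X (γ t)) = 0 := h0 (γ t)
    rwa [h2] at h1
  exact is_const_of_deriv_eq_zero (fun t ↦ (hd t).differentiableAt) (fun t ↦ (hd t).deriv) s t

/-! ### Commuting Killing fields: the Gram matrix `g(K_μ, K_ν)` is invariant under both flows
(Chruściel–Costa 2008, §5.2 and §6.2–6.4: the metric functions of a stationary axisymmetric
space-time are functions on the orbit space of the abelian group `ℝ × U(1)`) -/

namespace PseudoRiemannianMetric

variable [FiniteDimensional ℝ E] [CompleteSpace E] [Fact (1 ≤ n)]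
  {g : PseudoRiemannianMetric I n E (TangentSpace I : M → Type _)} [g.HasLeviCivita]
  {T Y : Π x : M, TangentSpace I x} {x : M}

/-- **Commuting vector fields have symmetric covariant derivatives**: if `[T, Y](x) = 0` then
`∇_T Y = ∇_Y T` at `x` (for `T`, `Y` differentiable at `x`), by the torsion-freeness of the
Levi-Civita connection, `∇_T Y - ∇_Y T = [T, Y]` (`isLeviCivita_leviCivita_holds`, Mathlib's
`CovariantDerivative.torsion_eq_zero_iff`; recall `cov Y x (T x) = ∇_T Y`). O'Neill 1983, Ch. 3,
Thm. 3.11 (D3). [cite: ONeillSemiRiemannian1983, Ch. 3, Thm. 3.11] -/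
theorem leviCivita_apply_comm_of_mlieBracket_eq_zero (hT : MDiffAt (T% T) x)
    (hY : MDiffAt (T% Y) x) (hTY : VectorField.mlieBracket I T Y x = 0) :
    g.leviCivita Y x (T x) = g.leviCivita T x (Y x) := by
  have hLC : g.IsLeviCivita g.leviCivita := isLeviCivita_leviCivita_holds
  have h := g.leviCivita.torsion_eq_zero_iff.1 hLC.1 hT hY
  rw [hTY, sub_eq_zero] at h
  exact h

/-- **`T g(Y, Y) = 0` for commuting Killing fields.** If `T`, `Y` are Killing fields with
`[T, Y] = 0`, then the derivative of `g(Y, Y)` along `T` vanishes: by metric compatibility it is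
`2 g(∇_T Y, Y) = 2 g(∇_Y T, Y)` (`∇_T Y = ∇_Y T`), which is zero by the Killing equation for `T`.
Hence `g(Y, Y)` is invariant under the flow of `T` — for the stationary and axial Killing fields of a
stationary axisymmetric space-time, the norm of the axial field is a function on the orbit space
(Chruściel–Costa 2008, §6.2–6.4; Heusler 1996, Ch. 2). [cite: ChruscielCosta2008, §6.4 (the metric functions depend on the orbit-space coordinates only)] -/
theorem IsKillingField.mvfderiv_val_apply_self_eq_zero_of_mlieBracket_eq_zero
    (hT : g.IsKillingField T) (hY : g.IsKillingField Y)
    (hTY : ∀ x, VectorField.mlieBracket I T Y x = 0) (x : M) :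
    mvfderiv I (fun y ↦ g.val y (Y y) (Y y)) x (T x) = 0 := by
  have hLC : g.IsLeviCivita g.leviCivita := isLeviCivita_leviCivita_holds
  have hTd : MDiffAt (T% T) x := hT.mdifferentiableAt x
  have hYd : MDiffAt (T% Y) x := hY.mdifferentiableAt x
  rw [hLC.2 hTd hYd hYd, leviCivita_apply_comm_of_mlieBracket_eq_zero hTd hYd (hTY x)]
  exact hT.val_leviCivita_add x (Y x) (Y x)

/-- **`T g(T, Y) = 0` for commuting Killing fields**: by compatibility the derivative is
`g(∇_T T, Y) + g(T, ∇_T Y) = g(∇_T T, Y) + g(T, ∇_Y T)`, the Killing equation for `T` evaluated on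
`(T, Y)`. Chruściel–Costa 2008, §6.2–6.4. [cite: ChruscielCosta2008, §6.4 (the metric functions depend on the orbit-space coordinates only)] -/
theorem IsKillingField.mvfderiv_val_self_apply_eq_zero_of_mlieBracket_eq_zero
    (hT : g.IsKillingField T) (hY : g.IsKillingField Y)
    (hTY : ∀ x, VectorField.mlieBracket I T Y x = 0) (x : M) :
    mvfderiv I (fun y ↦ g.val y (T y) (Y y)) x (T x) = 0 := by
  have hLC : g.IsLeviCivita g.leviCivita := isLeviCivita_leviCivita_holds
  have hTd : MDiffAt (T% T) x := hT.mdifferentiableAt x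
  have hYd : MDiffAt (T% Y) x := hY.mdifferentiableAt x
  rw [hLC.2 hTd hTd hYd, leviCivita_apply_comm_of_mlieBracket_eq_zero hTd hYd (hTY x)]
  exact hT.val_leviCivita_add x (T x) (Y x)

/-- **`Y g(T, T) = 0` for commuting Killing fields**: the derivative is
`2 g(∇_Y T, T) = 2 g(∇_T Y, T)`, zero by the Killing equation for `Y`. Chruściel–Costa 2008,
§6.2–6.4 (the norm `-V²` of the stationary field is a function on the orbit space).
[cite: ChruscielCosta2008, §6.4 (the metric functions depend on the orbit-space coordinates only)] -/
theorem IsKillingField.mvfderiv_val_self_self_eq_zero_of_mlieBracket_eq_zero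
    (hT : g.IsKillingField T) (hY : g.IsKillingField Y)
    (hTY : ∀ x, VectorField.mlieBracket I T Y x = 0) (x : M) :
    mvfderiv I (fun y ↦ g.val y (T y) (T y)) x (Y x) = 0 := by
  have hLC : g.IsLeviCivita g.leviCivita := isLeviCivita_leviCivita_holds
  have hTd : MDiffAt (T% T) x := hT.mdifferentiableAt x
  have hYd : MDiffAt (T% Y) x := hY.mdifferentiableAt x
  rw [hLC.2 hYd hTd hTd, ← leviCivita_apply_comm_of_mlieBracket_eq_zero hTd hYd (hTY x)]
  exact hY.val_leviCivita_add x (T x) (T x)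

/-- **`Y g(T, Y) = 0` for commuting Killing fields**: the derivative is
`g(∇_Y T, Y) + g(T, ∇_Y Y) = g(∇_T Y, Y) + g(T, ∇_Y Y)`, the Killing equation for `Y` evaluated on
`(T, Y)`. Chruściel–Costa 2008, §6.2–6.4. [cite: ChruscielCosta2008, §6.4 (the metric functions depend on the orbit-space coordinates only)] -/
theorem IsKillingField.mvfderiv_val_apply_eq_zero_of_mlieBracket_eq_zero
    (hT : g.IsKillingField T) (hY : g.IsKillingField Y)
    (hTY : ∀ x, VectorField.mlieBracket I T Y x = 0) (x : M) :
    mvfderiv I (fun y ↦ g.val y (T y) (Y y)) x (Y x) = 0 := by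
  have hLC : g.IsLeviCivita g.leviCivita := isLeviCivita_leviCivita_holds
  have hTd : MDiffAt (T% T) x := hT.mdifferentiableAt x
  have hYd : MDiffAt (T% Y) x := hY.mdifferentiableAt x
  rw [hLC.2 hYd hTd hYd, ← leviCivita_apply_comm_of_mlieBracket_eq_zero hTd hYd (hTY x)]
  exact hY.val_leviCivita_add x (T x) (Y x)

/-- **The Gram matrix is invariant under the flow of `T`.** For commuting Killing fields `T`, `Y`
and an integral curve `γ` of `T`, the three functions `g(T, T)`, `g(T, Y)`, `g(Y, Y)` take the same
values at `γ s` and `γ t` (`apply_eq_apply_of_isMIntegralCurve_of_mvfderiv_eq_zero` with the three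
vanishing derivatives above and `IsKillingField.mvfderiv_val_self_apply_self`). Chruściel–Costa
2008, §5.2 and §6.2–6.4 (the matrix `g(K_μ, K_ν)`, its determinant `-W` and the metric functions
are invariant under the isometry group `ℝ × U(1)`). [cite: ChruscielCosta2008, §5.2 and §6.4] -/
theorem IsKillingField.gram_apply_eq_of_isMIntegralCurve_left (hT : g.IsKillingField T)
    (hY : g.IsKillingField Y) (hTY : ∀ x, VectorField.mlieBracket I T Y x = 0) {γ : ℝ → M}
    (hγ : IsMIntegralCurve γ T) (s t : ℝ) :
    g.val (γ s) (T (γ s)) (T (γ s)) = g.val (γ t) (T (γ t)) (T (γ t)) ∧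
      g.val (γ s) (T (γ s)) (Y (γ s)) = g.val (γ t) (T (γ t)) (Y (γ t)) ∧
        g.val (γ s) (Y (γ s)) (Y (γ s)) = g.val (γ t) (Y (γ t)) (Y (γ t)) := by
  refine ⟨hT.val_self_apply_eq_of_isMIntegralCurve hγ s t, ?_, ?_⟩
  · exact apply_eq_apply_of_isMIntegralCurve_of_mvfderiv_eq_zero
      (fun x ↦ g.mdifferentiableAt_val_apply (hT.mdifferentiableAt x) (hY.mdifferentiableAt x))
      (hT.mvfderiv_val_self_apply_eq_zero_of_mlieBracket_eq_zero hY hTY) hγ s t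
  · exact apply_eq_apply_of_isMIntegralCurve_of_mvfderiv_eq_zero
      (fun x ↦ g.mdifferentiableAt_val_apply (hY.mdifferentiableAt x) (hY.mdifferentiableAt x))
      (hT.mvfderiv_val_apply_self_eq_zero_of_mlieBracket_eq_zero hY hTY) hγ s t

/-- **The Gram matrix is invariant under the flow of `Y`** (the same along integral curves of the
second field). Chruściel–Costa 2008, §5.2 and §6.2–6.4. [cite: ChruscielCosta2008, §5.2 and §6.4] -/
theorem IsKillingField.gram_apply_eq_of_isMIntegralCurve_right (hT : g.IsKillingField T)
    (hY : g.IsKillingField Y) (hTY : ∀ x, VectorField.mlieBracket I T Y x = 0) {γ : ℝ → M}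
    (hγ : IsMIntegralCurve γ Y) (s t : ℝ) :
    g.val (γ s) (T (γ s)) (T (γ s)) = g.val (γ t) (T (γ t)) (T (γ t)) ∧
      g.val (γ s) (T (γ s)) (Y (γ s)) = g.val (γ t) (T (γ t)) (Y (γ t)) ∧
        g.val (γ s) (Y (γ s)) (Y (γ s)) = g.val (γ t) (Y (γ t)) (Y (γ t)) := by
  refine ⟨?_, ?_, hY.val_self_apply_eq_of_isMIntegralCurve hγ s t⟩
  · exact apply_eq_apply_of_isMIntegralCurve_of_mvfderiv_eq_zero
      (fun x ↦ g.mdifferentiableAt_val_apply (hT.mdifferentiableAt x) (hT.mdifferentiableAt x))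
      (hT.mvfderiv_val_self_self_eq_zero_of_mlieBracket_eq_zero hY hTY) hγ s t
  · exact apply_eq_apply_of_isMIntegralCurve_of_mvfderiv_eq_zero
      (fun x ↦ g.mdifferentiableAt_val_apply (hT.mdifferentiableAt x) (hY.mdifferentiableAt x))
      (hT.mvfderiv_val_apply_eq_zero_of_mlieBracket_eq_zero hY hTY) hγ s t

/-- **The area function is invariant under the flow of `T`**: for commuting Killing fields `T`, `Y`
the function `W = g(T, Y)² - g(T, T) g(Y, Y)` is constant along every integral curve of `T`.
Chruściel–Costa 2008, §5 ((5.1); `W` is a function on the orbit space, §5.2, §6.2).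
[cite: ChruscielCosta2008, §5 (5.1) and §5.2] -/
theorem IsKillingField.areaFunction_apply_eq_of_isMIntegralCurve_left (hT : g.IsKillingField T)
    (hY : g.IsKillingField Y) (hTY : ∀ x, VectorField.mlieBracket I T Y x = 0) {γ : ℝ → M}
    (hγ : IsMIntegralCurve γ T) (s t : ℝ) :
    g.val (γ s) (T (γ s)) (Y (γ s)) ^ 2 -
        g.val (γ s) (T (γ s)) (T (γ s)) * g.val (γ s) (Y (γ s)) (Y (γ s)) =
      g.val (γ t) (T (γ t)) (Y (γ t)) ^ 2 -
        g.val (γ t) (T (γ t)) (T (γ t)) * g.val (γ t) (Y (γ t)) (Y (γ t)) := by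
  obtain ⟨h1, h2, h3⟩ := hT.gram_apply_eq_of_isMIntegralCurve_left hY hTY hγ s t
  rw [h1, h2, h3]

/-- **The area function is invariant under the flow of `Y`**. Chruściel–Costa 2008, §5 ((5.1),
§5.2). [cite: ChruscielCosta2008, §5 (5.1) and §5.2] -/
theorem IsKillingField.areaFunction_apply_eq_of_isMIntegralCurve_right (hT : g.IsKillingField T)
    (hY : g.IsKillingField Y) (hTY : ∀ x, VectorField.mlieBracket I T Y x = 0) {γ : ℝ → M}
    (hγ : IsMIntegralCurve γ Y) (s t : ℝ) :
    g.val (γ s) (T (γ s)) (Y (γ s)) ^ 2 -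
        g.val (γ s) (T (γ s)) (T (γ s)) * g.val (γ s) (Y (γ s)) (Y (γ s)) =
      g.val (γ t) (T (γ t)) (Y (γ t)) ^ 2 -
        g.val (γ t) (T (γ t)) (T (γ t)) * g.val (γ t) (Y (γ t)) (Y (γ t)) := by
  obtain ⟨h1, h2, h3⟩ := hT.gram_apply_eq_of_isMIntegralCurve_right hY hTY hγ s t
  rw [h1, h2, h3]

/-! ### Constant linear combinations of (commuting) Killing fields

Chruściel–Costa freeze the coefficients of `ℓ_p = K₀ - (h^{ij} g(K₀, K_i))|_p K_j` at the point `p`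
to obtain "the Killing vector field `ℓ_p`" (Thm. 5.8), and the horizon Killing field of a rotating
hole is `K₀ + Ω K₁` (§4.4, §7.1); both rest on: constant-coefficient combinations of Killing fields
are Killing (`PseudoRiemannianMetric.IsKillingField.linearCombination` of
`KillingAlgebraAsymptoticallyFlat.lean`, not imported here; O'Neill 1983, Ch. 9, remark before
Lemma 9.28) and still commute with `K₀`, `K₁`, which is what is proved here. -/

omit [FiniteDimensional ℝ E] [Fact (1 ≤ n)] [g.HasLeviCivita] in
/-- **`[T, a T + b Y] = b [T, Y]`** for sections differentiable at `x` (bilinearity of the Lie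
bracket of vector fields, Mathlib `VectorField.mlieBracket_add_right`,
`mlieBracket_const_smul_right`, and `[T, T] = 0`). O'Neill 1983, Ch. 1, Lemma 18.
[cite: ONeillSemiRiemannian1983, Ch. 1, Lemma 18 (pp. 13–14)] -/
theorem mlieBracket_combination_right (hT : MDiffAt (T% T) x) (hY : MDiffAt (T% Y) x)
    (a b : ℝ) :
    VectorField.mlieBracket I T (a • T + b • Y) x = b • VectorField.mlieBracket I T Y x := by
  rw [VectorField.mlieBracket_add_right hT.smul_const_section hY.smul_const_section,
    VectorField.mlieBracket_const_smul_right hT, VectorField.mlieBracket_const_smul_right hY,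
    VectorField.mlieBracket_self]
  simp

omit [FiniteDimensional ℝ E] [Fact (1 ≤ n)] [g.HasLeviCivita] in
/-- **`[a T + b Y, Y] = a [T, Y]`** for sections differentiable at `x`. O'Neill 1983, Ch. 1,
Lemma 18. [cite: ONeillSemiRiemannian1983, Ch. 1, Lemma 18 (pp. 13–14)] -/
theorem mlieBracket_combination_left (hT : MDiffAt (T% T) x) (hY : MDiffAt (T% Y) x)
    (a b : ℝ) :
    VectorField.mlieBracket I (a • T + b • Y) Y x = a • VectorField.mlieBracket I T Y x := by
  rw [VectorField.mlieBracket_add_left hT.smul_const_section hY.smul_const_section,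
    VectorField.mlieBracket_const_smul_left hT, VectorField.mlieBracket_const_smul_left hY,
    VectorField.mlieBracket_self]
  simp

omit [FiniteDimensional ℝ E] in
/-- **A constant combination of two commuting Killing fields commutes with both**: if `T`, `Y` are
Killing with `[T, Y] = 0` then `K = a • T + b • Y` satisfies `[T, K] = 0` and `[K, Y] = 0`
everywhere — the isometry group generated stays abelian (Chruściel–Costa 2008, §5.2: "commuting
Killing vector fields `K_μ`"; Chruściel–Costa–Heusler 2012, §3.2.1). [cite: ChruscielCosta2008, §5.2 (commuting Killing vectors K_μ)] -/
theorem IsKillingField.mlieBracket_combination_eq_zero (hT : g.IsKillingField T)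
    (hY : g.IsKillingField Y) (hTY : ∀ x, VectorField.mlieBracket I T Y x = 0) (a b : ℝ)
    (x : M) :
    VectorField.mlieBracket I T (a • T + b • Y) x = 0 ∧
      VectorField.mlieBracket I (a • T + b • Y) Y x = 0 := by
  constructor
  · rw [mlieBracket_combination_right (hT.mdifferentiableAt x) (hY.mdifferentiableAt x), hTY x,
      smul_zero]
  · rw [mlieBracket_combination_left (hT.mdifferentiableAt x) (hY.mdifferentiableAt x), hTY x,
      smul_zero]

/-! ### On the rotation axis `𝒜 = {Y = 0}` (Chruściel–Costa 2008, §5.3)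

Chruściel–Costa, §5.3 (p. 25 of arXiv:0806.0016), for commuting Killing fields `X = K₀`, `Y = K₁`
with `Y` vanishing on the axis `𝒜`: "`X^α ∇_ν Y_α|_𝒜 = -X^α ∇_α Y_ν + Y^α ∇_α X_ν = -[X, Y]_ν = 0`"
and "We have `∇W|_𝒜 = 0`". Both are pointwise consequences of `[T, Y] = 0`, torsion-freeness, the
Killing equation and `Y p = 0`. -/

/-- **`∇_T Y = 0` on the axis.** For commuting Killing fields `T`, `Y` and a zero `p` of `Y`,
`∇_{T p} Y = ∇_{Y p} T = ∇_0 T = 0` (`leviCivita_apply_comm_of_mlieBracket_eq_zero`).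
Chruściel–Costa 2008, §5.3 (p. 25, the display `X^α ∇_α Y_ν|_𝒜 = [X, Y]_ν + Y^α ∇_α X_ν = 0`).
[cite: ChruscielCosta2008, §5.3 (p. 25, display "X^α∇_νY_α|_𝒜 = … = -[X,Y]_ν = 0")] -/
theorem IsKillingField.leviCivita_apply_eq_zero_of_apply_eq_zero (hT : g.IsKillingField T)
    (hY : g.IsKillingField Y) (hTY : ∀ x, VectorField.mlieBracket I T Y x = 0) {p : M}
    (hp : Y p = 0) : g.leviCivita Y p (T p) = 0 := by
  rw [leviCivita_apply_comm_of_mlieBracket_eq_zero (hT.mdifferentiableAt p) (hY.mdifferentiableAt p)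
    (hTY p), hp, map_zero]

/-- **`X^α ∇_ν Y_α = 0` on the axis**: for commuting Killing fields `T`, `Y` and a zero `p` of `Y`,
`g(∇_v Y, T p) = 0` for every tangent vector `v` at `p` — the Killing equation for `Y` on `(v, T p)`
and `∇_{T p} Y = 0` (`leviCivita_apply_eq_zero_of_apply_eq_zero`). Thus `T p` is `g`-orthogonal to
the range of `∇Y` at axis points (Chruściel–Costa: "`T ∈ Ker ∇Y`"). Chruściel–Costa 2008, §5.3
(p. 25). [cite: ChruscielCosta2008, §5.3 (p. 25, display "X^α∇_νY_α|_𝒜 = … = -[X,Y]_ν = 0")] -/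
theorem IsKillingField.val_leviCivita_apply_eq_zero_of_apply_eq_zero (hT : g.IsKillingField T)
    (hY : g.IsKillingField Y) (hTY : ∀ x, VectorField.mlieBracket I T Y x = 0) {p : M}
    (hp : Y p = 0) (v : TangentSpace I p) : g.val p (g.leviCivita Y p v) (T p) = 0 := by
  have h := hY.val_leviCivita_add p v (T p)
  rw [hT.leviCivita_apply_eq_zero_of_apply_eq_zero hY hTY hp, map_zero, add_zero] at h
  exact h

/-- **`∇W = 0` on the axis.** For commuting Killing fields `T`, `Y` and a zero `p` of `Y`, the
area function `W = g(T, Y)² - g(T, T) g(Y, Y)` has vanishing differential at `p`: by the product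
rule `dW = 2 g(T, Y) d(g(T, Y)) - g(Y, Y) d(g(T, T)) - g(T, T) d(g(Y, Y))`, where at `p` the
factors `g(T, Y)(p) = g(Y, Y)(p) = 0` and `d(g(Y, Y))_p = 2 g(∇Y, Y p) = 0`
(`IsKillingField.mvfderiv_val_self_apply`). Chruściel–Costa 2008, §5.3 (p. 25: "We have
`∇W|_𝒜 = 0`"). [cite: ChruscielCosta2008, §5.3 (p. 25, "∇W|_𝒜 = 0")] -/
theorem IsKillingField.mfderiv_areaFunction_eq_zero_of_apply_eq_zero (hT : g.IsKillingField T)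
    (hY : g.IsKillingField Y) {p : M} (hp : Y p = 0) :
    mfderiv I 𝓘(ℝ, ℝ)
        (fun y ↦ g.val y (T y) (Y y) ^ 2 - g.val y (T y) (T y) * g.val y (Y y) (Y y)) p = 0 := by
  set f : M → ℝ := fun y ↦ g.val y (T y) (Y y) with hf_def
  set h : M → ℝ := fun y ↦ g.val y (T y) (T y) with hh_def
  set k : M → ℝ := fun y ↦ g.val y (Y y) (Y y) with hk_def
  have hfd : MDiffAt f p := g.mdifferentiableAt_val_apply (hT.mdifferentiableAt p) (hY.mdifferentiableAt p)
  have hhd : MDiffAt h p := g.mdifferentiableAt_val_apply (hT.mdifferentiableAt p) (hT.mdifferentiableAt p)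
  have hkd : MDiffAt k p := g.mdifferentiableAt_val_apply (hY.mdifferentiableAt p) (hY.mdifferentiableAt p)
  have hfp : f p = 0 := by simp [hf_def, hp]
  have hkp : k p = 0 := by simp [hk_def, hp]
  have hk0v : ∀ v : TangentSpace I p, mfderiv I 𝓘(ℝ, ℝ) k p v = 0 := by
    intro v
    have h1 : mvfderiv I k p v = 2 * g.val p (g.leviCivita Y p v) (Y p) :=
      hY.mvfderiv_val_self_apply p v
    rw [hp, map_zero, mul_zero] at h1
    exact h1
  have h3 := (hfd.hasMFDerivAt.mul hfd.hasMFDerivAt).sub (hhd.hasMFDerivAt.mul hkd.hasMFDerivAt)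
  have hfun : (fun y ↦ g.val y (T y) (Y y) ^ 2 - g.val y (T y) (T y) * g.val y (Y y) (Y y)) =
      f * f - h * k := by
    funext y
    simp only [hf_def, hh_def, hk_def, Pi.sub_apply, Pi.mul_apply, sq]
  rw [hfun, h3.mfderiv]
  ext v
  simp [hfp, hkp]
  erw [hk0v v, mul_zero, neg_zero]
  rfl

end PseudoRiemannianMetric

/-! ### The area function of two vectors, pointwise (Chruściel–Costa 2008, (5.1)) -/

namespace LorentzianMetric

variable {g : LorentzianMetric I n M}

/-- **`W ≥ 0` where the stationary field is timelike.** For tangent vectors `T₀, Y₀` at `x` with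
`T₀` timelike, the area function `W = g(T₀, Y₀)² - g(T₀, T₀) g(Y₀, Y₀)` — minus the Gram
determinant of `(T₀, Y₀)`, Chruściel–Costa's (5.1) at a point — is non-negative: this is the reverse
Cauchy–Schwarz inequality `g(T₀, T₀) g(Y₀, Y₀) ≤ g(T₀, Y₀)²` (O'Neill 1983, Ch. 5, Prop. 5.30, the
prelude's `mul_le_sq_of_isTimelike`). Chruściel–Costa 2008, §5, (5.1) and the sentence following it.
[cite: ChruscielCosta2008, §5 (5.1) (p. 18)] -/
theorem areaFunction_nonneg_of_isTimelike {x : M} {T₀ : TangentSpace I x} (hT : g.IsTimelike T₀)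
    (Y₀ : TangentSpace I x) :
    0 ≤ g.val x T₀ Y₀ ^ 2 - g.val x T₀ T₀ * g.val x Y₀ Y₀ := by
  have h := g.mul_le_sq_of_isTimelike_holds hT Y₀
  linarith

/-- **`W > 0` where the stationary field is timelike and the axial field is spacelike and
non-zero**: "The function `W` is clearly positive in a region where `K₀` is timelike and `K₁` is
spacelike" (Chruściel–Costa 2008, p. 18): `g(T₀, T₀) < 0 < g(Y₀, Y₀)` gives
`-g(T₀, T₀) g(Y₀, Y₀) > 0`, and `g(T₀, Y₀)² ≥ 0`. [cite: ChruscielCosta2008, §5 (p. 18, sentence after (5.1))] -/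
theorem areaFunction_pos_of_isTimelike_of_isSpacelike {x : M} {T₀ Y₀ : TangentSpace I x}
    (hT : g.IsTimelike T₀) (hY : g.IsSpacelike Y₀) (hY0 : Y₀ ≠ 0) :
    0 < g.val x T₀ Y₀ ^ 2 - g.val x T₀ T₀ * g.val x Y₀ Y₀ := by
  have hYpos : 0 < g.val x Y₀ Y₀ := hY.resolve_right hY0
  have hTneg : g.val x T₀ T₀ < 0 := hT
  nlinarith [sq_nonneg (g.val x T₀ Y₀), mul_pos (neg_pos.2 hTneg) hYpos]

/-- **`W ≥ 0` off the ergoset wherever the axial field is spacelike**: if `g(T₀, T₀) ≤ 0`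
(`T₀` timelike, null or zero — the complement of the open ergoregion `{g(K₀, K₀) > 0}`) and `Y₀` is
spacelike or zero, then `W = g(T₀, Y₀)² - g(T₀, T₀) g(Y₀, Y₀) ≥ 0` (both terms are non-negative).
Hence the content of Chruściel–Costa's Theorems 5.1/5.4 (`W ≥ 0` on all of `⟨⟨M_ext⟩⟩`) lies in the
ergoset `E = {g(K₀, K₀) ≥ 0}` of their §5.3, (5.37). [cite: ChruscielCosta2008, §5 (p. 18) and §5.3 (5.37) (the ergoset)] -/
theorem areaFunction_nonneg_of_val_self_nonpos_of_isSpacelike {x : M} {T₀ Y₀ : TangentSpace I x}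
    (hT : g.val x T₀ T₀ ≤ 0) (hY : g.IsSpacelike Y₀) :
    0 ≤ g.val x T₀ Y₀ ^ 2 - g.val x T₀ T₀ * g.val x Y₀ Y₀ := by
  have hYnn : 0 ≤ g.val x Y₀ Y₀ := by
    rcases hY with h | h
    · exact h.le
    · rw [h]
      simp
  nlinarith [sq_nonneg (g.val x T₀ Y₀), mul_nonneg (neg_nonneg.2 hT) hYnn]

/-- **`W = 0` on the axis**: if `Y₀ = 0` the area function vanishes (Chruściel–Costa 2008, Thm. 5.1:
`W` vanishes on `{g(K₁, K₁) = 0}`, which contains the axis `{K₁ = 0}`). [cite: ChruscielCosta2008, Thm. 5.1 (statement)] -/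
theorem areaFunction_eq_zero_of_eq_zero {x : M} (T₀ : TangentSpace I x) {Y₀ : TangentSpace I x}
    (hY0 : Y₀ = 0) : g.val x T₀ Y₀ ^ 2 - g.val x T₀ T₀ * g.val x Y₀ Y₀ = 0 := by
  subst hY0
  simp

/-- **`W = 0` where the two fields are collinear**: if `Y₀ = c • T₀` the area function vanishes
(`W` is minus the Gram determinant of `(T₀, Y₀)`; Chruściel–Costa 2008, §5.2:
`𝒵_dgt = {K₀ ∧ K₁ = 0} ⊆ {W = 0}`). [cite: ChruscielCosta2008, §5.2 (p. 19, "𝒵_dgt ⊂ {W = 0}")] -/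
theorem areaFunction_eq_zero_of_eq_smul {x : M} (T₀ : TangentSpace I x) {Y₀ : TangentSpace I x}
    {c : ℝ} (hY0 : Y₀ = c • T₀) : g.val x T₀ Y₀ ^ 2 - g.val x T₀ T₀ * g.val x Y₀ Y₀ = 0 := by
  subst hY0
  simp only [map_smul, smul_eq_mul, FunLike.coe_smul, Pi.smul_apply]
  ring

/-- **`W ≠ 0` forces linear independence**: if the area function of `(T₀, Y₀)` is non-zero then
`T₀, Y₀` are linearly independent, i.e. the point lies outside `𝒵_dgt = {K₀ ∧ K₁ = 0}`
(contrapositive of `𝒵_dgt ⊆ {W = 0}`, Chruściel–Costa 2008, §5.2, p. 19). [cite: ChruscielCosta2008, §5.2 (p. 19, "𝒵_dgt ⊂ {W = 0}")] -/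
theorem linearIndependent_of_areaFunction_ne_zero {x : M} {T₀ Y₀ : TangentSpace I x}
    (hW : g.val x T₀ Y₀ ^ 2 - g.val x T₀ T₀ * g.val x Y₀ Y₀ ≠ 0) :
    LinearIndependent ℝ ![T₀, Y₀] := by
  rw [LinearIndependent.pair_iff]
  intro s t hst
  by_cases ht : t = 0
  · subst ht
    by_cases hs : s = 0
    · exact ⟨hs, rfl⟩
    · exfalso
      have hT0 : T₀ = 0 := by
        simpa [hs] using hst
      apply hW
      simp [hT0]
  · exfalso
    have hY : Y₀ = (-(s / t)) • T₀ := by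
      have h1 : t • Y₀ = -(s • T₀) := eq_neg_of_add_eq_zero_right hst
      have h2 : Y₀ = t⁻¹ • (t • Y₀) := by rw [smul_smul, inv_mul_cancel₀ ht, one_smul]
      rw [h2, h1, smul_neg, smul_smul, neg_smul, div_eq_inv_mul]
    exact hW (areaFunction_eq_zero_of_eq_smul T₀ hY)

/-! ### The null vector `ℓ = K₀ - h^{ij} g(K₀, K_j) K_i` of the orbit planes (Chruściel–Costa
2008, proof of Thm. 5.8), case `s = 2`: `ℓ = T₀ - (g(T₀, Y₀) / g(Y₀, Y₀)) Y₀` -/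

/-- **`ℓ ⊥ Y`.** For `g(Y₀, Y₀) ≠ 0` the vector `ℓ = T₀ - (g(T₀, Y₀)/g(Y₀, Y₀)) Y₀` is orthogonal
to `Y₀` (Chruściel–Costa 2008, proof of Thm. 5.8: `ℓ` solves `g(K_μ, K_ν) Ω^ν = 0` in the
`K_i`-directions, normalised by `Ω⁰ = 1`). [cite: ChruscielCosta2008, Thm. 5.8 (proof, definition of ℓ)] -/
theorem val_ell_apply_eq_zero {x : M} (T₀ : TangentSpace I x) {Y₀ : TangentSpace I x}
    (hY : g.val x Y₀ Y₀ ≠ 0) :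
    g.val x (T₀ - (g.val x T₀ Y₀ / g.val x Y₀ Y₀) • Y₀) Y₀ = 0 := by
  simp only [map_sub, map_smul, FunLike.coe_sub, FunLike.coe_smul,
    Pi.sub_apply, Pi.smul_apply, smul_eq_mul]
  field_simp
  ring

/-- **`g(ℓ, ℓ) g(Y, Y) = -W`.** For `g(Y₀, Y₀) ≠ 0`,
`g(ℓ, ℓ) · g(Y₀, Y₀) = -(g(T₀, Y₀)² - g(T₀, T₀) g(Y₀, Y₀))`: the norm of `ℓ` is minus the area
function divided by `g(Y₀, Y₀)` — the computation behind "on `{W = 0} ∖ 𝒵_dgt` … some linear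
combination of Killing vectors is null and orthogonal to `Span{K₀, …, K_{s-1}}`" (Chruściel–Costa
2008, proof of Thm. 5.8). [cite: ChruscielCosta2008, Thm. 5.8 (proof, definition of ℓ)] -/
theorem val_ell_self_mul_eq_neg_areaFunction {x : M} (T₀ : TangentSpace I x)
    {Y₀ : TangentSpace I x} (hY : g.val x Y₀ Y₀ ≠ 0) :
    g.val x (T₀ - (g.val x T₀ Y₀ / g.val x Y₀ Y₀) • Y₀)
        (T₀ - (g.val x T₀ Y₀ / g.val x Y₀ Y₀) • Y₀) * g.val x Y₀ Y₀ =
      -(g.val x T₀ Y₀ ^ 2 - g.val x T₀ T₀ * g.val x Y₀ Y₀) := by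
  have hs : g.val x Y₀ T₀ = g.val x T₀ Y₀ := g.symm x Y₀ T₀
  simp only [map_sub, map_smul, FunLike.coe_sub, FunLike.coe_smul,
    Pi.sub_apply, Pi.smul_apply, smul_eq_mul, hs]
  field_simp
  ring

/-- **`ℓ` is null exactly on `{W = 0}`** (where `Y` is non-null): for `g(Y₀, Y₀) ≠ 0`,
`g(ℓ, ℓ) = 0 ↔ W = 0`. Chruściel–Costa 2008, proof of Thm. 5.8 ("for `q ∈ {W = 0} ∖ 𝒵_dgt` some
linear combination of Killing vectors is null and orthogonal to `Span{K₀, …, K_{s-1}}`").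
[cite: ChruscielCosta2008, Thm. 5.8 (proof)] -/
theorem val_ell_self_eq_zero_iff {x : M} (T₀ : TangentSpace I x) {Y₀ : TangentSpace I x}
    (hY : g.val x Y₀ Y₀ ≠ 0) :
    g.val x (T₀ - (g.val x T₀ Y₀ / g.val x Y₀ Y₀) • Y₀)
        (T₀ - (g.val x T₀ Y₀ / g.val x Y₀ Y₀) • Y₀) = 0 ↔
      g.val x T₀ Y₀ ^ 2 - g.val x T₀ T₀ * g.val x Y₀ Y₀ = 0 := by
  have h := g.val_ell_self_mul_eq_neg_areaFunction T₀ hY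
  constructor
  · intro h0
    rw [h0, zero_mul] at h
    linarith
  · intro hW
    rw [hW, neg_zero] at h
    exact (mul_eq_zero.1 h).resolve_right hY

/-- **`ℓ` is timelike exactly on `{W > 0}`** where `Y` is spacelike and non-zero: for
`g(Y₀, Y₀) > 0`, `ℓ` is timelike iff `W > 0` (`g(ℓ, ℓ) g(Y₀, Y₀) = -W`). In particular the orbit
plane `Span{T₀, Y₀}` is timelike (Lorentzian) where `W > 0`, and null where `W = 0`, as in the
proof of Chruściel–Costa 2008, Thm. 5.8. [cite: ChruscielCosta2008, Thm. 5.8 (proof)] -/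
theorem isTimelike_ell_iff_areaFunction_pos {x : M} (T₀ : TangentSpace I x)
    {Y₀ : TangentSpace I x} (hY : 0 < g.val x Y₀ Y₀) :
    g.IsTimelike (T₀ - (g.val x T₀ Y₀ / g.val x Y₀ Y₀) • Y₀) ↔
      0 < g.val x T₀ Y₀ ^ 2 - g.val x T₀ T₀ * g.val x Y₀ Y₀ := by
  have h := g.val_ell_self_mul_eq_neg_areaFunction T₀ hY.ne'
  rw [LorentzianMetric.isTimelike_iff]
  constructor
  · intro hl
    nlinarith [mul_neg_of_neg_of_pos hl hY]
  · intro hW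
    by_contra hl
    have hl' : 0 ≤ g.val x (T₀ - (g.val x T₀ Y₀ / g.val x Y₀ Y₀) • Y₀)
        (T₀ - (g.val x T₀ Y₀ / g.val x Y₀ Y₀) • Y₀) := le_of_not_gt hl
    nlinarith [mul_nonneg hl' hY.le]

/-- **`W = 0` where a combination `T₀ + Ω Y₀` is orthogonal to both `T₀` and `Y₀`** — the
mechanism by which the area function vanishes on the event horizon: there the horizon Killing field
`K = T + Ω Y` is null and tangent, hence orthogonal to the tangent vectors `T`, `Y` (Chruściel–Costa
2008, §5.2 and §7.1; on the model, `Kerr.areaFunction_stationary_axial_eq`: `W = Δ sin²θ`). Linear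
algebra: `(1, Ω)` is in the kernel of the Gram matrix of `(T₀, Y₀)`, whose determinant is `−W`.
[cite: ChruscielCosta2008, §5.2 (p. 19)] -/
theorem areaFunction_eq_zero_of_orthogonal_combination {x : M} {T₀ Y₀ : TangentSpace I x} {Ω : ℝ}
    (hT : g.val x (T₀ + Ω • Y₀) T₀ = 0) (hY : g.val x (T₀ + Ω • Y₀) Y₀ = 0) :
    g.val x T₀ Y₀ ^ 2 - g.val x T₀ T₀ * g.val x Y₀ Y₀ = 0 := by
  simp only [map_add, map_smul, _root_.add_apply, FunLike.coe_smul, Pi.smul_apply, smul_eq_mul] at hT hY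
  have hsym : g.val x Y₀ T₀ = g.val x T₀ Y₀ := g.symm x Y₀ T₀
  rw [hsym] at hT
  -- `g(T,T) = -Ω g(T,Y)` and `g(T,Y) = -Ω g(Y,Y)`
  have h1 : g.val x T₀ T₀ = -Ω * g.val x T₀ Y₀ := by linarith
  have h2 : g.val x T₀ Y₀ = -Ω * g.val x Y₀ Y₀ := by linarith
  rw [h1, h2]
  ring

/-- **If no combination `T₀ + Ω Y₀`, `Ω ∈ ℝ`, is timelike, then `W ≤ 0`**: the quadratic
`Ω ↦ g(T₀ + Ω Y₀, T₀ + Ω Y₀) = g(T₀,T₀) + 2Ω g(T₀,Y₀) + Ω² g(Y₀,Y₀)` is non-negative on `ℝ`, so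
its discriminant `4 (g(T₀,Y₀)² - g(T₀,T₀) g(Y₀,Y₀)) = 4W` is non-positive (Mathlib's
`discrim_le_zero`). Dual to "`W` is clearly positive in a region where `K₀` is timelike and
`K₁` is spacelike" (Chruściel–Costa 2008, p. 18): `W > 0` at a point forces the plane
`Span{T₀, Y₀}` to be timelike, i.e. to contain a timelike vector. [cite: ChruscielCosta2008, §5 (p. 18, (5.1) and the sentence following it)] -/
theorem areaFunction_nonpos_of_forall_not_isTimelike {x : M} {T₀ Y₀ : TangentSpace I x}
    (h : ∀ Ω : ℝ, ¬ g.IsTimelike (T₀ + Ω • Y₀)) :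
    g.val x T₀ Y₀ ^ 2 - g.val x T₀ T₀ * g.val x Y₀ Y₀ ≤ 0 := by
  have hsym : g.val x Y₀ T₀ = g.val x T₀ Y₀ := g.symm x Y₀ T₀
  have hq : ∀ Ω : ℝ,
      0 ≤ g.val x Y₀ Y₀ * (Ω * Ω) + 2 * g.val x T₀ Y₀ * Ω + g.val x T₀ T₀ := by
    intro Ω
    have h' := h Ω
    rw [LorentzianMetric.IsTimelike, not_lt] at h'
    simp only [map_add, map_smul, _root_.add_apply, FunLike.coe_smul, Pi.smul_apply, smul_eq_mul,
      hsym] at h'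
    nlinarith [h']
  have hd := discrim_le_zero hq
  rw [discrim] at hd
  nlinarith [hd]

end LorentzianMetric

end KillingOrbits

/-! ### The axial Killing field and the area function of an `I⁺`-regular stationary axisymmetric
black hole (Chruściel–Costa 2008, §5, case `s = 2`; the setting of Chruściel–Costa–Heusler 2012,
§3.2 and Thm. 3.2) -/

namespace StationaryAFBlackHole

variable {𝓑 : StationaryAFBlackHole.{u}}

/-- **The axial Killing field is spacelike or zero on the domain of outer communications.** Let `𝓑`
be an `I⁺`-regular stationary AF black hole (so strong causality holds at every point of
`⟨⟨M_ext⟩⟩`, Chruściel–Costa Def. 1.1) and `Y` an axisymmetric Killing field of `𝓑` (complete, all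
orbits `2π`-periodic). Then `Y p` is spacelike or zero at every `p ∈ ⟨⟨M_ext⟩⟩`: the orbit of `p` is
a closed curve through a strongly causal point
(`IsKillingField.isSpacelike_apply_of_periodic_of_isStronglyCausalAt`). This is the standing
assumption "the `K_i`'s are spacelike [away from their zero sets]" of Chruściel–Costa 2008, §5.2
(p. 19) on `⟨⟨M_ext⟩⟩`, in the stationary-axisymmetric setting of Chruściel–Costa–Heusler 2012,
§3.2.1 and Thm. 3.2 (hypothesis `IsStationaryAxisymmetric` of
`ChruscielCostaHeusler2012_axisymmetricUniqueness`). [cite: ChruscielCosta2008, §5.2 (p. 19, "the K_i's are spacelike", footnote)] [cite: ChruscielCostaHeusler2012, §3.2.1 (p. 10)] -/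
theorem isSpacelike_of_isAxisymmetricKilling_of_mem_doc [𝓑.metric.HasLeviCivita]
    (hreg : 𝓑.IsIPlusRegular) {Y : Π x : 𝓑.carrier, TangentSpace (𝓡 4) x}
    (hY : 𝓑.toSpacetime.IsAxisymmetricKilling Y) {p : 𝓑.carrier} (hp : p ∈ 𝓑.doc) :
    𝓑.metric.IsSpacelike (Y p) := by
  obtain ⟨hK, hcomp, hper, -, -⟩ := hY
  obtain ⟨γ, hγ, rfl⟩ := hcomp p
  exact hK.isSpacelike_apply_of_periodic_of_isStronglyCausalAt hγ Real.two_pi_pos (hper γ hγ)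
    (hreg.isStronglyCausalAt hp)

/-- **`g(Y, Y) ≥ 0` on `⟨⟨M_ext⟩⟩`** for an axisymmetric Killing field `Y` of an `I⁺`-regular
stationary AF black hole (`Y` is spacelike or zero there). Chruściel–Costa 2008, §5.2 (p. 19).
[cite: ChruscielCosta2008, §5.2 (p. 19)] -/
theorem val_self_nonneg_of_isAxisymmetricKilling_of_mem_doc [𝓑.metric.HasLeviCivita]
    (hreg : 𝓑.IsIPlusRegular) {Y : Π x : 𝓑.carrier, TangentSpace (𝓡 4) x}
    (hY : 𝓑.toSpacetime.IsAxisymmetricKilling Y) {p : 𝓑.carrier} (hp : p ∈ 𝓑.doc) :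
    0 ≤ 𝓑.metric.val p (Y p) (Y p) := by
  rcases isSpacelike_of_isAxisymmetricKilling_of_mem_doc hreg hY hp with h | h
  · exact h.le
  · rw [h]
    simp

/-- **On `⟨⟨M_ext⟩⟩` the set `{g(Y, Y) = 0}` is the axis `{Y = 0}`**: for an axisymmetric Killing
field `Y` of an `I⁺`-regular stationary AF black hole and `p ∈ ⟨⟨M_ext⟩⟩`, `g(Y, Y)(p) = 0` iff
`Y p = 0` (`Y p` is spacelike or zero). This identifies, within `⟨⟨M_ext⟩⟩`, the vanishing set
`{g(K₁, K₁) = 0}` of Chruściel–Costa's Theorem 5.1 (`s = 2`: `𝒵̃ = {det g(K_i, K_j) = 0}`) with the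
rotation axis `𝒜 = {Y = 0}` (Chruściel–Costa 2008, §5.2, p. 19: "`𝒵̃ ∩ ⟨⟨M_ext⟩⟩ = 𝒵_dgt ∩ ⟨⟨M_ext⟩⟩`
in a chronological domain of outer communications"; §6.1: `𝒜` "the set of fixed points of the
Killing vector `Y`"). [cite: ChruscielCosta2008, §5.2 (p. 19) and Thm. 5.1] -/
theorem val_self_eq_zero_iff_of_isAxisymmetricKilling_of_mem_doc [𝓑.metric.HasLeviCivita]
    (hreg : 𝓑.IsIPlusRegular) {Y : Π x : 𝓑.carrier, TangentSpace (𝓡 4) x}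
    (hY : 𝓑.toSpacetime.IsAxisymmetricKilling Y) {p : 𝓑.carrier} (hp : p ∈ 𝓑.doc) :
    𝓑.metric.val p (Y p) (Y p) = 0 ↔ Y p = 0 := by
  constructor
  · intro h0
    rcases isSpacelike_of_isAxisymmetricKilling_of_mem_doc hreg hY hp with h | h
    · exact absurd h0 h.ne'
    · exact h
  · intro h
    rw [h]
    simp

/-- **The area function is non-negative on `M_ext`.** For a stationary AF black hole `𝓑` with
stationary Killing field `T = 𝓑.killing` (timelike on `M_ext`) and *any* vector field `Y`, the area
function `W = g(T, Y)² - g(T, T) g(Y, Y)` (Chruściel–Costa (5.1), `K₀ = T`, `K₁ = Y`) is non-negative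
at every point of `M_ext` — "in particular it is non-negative on `M_ext`" (Chruściel–Costa 2008,
p. 18; pointwise reverse Cauchy–Schwarz, `areaFunction_nonneg_of_isTimelike`).
[cite: ChruscielCosta2008, §5 (p. 18, sentence after (5.1))] -/
theorem areaFunction_nonneg_of_mem_Mext [𝓑.metric.HasLeviCivita]
    (Y : Π x : 𝓑.carrier, TangentSpace (𝓡 4) x) {p : 𝓑.carrier} (hp : p ∈ 𝓑.Mext) :
    0 ≤ 𝓑.metric.val p (𝓑.killing p) (Y p) ^ 2 -
      𝓑.metric.val p (𝓑.killing p) (𝓑.killing p) * 𝓑.metric.val p (Y p) (Y p) :=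
  LorentzianMetric.areaFunction_nonneg_of_isTimelike (𝓑.isStationaryKilling.isTimelike hp).1 (Y p)

/-- **The area function is positive on `M_ext` off the axis.** For an `I⁺`-regular stationary AF
black hole `𝓑` with an axisymmetric Killing field `Y`, at every point `p ∈ M_ext` with `Y p ≠ 0`
the area function `W = g(T, Y)² - g(T, T) g(Y, Y)` is positive: `T = 𝓑.killing` is timelike on
`M_ext` and `Y` is spacelike on `⟨⟨M_ext⟩⟩ ⊇ M_ext` away from the axis
(`isSpacelike_of_isAxisymmetricKilling_of_mem_doc`, `Mext_subset_doc`) — "`W` is clearly positive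
in a region where `K₀` is timelike and `K₁` is spacelike" (Chruściel–Costa 2008, p. 18).
[cite: ChruscielCosta2008, §5 (p. 18, sentence after (5.1))] -/
theorem areaFunction_pos_of_mem_Mext [𝓑.metric.HasLeviCivita] (hreg : 𝓑.IsIPlusRegular)
    {Y : Π x : 𝓑.carrier, TangentSpace (𝓡 4) x} (hY : 𝓑.toSpacetime.IsAxisymmetricKilling Y)
    {p : 𝓑.carrier} (hp : p ∈ 𝓑.Mext) (hYp : Y p ≠ 0) :
    0 < 𝓑.metric.val p (𝓑.killing p) (Y p) ^ 2 -
      𝓑.metric.val p (𝓑.killing p) (𝓑.killing p) * 𝓑.metric.val p (Y p) (Y p) :=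
  LorentzianMetric.areaFunction_pos_of_isTimelike_of_isSpacelike
    (𝓑.isStationaryKilling.isTimelike hp).1
    (isSpacelike_of_isAxisymmetricKilling_of_mem_doc hreg hY (𝓑.Mext_subset_doc hp)) hYp

/-- **Under the hypotheses of the axisymmetric uniqueness theorem the axial field is spacelike or
zero on `⟨⟨M_ext⟩⟩`**: for `𝓑` satisfying the hypothesis predicate
`IsIPlusRegularNonDegenerate ∧ IsStationaryAxisymmetric` of
`ChruscielCostaHeusler2012_axisymmetricUniqueness`, there is an axisymmetric Killing field `Y`
commuting with `T = 𝓑.killing` which is spacelike or zero at every point of the domain of outer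
communications (the form in which the preceding statements enter the proof of Chruściel–Costa–Heusler
2012, Thm. 3.2 via Chruściel–Costa 2008, §5). [cite: ChruscielCostaHeusler2012, Thm. 3.2 (hypotheses) and §3.2.1] -/
theorem exists_axial_isSpacelike_of_hypotheses [𝓑.metric.HasLeviCivita]
    (h : 𝓑.IsIPlusRegularNonDegenerate ∧ 𝓑.IsStationaryAxisymmetric) :
    ∃ Y : Π x : 𝓑.carrier, TangentSpace (𝓡 4) x,
      𝓑.toSpacetime.IsAxisymmetricKilling Y ∧
        (∀ x, VectorField.mlieBracket (𝓡 4) 𝓑.killing Y x = 0) ∧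
        ∀ p ∈ 𝓑.doc, 𝓑.metric.IsSpacelike (Y p) := by
  obtain ⟨Y, hY, hTY⟩ := h.2
  exact ⟨Y, hY, hTY, fun _ hp ↦
    isSpacelike_of_isAxisymmetricKilling_of_mem_doc h.1.isIPlusRegular hY hp⟩

/-- **The Gram matrix of `(T, Y)` and the area function are `ℝ × U(1)`-invariant.** For a
stationary AF black hole `𝓑` with stationary Killing field `T = 𝓑.killing` and an axisymmetric
Killing field `Y` commuting with it (`[T, Y] = 0`, the hypothesis `IsStationaryAxisymmetric`), the
functions `g(T, T)`, `g(T, Y)`, `g(Y, Y)` — hence `W = g(T, Y)² - g(T, T) g(Y, Y)` — are constant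
along every integral curve of `T` and along every integral curve of `Y`: they are functions on the
orbit space of the isometry group `ℝ × U(1)`, the starting point of Carter's reduction
(Chruściel–Costa 2008, §5.2, §6.2–6.4; Chruściel–Costa–Heusler 2012, §3.2.3).
[cite: ChruscielCosta2008, §5.2 and §6.4] [cite: ChruscielCostaHeusler2012, §3.2.3 (p. 10)] -/
theorem gram_invariant_of_isAxisymmetricKilling [𝓑.metric.HasLeviCivita]
    {Y : Π x : 𝓑.carrier, TangentSpace (𝓡 4) x} (hY : 𝓑.toSpacetime.IsAxisymmetricKilling Y)
    (hTY : ∀ x, VectorField.mlieBracket (𝓡 4) 𝓑.killing Y x = 0) {γ : ℝ → 𝓑.carrier}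
    (hγ : IsMIntegralCurve γ 𝓑.killing ∨ IsMIntegralCurve γ Y) (s t : ℝ) :
    𝓑.metric.val (γ s) (𝓑.killing (γ s)) (𝓑.killing (γ s)) =
        𝓑.metric.val (γ t) (𝓑.killing (γ t)) (𝓑.killing (γ t)) ∧
      𝓑.metric.val (γ s) (𝓑.killing (γ s)) (Y (γ s)) =
          𝓑.metric.val (γ t) (𝓑.killing (γ t)) (Y (γ t)) ∧
        𝓑.metric.val (γ s) (Y (γ s)) (Y (γ s)) = 𝓑.metric.val (γ t) (Y (γ t)) (Y (γ t)) := by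
  have hT : 𝓑.metric.IsKillingField 𝓑.killing := 𝓑.isStationaryKilling.isKillingField
  rcases hγ with hγ | hγ
  · exact hT.gram_apply_eq_of_isMIntegralCurve_left hY.1 hTY hγ s t
  · exact hT.gram_apply_eq_of_isMIntegralCurve_right hY.1 hTY hγ s t

/-- **`W` is `ℝ × U(1)`-invariant** for a stationary AF black hole with an axisymmetric Killing
field commuting with the stationary one (constant along the integral curves of either field).
Chruściel–Costa 2008, §5 ((5.1), §5.2). [cite: ChruscielCosta2008, §5 (5.1) and §5.2] -/
theorem areaFunction_invariant_of_isAxisymmetricKilling [𝓑.metric.HasLeviCivita]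
    {Y : Π x : 𝓑.carrier, TangentSpace (𝓡 4) x} (hY : 𝓑.toSpacetime.IsAxisymmetricKilling Y)
    (hTY : ∀ x, VectorField.mlieBracket (𝓡 4) 𝓑.killing Y x = 0) {γ : ℝ → 𝓑.carrier}
    (hγ : IsMIntegralCurve γ 𝓑.killing ∨ IsMIntegralCurve γ Y) (s t : ℝ) :
    𝓑.metric.val (γ s) (𝓑.killing (γ s)) (Y (γ s)) ^ 2 -
        𝓑.metric.val (γ s) (𝓑.killing (γ s)) (𝓑.killing (γ s)) *
          𝓑.metric.val (γ s) (Y (γ s)) (Y (γ s)) =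
      𝓑.metric.val (γ t) (𝓑.killing (γ t)) (Y (γ t)) ^ 2 -
        𝓑.metric.val (γ t) (𝓑.killing (γ t)) (𝓑.killing (γ t)) *
          𝓑.metric.val (γ t) (Y (γ t)) (Y (γ t)) := by
  obtain ⟨h1, h2, h3⟩ := gram_invariant_of_isAxisymmetricKilling hY hTY hγ s t
  rw [h1, h2, h3]

/-- **Off the axis in `⟨⟨M_ext⟩⟩`, the vector `ℓ = T - (g(T, Y)/g(Y, Y)) Y` is orthogonal to `Y`,
null exactly where `W = 0` and timelike exactly where `W > 0`.** For an `I⁺`-regular stationary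
AF black hole `𝓑` with an axisymmetric Killing field `Y` and a point `p ∈ ⟨⟨M_ext⟩⟩` with
`Y p ≠ 0` (so `g(Y, Y)(p) > 0`, `isSpacelike_of_isAxisymmetricKilling_of_mem_doc`), Chruściel–Costa's
`ℓ_p = K₀ - h^{ij} g(K₀, K_j) K_i` (proof of Thm. 5.8; `s = 2`, `K₀ = T = 𝓑.killing`, `K₁ = Y`)
satisfies `g(ℓ_p, Y) = 0`, `g(ℓ_p, ℓ_p) = 0 ↔ W(p) = 0` and `ℓ_p` timelike `↔ W(p) > 0`.
[cite: ChruscielCosta2008, Thm. 5.8 (proof, definition of ℓ)] -/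
theorem ell_orthogonal_and_causalCharacter_of_mem_doc [𝓑.metric.HasLeviCivita]
    (hreg : 𝓑.IsIPlusRegular) {Y : Π x : 𝓑.carrier, TangentSpace (𝓡 4) x}
    (hY : 𝓑.toSpacetime.IsAxisymmetricKilling Y) {p : 𝓑.carrier} (hp : p ∈ 𝓑.doc)
    (hYp : Y p ≠ 0) :
    𝓑.metric.val p (𝓑.killing p -
        (𝓑.metric.val p (𝓑.killing p) (Y p) / 𝓑.metric.val p (Y p) (Y p)) • Y p) (Y p) = 0 ∧
      (𝓑.metric.val p
          (𝓑.killing p -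
            (𝓑.metric.val p (𝓑.killing p) (Y p) / 𝓑.metric.val p (Y p) (Y p)) • Y p)
          (𝓑.killing p -
            (𝓑.metric.val p (𝓑.killing p) (Y p) / 𝓑.metric.val p (Y p) (Y p)) • Y p) = 0 ↔
        𝓑.metric.val p (𝓑.killing p) (Y p) ^ 2 -
          𝓑.metric.val p (𝓑.killing p) (𝓑.killing p) * 𝓑.metric.val p (Y p) (Y p) = 0) ∧
      (𝓑.metric.IsTimelike (𝓑.killing p -
          (𝓑.metric.val p (𝓑.killing p) (Y p) / 𝓑.metric.val p (Y p) (Y p)) • Y p) ↔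
        0 < 𝓑.metric.val p (𝓑.killing p) (Y p) ^ 2 -
          𝓑.metric.val p (𝓑.killing p) (𝓑.killing p) * 𝓑.metric.val p (Y p) (Y p)) := by
  have hpos : 0 < 𝓑.metric.val p (Y p) (Y p) :=
    (isSpacelike_of_isAxisymmetricKilling_of_mem_doc hreg hY hp).resolve_right hYp
  exact ⟨LorentzianMetric.val_ell_apply_eq_zero _ hpos.ne',
    LorentzianMetric.val_ell_self_eq_zero_iff _ hpos.ne',
    LorentzianMetric.isTimelike_ell_iff_areaFunction_pos _ hpos⟩

/-- **On `M_ext` the area function vanishes exactly on the axis**: for an `I⁺`-regular stationary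
AF black hole with an axisymmetric Killing field `Y` and `p ∈ M_ext`, `W(p) = 0 ↔ Y p = 0`
(`W > 0` off the axis, `areaFunction_pos_of_mem_Mext`; `W = 0` on it). This is the restriction to
`M_ext` of the vanishing clause of Chruściel–Costa's Theorem 5.1 ("vanishing precisely on the union
of its boundary with the set `{g(K₁, K₁) = 0}`"; on `⟨⟨M_ext⟩⟩` that set is the axis,
`val_self_eq_zero_iff_of_isAxisymmetricKilling_of_mem_doc`). [cite: ChruscielCosta2008, Thm. 5.1 (statement) and §5 (p. 18)] -/
theorem areaFunction_eq_zero_iff_of_mem_Mext [𝓑.metric.HasLeviCivita] (hreg : 𝓑.IsIPlusRegular)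
    {Y : Π x : 𝓑.carrier, TangentSpace (𝓡 4) x} (hY : 𝓑.toSpacetime.IsAxisymmetricKilling Y)
    {p : 𝓑.carrier} (hp : p ∈ 𝓑.Mext) :
    𝓑.metric.val p (𝓑.killing p) (Y p) ^ 2 -
        𝓑.metric.val p (𝓑.killing p) (𝓑.killing p) * 𝓑.metric.val p (Y p) (Y p) = 0 ↔
      Y p = 0 := by
  constructor
  · intro hW
    by_contra hYp
    exact (areaFunction_pos_of_mem_Mext hreg hY hp hYp).ne' hW
  · intro hYp
    exact LorentzianMetric.areaFunction_eq_zero_of_eq_zero _ hYp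

/-- **On `M_ext` off the axis the stationary and axial Killing vectors are linearly independent**
(`W > 0` there, `areaFunction_pos_of_mem_Mext`, and `W ≠ 0` forces independence,
`linearIndependent_of_areaFunction_ne_zero`): `M_ext ∖ 𝒜` does not meet
`𝒵_dgt = {K₀ ∧ K₁ = 0}` (Chruściel–Costa 2008, §5.2, p. 19: `𝒵_dgt ⊆ {W = 0}`; §5, p. 18: `W`
is non-negative on `M_ext`). [cite: ChruscielCosta2008, §5.2 (p. 19, "𝒵_dgt ⊂ {W = 0}")] -/
theorem linearIndependent_killing_axial_of_mem_Mext [𝓑.metric.HasLeviCivita]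
    (hreg : 𝓑.IsIPlusRegular) {Y : Π x : 𝓑.carrier, TangentSpace (𝓡 4) x}
    (hY : 𝓑.toSpacetime.IsAxisymmetricKilling Y) {p : 𝓑.carrier} (hp : p ∈ 𝓑.Mext)
    (hYp : Y p ≠ 0) : LinearIndependent ℝ ![𝓑.killing p, Y p] :=
  LorentzianMetric.linearIndependent_of_areaFunction_ne_zero
    (areaFunction_pos_of_mem_Mext hreg hY hp hYp).ne'

/-- **The candidate horizon Killing fields `K = a T + b Y` commute with `T` and `Y` and have
`ℝ × U(1)`-invariant norm.** For a stationary AF black hole with an axisymmetric Killing field `Y`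
commuting with `T = 𝓑.killing` and constants `a, b`, the field `K = a • T + b • Y` (a Killing
field: `PseudoRiemannianMetric.IsKillingField.linearCombination`,
`KillingAlgebraAsymptoticallyFlat.lean`) satisfies `[T, K] = 0 = [K, Y]`, and `g(K, K)` takes the
same value at any two points of an integral curve of `T` or of `Y` (it is the quadratic form of the
invariant Gram matrix, `gram_invariant_of_isAxisymmetricKilling`). In particular the null set
`𝒩[K] = {g(K, K) = 0, K ≠ 0}` of such a `K` (Chruściel–Costa (2.7); for `K = K₀ + Ω K₁` the
candidate Killing horizon of a rotating hole, §4.4, §7.1) is a union of group orbits.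
[cite: ChruscielCosta2008, §2.4 (2.7) and §4.4] -/
theorem combination_commutes_and_norm_invariant [𝓑.metric.HasLeviCivita]
    {Y : Π x : 𝓑.carrier, TangentSpace (𝓡 4) x} (hY : 𝓑.toSpacetime.IsAxisymmetricKilling Y)
    (hTY : ∀ x, VectorField.mlieBracket (𝓡 4) 𝓑.killing Y x = 0) (a b : ℝ) :
    (∀ x, VectorField.mlieBracket (𝓡 4) 𝓑.killing (a • 𝓑.killing + b • Y) x = 0 ∧
        VectorField.mlieBracket (𝓡 4) (a • 𝓑.killing + b • Y) Y x = 0) ∧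
      ∀ {γ : ℝ → 𝓑.carrier}, (IsMIntegralCurve γ 𝓑.killing ∨ IsMIntegralCurve γ Y) →
        ∀ s t : ℝ,
          𝓑.metric.val (γ s) ((a • 𝓑.killing + b • Y) (γ s)) ((a • 𝓑.killing + b • Y) (γ s)) =
            𝓑.metric.val (γ t) ((a • 𝓑.killing + b • Y) (γ t))
              ((a • 𝓑.killing + b • Y) (γ t)) := by
  have hT : 𝓑.metric.IsKillingField 𝓑.killing := 𝓑.isStationaryKilling.isKillingField
  refine ⟨fun x ↦ hT.mlieBracket_combination_eq_zero hY.1 hTY a b x, fun {γ} hγ s t ↦ ?_⟩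
  obtain ⟨h1, h2, h3⟩ := gram_invariant_of_isAxisymmetricKilling hY hTY hγ s t
  have hsym : ∀ x, 𝓑.metric.val x (Y x) (𝓑.killing x) = 𝓑.metric.val x (𝓑.killing x) (Y x) :=
    fun x ↦ 𝓑.metric.symm x _ _
  simp only [Pi.add_apply, Pi.smul_apply, map_add, map_smul, _root_.add_apply, FunLike.coe_smul,
    smul_eq_mul, hsym]
  linear_combination a ^ 2 * h1 + 2 * a * b * h2 + b ^ 2 * h3

/-- **`W ≥ 0` on the domain of outer communications away from the open ergoregion.** For an
`I⁺`-regular stationary AF black hole with an axisymmetric Killing field `Y`, at every point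
`p ∈ ⟨⟨M_ext⟩⟩` where the stationary field is causal or zero (`g(T, T)(p) ≤ 0`) the area function
is non-negative (`Y` is spacelike or zero on `⟨⟨M_ext⟩⟩`,
`isSpacelike_of_isAxisymmetricKilling_of_mem_doc`). The non-trivial content of Chruściel–Costa's
Theorems 5.1/5.4/5.6 — `W ≥ 0` on all of `⟨⟨M_ext⟩⟩` — therefore lies in the ergoset
`E = {g(K₀, K₀) ≥ 0}` (§5.3, (5.37)), whose interplay with the axis is their Ergoset Theorem 5.24.
[cite: ChruscielCosta2008, §5 (p. 18), Thm. 5.1 and §5.3 (5.37)] -/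
theorem areaFunction_nonneg_of_mem_doc_of_val_killing_nonpos [𝓑.metric.HasLeviCivita]
    (hreg : 𝓑.IsIPlusRegular) {Y : Π x : 𝓑.carrier, TangentSpace (𝓡 4) x}
    (hY : 𝓑.toSpacetime.IsAxisymmetricKilling Y) {p : 𝓑.carrier} (hp : p ∈ 𝓑.doc)
    (hT : 𝓑.metric.val p (𝓑.killing p) (𝓑.killing p) ≤ 0) :
    0 ≤ 𝓑.metric.val p (𝓑.killing p) (Y p) ^ 2 -
      𝓑.metric.val p (𝓑.killing p) (𝓑.killing p) * 𝓑.metric.val p (Y p) (Y p) :=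
  LorentzianMetric.areaFunction_nonneg_of_val_self_nonpos_of_isSpacelike hT
    (isSpacelike_of_isAxisymmetricKilling_of_mem_doc hreg hY hp)

/-- **On the rotation axis: `∇_T Y = 0`, `T ⊥ range ∇Y`, and `∇W = 0`.** For a stationary AF
black hole with an axisymmetric Killing field `Y` commuting with `T = 𝓑.killing` and a point `p`
of the axis `𝒜 = {Y = 0}`: `∇_{T p} Y = 0`, `g(∇_v Y, T p) = 0` for all `v`, and the area function
`W = g(T, Y)² - g(T, T) g(Y, Y)` has zero differential at `p`. Chruściel–Costa 2008, §5.3 (p. 25: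
"`X^α ∇_ν Y_α|_𝒜 = … = -[X, Y]_ν = 0`" and "We have `∇W|_𝒜 = 0`"), the first steps of the proof
of their Lemma 5.23 / Ergoset Theorem 5.24. [cite: ChruscielCosta2008, §5.3 (p. 25, "∇W|_𝒜 = 0" and the preceding display)] -/
theorem axis_leviCivita_and_mfderiv_areaFunction [𝓑.metric.HasLeviCivita]
    {Y : Π x : 𝓑.carrier, TangentSpace (𝓡 4) x} (hY : 𝓑.toSpacetime.IsAxisymmetricKilling Y)
    (hTY : ∀ x, VectorField.mlieBracket (𝓡 4) 𝓑.killing Y x = 0) {p : 𝓑.carrier}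
    (hp : Y p = 0) :
    𝓑.metric.leviCivita Y p (𝓑.killing p) = 0 ∧
      (∀ v : TangentSpace (𝓡 4) p,
        𝓑.metric.val p (𝓑.metric.leviCivita Y p v) (𝓑.killing p) = 0) ∧
      mfderiv (𝓡 4) 𝓘(ℝ, ℝ)
          (fun y ↦ 𝓑.metric.val y (𝓑.killing y) (Y y) ^ 2 -
            𝓑.metric.val y (𝓑.killing y) (𝓑.killing y) * 𝓑.metric.val y (Y y) (Y y)) p = 0 := by
  have hT : 𝓑.metric.IsKillingField 𝓑.killing := 𝓑.isStationaryKilling.isKillingField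
  exact ⟨hT.leviCivita_apply_eq_zero_of_apply_eq_zero hY.1 hTY hp,
    hT.val_leviCivita_apply_eq_zero_of_apply_eq_zero hY.1 hTY hp,
    hT.mfderiv_areaFunction_eq_zero_of_apply_eq_zero hY.1 hp⟩

/-! ### The axial flow: existence, periodicity, and the invariance of `⟨⟨M_ext⟩⟩`, `𝓑`, `𝓔⁺`
conditional on the invariance of `M_ext` (Chruściel–Costa 2008, §6.1 and p. 13) -/

/-- **The axial Killing field generates a global flow by isometries, `2π`-periodic in the angle.**
For an axisymmetric Killing field `Y` of `𝓑` (complete, all integral curves `2π`-periodic) there is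
a smooth map `ψ : ℝ × M → M` — the `U(1)`-action `ψ_s = φ_s[Y]` of Chruściel–Costa 2008, §6.1 —
with `ψ(0, p) = p`, the group law, whose curves are the integral curves of `Y`, which is
`2π`-periodic in `s`, and every `ψ_s` an infinitesimal isometry preserving the time orientation.
Existence of the flow: Lee 2012, Thm. 9.12 (`exists_contMDiff_globalFlow_of_complete`); isometry:
O'Neill 1983, Ch. 9, Prop. 9.23 (`IsKillingField.val_mfderiv_flow`). (With `[T, Y] = 0` the two
flows commute, `flow_comm_of_mlieBracket_eq_zero` of `KillingAlgebraAsymptoticallyFlatProofs`.)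
[cite: ChruscielCosta2008, §6.1 (the periodic flow of Y)] -/
theorem exists_axial_flow [𝓑.metric.HasLeviCivita] {Y : Π x : 𝓑.carrier, TangentSpace (𝓡 4) x}
    (hY : 𝓑.toSpacetime.IsAxisymmetricKilling Y) :
    ∃ ψ : ℝ × 𝓑.carrier → 𝓑.carrier, ContMDiff (𝓘(ℝ, ℝ).prod (𝓡 4)) (𝓡 4) ∞ ψ ∧
      (∀ p, ψ (0, p) = p) ∧ (∀ s s' p, ψ (s, ψ (s', p)) = ψ (s + s', p)) ∧
      (∀ p, IsMIntegralCurve (fun s ↦ ψ (s, p)) Y) ∧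
      (∀ s p, ψ (s + 2 * Real.pi, p) = ψ (s, p)) ∧
      (∀ (s : ℝ) (p : 𝓑.carrier) (v w : TangentSpace (𝓡 4) p),
        𝓑.metric.val (ψ (s, p)) (mfderiv (𝓡 4) (𝓡 4) (fun q ↦ ψ (s, q)) p v)
          (mfderiv (𝓡 4) (𝓡 4) (fun q ↦ ψ (s, q)) p w) = 𝓑.metric.val p v w) ∧
      ∀ (s : ℝ) (p : 𝓑.carrier) (v : TangentSpace (𝓡 4) p),
        𝓑.timeOrientation.IsFutureDirected v →
          𝓑.timeOrientation.IsFutureDirected (mfderiv (𝓡 4) (𝓡 4) (fun q ↦ ψ (s, q)) p v) := by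
  obtain ⟨hK, hcomp, hper, -, -⟩ := hY
  have hKs : ContMDiff (𝓡 4) (𝓡 4).tangent ∞
      (fun x ↦ (⟨x, Y x⟩ : TangentBundle (𝓡 4) 𝓑.carrier)) := hK.contMDiff
  have hc : ∀ x : 𝓑.carrier, ∃ γ : ℝ → 𝓑.carrier, γ 0 = x ∧ IsMIntegralCurve γ Y := by
    intro x
    obtain ⟨γ, hγ, h0⟩ := hcomp x
    exact ⟨γ, h0, hγ⟩
  obtain ⟨ψ, hψ, hψ0, hψadd, hψY⟩ :=
    Literature.Geometry.Manifold.exists_contMDiff_globalFlow_of_complete (I := 𝓡 4) (n := ⊤)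
      (by exact_mod_cast hKs) le_top hc
  have hψ' : ContMDiff (𝓘(ℝ, ℝ).prod (𝓡 4)) (𝓡 4) ∞ ψ := by exact_mod_cast hψ
  have hψ2 : ContMDiff (𝓘(ℝ, ℝ).prod (𝓡 4)) (𝓡 4) 2 ψ := hψ'.of_le (WithTop.coe_le_coe.mpr le_top)
  refine ⟨ψ, hψ', hψ0, hψadd, hψY, fun s p ↦ hper _ (hψY p) s,
    fun s p v w ↦ hK.val_mfderiv_flow hψ2 hψ0 hψY s p v w, fun s p v hv ↦ ?_⟩
  exact hK.isFutureDirected_mfderiv_flow hψ2 hψ0 hψadd hψY s hv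

/-- **If a Killing flow leaves `M_ext` invariant, it leaves `I^±(M_ext)` invariant**
(`θ_s(I^±(A)) = I^±(θ_s(A))`, Chruściel–Costa 2008, proof of Lemma 3.6, for any Killing flow). For the
axial flow the hypothesis `ψ_s(M_ext) = M_ext` is the asymptotic input of Chruściel–Costa 2008, p. 13
("by the asymptotic analysis of [Chruściel–Maerten] there exists `R` so that for `r ≥ R` the orbits
of the `K_i`'s are entirely contained in `M_ext`"). [cite: ChruscielCosta2008, Lemma 3.6 (proof) and p. 13] -/
theorem image_flow_chronological_of_image_Mext [𝓑.metric.HasLeviCivita]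
    {Y : Π x : 𝓑.carrier, TangentSpace (𝓡 4) x} (hK : 𝓑.metric.IsKillingField Y)
    {ψ : ℝ × 𝓑.carrier → 𝓑.carrier} (hψ : ContMDiff (𝓘(ℝ, ℝ).prod (𝓡 4)) (𝓡 4) 2 ψ)
    (hψ0 : ∀ p, ψ (0, p) = p) (hψadd : ∀ s s' p, ψ (s, ψ (s', p)) = ψ (s + s', p))
    (hψY : ∀ p, IsMIntegralCurve (fun s ↦ ψ (s, p)) Y) {s : ℝ}
    (hM : (fun q ↦ ψ (s, q)) '' 𝓑.Mext = 𝓑.Mext) :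
    (fun q ↦ ψ (s, q)) '' 𝓑.metric.chronologicalFuture 𝓑.timeOrientation 𝓑.Mext =
        𝓑.metric.chronologicalFuture 𝓑.timeOrientation 𝓑.Mext ∧
      (fun q ↦ ψ (s, q)) '' 𝓑.metric.chronologicalPast 𝓑.timeOrientation 𝓑.Mext =
        𝓑.metric.chronologicalPast 𝓑.timeOrientation 𝓑.Mext := by
  constructor
  · rw [hK.image_flow_chronologicalFuture hψ hψ0 hψadd hψY, hM]
  · rw [hK.image_flow_chronologicalPast hψ hψ0 hψadd hψY, hM]

/-- **The domain of outer communications is invariant under a Killing flow preserving `M_ext`**: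
`ψ_s(⟨⟨M_ext⟩⟩) = ⟨⟨M_ext⟩⟩` (`⟨⟨M_ext⟩⟩ = I⁺(M_ext) ∩ I⁻(M_ext)`). Chruściel–Costa 2008, §2.2 and
§6.1 (the `ℝ × U(1)` action on `⟨⟨M_ext⟩⟩`). [cite: ChruscielCosta2008, §6.1] -/
theorem image_flow_doc_of_image_Mext [𝓑.metric.HasLeviCivita]
    {Y : Π x : 𝓑.carrier, TangentSpace (𝓡 4) x} (hK : 𝓑.metric.IsKillingField Y)
    {ψ : ℝ × 𝓑.carrier → 𝓑.carrier} (hψ : ContMDiff (𝓘(ℝ, ℝ).prod (𝓡 4)) (𝓡 4) 2 ψ)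
    (hψ0 : ∀ p, ψ (0, p) = p) (hψadd : ∀ s s' p, ψ (s, ψ (s', p)) = ψ (s + s', p))
    (hψY : ∀ p, IsMIntegralCurve (fun s ↦ ψ (s, p)) Y) {s : ℝ}
    (hM : (fun q ↦ ψ (s, q)) '' 𝓑.Mext = 𝓑.Mext) :
    (fun q ↦ ψ (s, q)) '' 𝓑.doc = 𝓑.doc := by
  obtain ⟨hF, hP⟩ := image_flow_chronological_of_image_Mext hK hψ hψ0 hψadd hψY hM
  show (fun q ↦ ψ (s, q)) '' 𝓑.metric.docOfEnd 𝓑.timeOrientation 𝓑.Mext =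
    𝓑.metric.docOfEnd 𝓑.timeOrientation 𝓑.Mext
  rw [LorentzianMetric.docOfEnd,
    Set.image_inter (isHomeomorph_flow hψ.continuous hψ0 hψadd s).injective, hF, hP]

/-- **The black-hole region is invariant under a Killing flow preserving `M_ext`**:
`ψ_s(𝓑) = 𝓑`, `𝓑 = M ∖ I⁻(M_ext)`. Chruściel–Costa 2008, (2.3) and §6.1. [cite: ChruscielCosta2008, §6.1] -/
theorem image_flow_blackHoleRegion_of_image_Mext [𝓑.metric.HasLeviCivita]
    {Y : Π x : 𝓑.carrier, TangentSpace (𝓡 4) x} (hK : 𝓑.metric.IsKillingField Y)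
    {ψ : ℝ × 𝓑.carrier → 𝓑.carrier} (hψ : ContMDiff (𝓘(ℝ, ℝ).prod (𝓡 4)) (𝓡 4) 2 ψ)
    (hψ0 : ∀ p, ψ (0, p) = p) (hψadd : ∀ s s' p, ψ (s, ψ (s', p)) = ψ (s + s', p))
    (hψY : ∀ p, IsMIntegralCurve (fun s ↦ ψ (s, p)) Y) {s : ℝ}
    (hM : (fun q ↦ ψ (s, q)) '' 𝓑.Mext = 𝓑.Mext) :
    (fun q ↦ ψ (s, q)) '' 𝓑.blackHoleRegion = 𝓑.blackHoleRegion := by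
  obtain ⟨-, hP⟩ := image_flow_chronological_of_image_Mext hK hψ hψ0 hψadd hψY hM
  show (fun q ↦ ψ (s, q)) '' 𝓑.metric.blackHoleRegionOfEnd 𝓑.timeOrientation 𝓑.Mext =
    𝓑.metric.blackHoleRegionOfEnd 𝓑.timeOrientation 𝓑.Mext
  rw [LorentzianMetric.blackHoleRegionOfEnd,
    Set.image_compl_eq (isHomeomorph_flow hψ.continuous hψ0 hψadd s).bijective, hP]

/-- **The future event horizon is invariant under a Killing flow preserving `M_ext`**:
`ψ_s(𝓔⁺) = 𝓔⁺`, `𝓔⁺ = ∂I⁻(M_ext) ∩ I⁺(M_ext)` — for the axial flow this is "`𝓔⁺` is invariant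
under `ℝ × U(1)`", i.e. `Y` is tangent to the horizon (Chruściel–Costa 2008, §4 and §6.1).
[cite: ChruscielCosta2008, §6.1] -/
theorem image_flow_horizon_of_image_Mext [𝓑.metric.HasLeviCivita]
    {Y : Π x : 𝓑.carrier, TangentSpace (𝓡 4) x} (hK : 𝓑.metric.IsKillingField Y)
    {ψ : ℝ × 𝓑.carrier → 𝓑.carrier} (hψ : ContMDiff (𝓘(ℝ, ℝ).prod (𝓡 4)) (𝓡 4) 2 ψ)
    (hψ0 : ∀ p, ψ (0, p) = p) (hψadd : ∀ s s' p, ψ (s, ψ (s', p)) = ψ (s + s', p))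
    (hψY : ∀ p, IsMIntegralCurve (fun s ↦ ψ (s, p)) Y) {s : ℝ}
    (hM : (fun q ↦ ψ (s, q)) '' 𝓑.Mext = 𝓑.Mext) :
    (fun q ↦ ψ (s, q)) '' 𝓑.horizon = 𝓑.horizon := by
  obtain ⟨hF, hP⟩ := image_flow_chronological_of_image_Mext hK hψ hψ0 hψadd hψY hM
  have hh := isHomeomorph_flow hψ.continuous hψ0 hψadd s
  show (fun q ↦ ψ (s, q)) '' 𝓑.metric.futureEventHorizonOfEnd 𝓑.timeOrientation 𝓑.Mext =
    𝓑.metric.futureEventHorizonOfEnd 𝓑.timeOrientation 𝓑.Mext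
  rw [LorentzianMetric.futureEventHorizonOfEnd, Set.image_inter hh.injective, hh.image_frontier,
    hP, hF]

/-- **Orbits of a Killing flow preserving `M_ext` stay in `⟨⟨M_ext⟩⟩`, resp. on `𝓔⁺`**: if
`ψ_s(M_ext) = M_ext` for all `s`, then `ψ_s p ∈ ⟨⟨M_ext⟩⟩ ↔ p ∈ ⟨⟨M_ext⟩⟩` and
`ψ_s p ∈ 𝓔⁺ ↔ p ∈ 𝓔⁺`. Chruściel–Costa 2008, §6.1. [cite: ChruscielCosta2008, §6.1] -/
theorem flow_mem_doc_iff_of_image_Mext [𝓑.metric.HasLeviCivita]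
    {Y : Π x : 𝓑.carrier, TangentSpace (𝓡 4) x} (hK : 𝓑.metric.IsKillingField Y)
    {ψ : ℝ × 𝓑.carrier → 𝓑.carrier} (hψ : ContMDiff (𝓘(ℝ, ℝ).prod (𝓡 4)) (𝓡 4) 2 ψ)
    (hψ0 : ∀ p, ψ (0, p) = p) (hψadd : ∀ s s' p, ψ (s, ψ (s', p)) = ψ (s + s', p))
    (hψY : ∀ p, IsMIntegralCurve (fun s ↦ ψ (s, p)) Y)
    (hM : ∀ s, (fun q ↦ ψ (s, q)) '' 𝓑.Mext = 𝓑.Mext) (s : ℝ) (p : 𝓑.carrier) :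
    (ψ (s, p) ∈ 𝓑.doc ↔ p ∈ 𝓑.doc) ∧ (ψ (s, p) ∈ 𝓑.horizon ↔ p ∈ 𝓑.horizon) := by
  have hinj := (isHomeomorph_flow hψ.continuous hψ0 hψadd s).injective
  have hdoc := image_flow_doc_of_image_Mext hK hψ hψ0 hψadd hψY (hM s)
  have hhor := image_flow_horizon_of_image_Mext hK hψ hψ0 hψadd hψY (hM s)
  refine ⟨⟨fun h ↦ ?_, fun h ↦ ?_⟩, ⟨fun h ↦ ?_, fun h ↦ ?_⟩⟩
  · rw [← hdoc] at h
    exact hinj.mem_set_image.1 h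
  · rw [← hdoc]
    exact Set.mem_image_of_mem _ h
  · rw [← hhor] at h
    exact hinj.mem_set_image.1 h
  · rw [← hhor]
    exact Set.mem_image_of_mem _ h

/-! ### The axis is invariant under the stationary flow (Chruściel–Costa 2008, §5.2.2) -/

/-- **The stationary flow preserves the axial Killing field**: `dφ_t (Y_p) = Y_{φ_t p}` for the flow
`φ_t` of `T = 𝓑.killing` and a Killing field `Y` with `[T, Y] = 0` (Lee 2012, Thm. 9.42, in the
tree as `mfderiv_flow_apply_eq`). In particular **the axis `𝒜 = {Y = 0}` is invariant under the
stationary flow**: `Y (φ_t p) = 0 ↔ Y p = 0` (`dφ_t` is injective). Chruściel–Costa 2008, §5.2.2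
(the axis and the `ℝ × U(1)` action). [cite: ChruscielCosta2008, §5.2.2 (p. 20)] -/
theorem apply_flow_eq_zero_iff [𝓑.metric.HasLeviCivita]
    {Y : Π x : 𝓑.carrier, TangentSpace (𝓡 4) x} (hY : 𝓑.metric.IsKillingField Y)
    (hTY : ∀ x, VectorField.mlieBracket (𝓡 4) 𝓑.killing Y x = 0)
    {θ : ℝ × 𝓑.carrier → 𝓑.carrier} (hθ : ContMDiff (𝓘(ℝ, ℝ).prod (𝓡 4)) (𝓡 4) 2 θ)
    (hθ0 : ∀ p, θ (0, p) = p) (hθadd : ∀ t s p, θ (t, θ (s, p)) = θ (t + s, p))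
    (hθX : ∀ p, IsMIntegralCurve (fun t ↦ θ (t, p)) 𝓑.killing) (t : ℝ) (p : 𝓑.carrier) :
    mfderiv (𝓡 4) (𝓡 4) (fun q ↦ θ (t, q)) p (Y p) = Y (θ (t, p)) ∧
      (Y (θ (t, p)) = 0 ↔ Y p = 0) := by
  have hT : 𝓑.metric.IsKillingField 𝓑.killing := 𝓑.isStationaryKilling.isKillingField
  have key := mfderiv_flow_apply_eq hT.contMDiff hY.contMDiff hTY hθ hθX hθ0 hθadd t p
  refine ⟨key, ?_⟩
  rw [← key]
  constructor
  · intro h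
    by_contra hne
    exact PseudoRiemannianMetric.mfderiv_flow_ne_zero hθ hθ0 hθadd t hne h
  · intro h
    rw [h, map_zero]

/-- **The axis is invariant under the stationary flow, set form**: `φ_t(𝒜) = 𝒜` for
`𝒜 = {p | Y p = 0}`. Chruściel–Costa 2008, §5.2.2. [cite: ChruscielCosta2008, §5.2.2 (p. 20)] -/
theorem image_flow_axis [𝓑.metric.HasLeviCivita]
    {Y : Π x : 𝓑.carrier, TangentSpace (𝓡 4) x} (hY : 𝓑.metric.IsKillingField Y)
    (hTY : ∀ x, VectorField.mlieBracket (𝓡 4) 𝓑.killing Y x = 0)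
    {θ : ℝ × 𝓑.carrier → 𝓑.carrier} (hθ : ContMDiff (𝓘(ℝ, ℝ).prod (𝓡 4)) (𝓡 4) 2 θ)
    (hθ0 : ∀ p, θ (0, p) = p) (hθadd : ∀ t s p, θ (t, θ (s, p)) = θ (t + s, p))
    (hθX : ∀ p, IsMIntegralCurve (fun t ↦ θ (t, p)) 𝓑.killing) (t : ℝ) :
    (fun q ↦ θ (t, q)) '' {p | Y p = 0} = {p | Y p = 0} := by
  ext x
  constructor
  · rintro ⟨p, hp, rfl⟩
    exact (apply_flow_eq_zero_iff hY hTY hθ hθ0 hθadd hθX t p).2.2 hp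
  · intro hx
    refine ⟨θ (-t, x), ?_, flow_apply_flow_neg hθ0 hθadd t x⟩
    exact (apply_flow_eq_zero_iff hY hTY hθ hθ0 hθadd hθX (-t) x).2.2 hx

/-- **The axial flow fixes the axis pointwise and the two flows commute** (for `Y` axisymmetric
Killing with `[T, Y] = 0`, `ψ` its flow from `exists_axial_flow` and `φ` the stationary flow):
`ψ_s p = p` whenever `Y p = 0` (`IsKillingField.flow_apply_eq_of_apply_eq_zero`) and
`φ_t (ψ_s q) = ψ_s (φ_t q)` (`flow_comm_of_mlieBracket_eq_zero`, Lee 2012, Thm. 9.44) — the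
`ℝ × U(1)` action of Chruściel–Costa 2008, §6.1. [cite: ChruscielCosta2008, §6.1] -/
theorem flow_comm_and_axis_fixed [𝓑.metric.HasLeviCivita]
    {Y : Π x : 𝓑.carrier, TangentSpace (𝓡 4) x} (hY : 𝓑.metric.IsKillingField Y)
    (hTY : ∀ x, VectorField.mlieBracket (𝓡 4) 𝓑.killing Y x = 0)
    {θ : ℝ × 𝓑.carrier → 𝓑.carrier} (hθ : ContMDiff (𝓘(ℝ, ℝ).prod (𝓡 4)) (𝓡 4) 2 θ)
    (hθ0 : ∀ p, θ (0, p) = p) (hθadd : ∀ t s p, θ (t, θ (s, p)) = θ (t + s, p))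
    (hθX : ∀ p, IsMIntegralCurve (fun t ↦ θ (t, p)) 𝓑.killing)
    {ψ : ℝ × 𝓑.carrier → 𝓑.carrier} (hψ0 : ∀ p, ψ (0, p) = p)
    (hψY : ∀ p, IsMIntegralCurve (fun s ↦ ψ (s, p)) Y) :
    (∀ t s q, θ (t, ψ (s, q)) = ψ (s, θ (t, q))) ∧
      ∀ {p : 𝓑.carrier}, Y p = 0 → ∀ s, ψ (s, p) = p := by
  have hT : 𝓑.metric.IsKillingField 𝓑.killing := 𝓑.isStationaryKilling.isKillingField
  exact ⟨fun t s q ↦ flow_comm_of_mlieBracket_eq_zero hT.contMDiff hY.contMDiff hTY hθ hθX hθ0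
      hθadd hψY hψ0 t s q,
    fun hp s ↦ hY.flow_apply_eq_of_apply_eq_zero hψ0 hψY hp s⟩

/-! ### Killing flows commuting with the stationary flow preserve `I^±(M_ext)`, `⟨⟨M_ext⟩⟩`, `𝓑`
and `𝓔⁺` — unconditionally (Chruściel–Costa 2008, §3 and §6.1: the action of `ℝ × U(1)` on
`⟨⟨M_ext⟩⟩`; the asymptotic input of p. 13 replaced by a causal argument) -/

section CommutingKillingFlow

variable [𝓑.metric.HasLeviCivita] {K : Π x : 𝓑.carrier, TangentSpace (𝓡 4) x}
  {ψ : ℝ × 𝓑.carrier → 𝓑.carrier}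

/-- **A Killing flow commuting with the stationary flow preserves the stationary Killing field**:
`dψₛ(T_p) = T_{ψₛ p}` for the (`C²`, group-law) flow `ψ` of a Killing field `K` with `[T, K] = 0`
(`[K, T] = -[T, K] = 0` and Lee 2012, Thm. 9.42, in the tree as `mfderiv_flow_apply_eq`). This is
the infinitesimal form of the commutation of the two one-parameter groups in Chruściel–Costa's
standing assumption "a commutative group of isometries `ℝ × 𝕋^{s-1}`" (2008, §3, p. 9).
[cite: ChruscielCosta2008, §3 (p. 9)] [cite: LeeSmoothManifolds2013, Thm. 9.42] -/
theorem mfderiv_flow_killing_eq (hK : 𝓑.metric.IsKillingField K)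
    (hTK : ∀ x, VectorField.mlieBracket (𝓡 4) 𝓑.killing K x = 0)
    (hψ : ContMDiff (𝓘(ℝ, ℝ).prod (𝓡 4)) (𝓡 4) 2 ψ)
    (hψ0 : ∀ p, ψ (0, p) = p) (hψadd : ∀ s s' p, ψ (s, ψ (s', p)) = ψ (s + s', p))
    (hψK : ∀ p, IsMIntegralCurve (fun s ↦ ψ (s, p)) K) (s : ℝ) (p : 𝓑.carrier) :
    mfderiv (𝓡 4) (𝓡 4) (fun q ↦ ψ (s, q)) p (𝓑.killing p) = 𝓑.killing (ψ (s, p)) := by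
  have hT : 𝓑.metric.IsKillingField 𝓑.killing := 𝓑.isStationaryKilling.isKillingField
  have hKT : ∀ x, VectorField.mlieBracket (𝓡 4) K 𝓑.killing x = 0 := fun x ↦ by
    rw [VectorField.mlieBracket_swap_apply, hTK x, neg_zero]
  exact mfderiv_flow_apply_eq hK.contMDiff hT.contMDiff hKT hψ hψK hψ0 hψadd s p

/-- **`T` is future timelike along `ψₛ(M_ext)`**: for `p ∈ M_ext`, `T_{ψₛ p} = dψₛ(T_p)` is the
image of a future timelike vector under a time-orientation-preserving infinitesimal isometry
(`IsKillingField.isTimelike_mfderiv_flow_iff`, `….isFutureDirected_mfderiv_flow`).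
Chruściel–Costa 2008, §3 (p. 9: `K₀` timelike on `M_ext`; the group is by isometries). [cite: ChruscielCosta2008, §3 (p. 9)] -/
theorem isTimelike_killing_flow_of_mem_Mext (hK : 𝓑.metric.IsKillingField K)
    (hTK : ∀ x, VectorField.mlieBracket (𝓡 4) 𝓑.killing K x = 0)
    (hψ : ContMDiff (𝓘(ℝ, ℝ).prod (𝓡 4)) (𝓡 4) 2 ψ)
    (hψ0 : ∀ p, ψ (0, p) = p) (hψadd : ∀ s s' p, ψ (s, ψ (s', p)) = ψ (s + s', p))
    (hψK : ∀ p, IsMIntegralCurve (fun s ↦ ψ (s, p)) K) (s : ℝ) {p : 𝓑.carrier}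
    (hp : p ∈ 𝓑.Mext) :
    𝓑.metric.IsTimelike (𝓑.killing (ψ (s, p))) ∧
      𝓑.timeOrientation.IsFutureDirected (𝓑.killing (ψ (s, p))) := by
  obtain ⟨hTp, hFp⟩ := 𝓑.isStationaryKilling.isTimelike hp
  rw [← mfderiv_flow_killing_eq hK hTK hψ hψ0 hψadd hψK s p]
  exact ⟨(hK.isTimelike_mfderiv_flow_iff hψ hψ0 hψK s _).2 hTp,
    hK.isFutureDirected_mfderiv_flow hψ hψ0 hψadd hψK s hFp⟩

/-- **`ψₛ(M_ext)` does not meet the event horizons `𝓗⁺ = ∂𝓑 = ∂I⁻(M_ext)` and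
`𝓗⁻ = ∂I⁺(M_ext)`.** At `q = ψₛ p`, `p ∈ M_ext`, the stationary orbit `t ↦ φₜ q = ψₛ(φₜ p)` (the
flows commute, Lee 2012, Thm. 9.44, `flow_comm_of_mlieBracket_eq_zero`) is future timelike, so
`φ₁ q ∈ I⁺(q)`; both horizons are `φ`-invariant achronal boundaries (Hawking–Ellis 1973,
Prop. 6.3.1: `IsPastSet/IsFutureSet.isAchronal_frontier`), so `q` on one of them would exhibit
two chronologically related points of an achronal set. This is the argument of Chruściel–Costa's
Lemma 3.6 ("the null achronal boundaries `İ^∓(C) ∩ M_ext` are invariant under the flow … this is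
compatible with Lemma 3.4 if and only if `İ^∓(C) ∩ M_ext = ∅`") run at the translated point
`ψₛ p`. [cite: ChruscielCosta2008, Lemma 3.6 (proof)] [cite: HawkingEllis1973, §6.3, Prop. 6.3.1] -/
theorem flow_apply_not_mem_frontier_of_mem_Mext (hK : 𝓑.metric.IsKillingField K)
    (hTK : ∀ x, VectorField.mlieBracket (𝓡 4) 𝓑.killing K x = 0)
    (hψ : ContMDiff (𝓘(ℝ, ℝ).prod (𝓡 4)) (𝓡 4) 2 ψ)
    (hψ0 : ∀ p, ψ (0, p) = p) (hψadd : ∀ s s' p, ψ (s, ψ (s', p)) = ψ (s + s', p))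
    (hψK : ∀ p, IsMIntegralCurve (fun s ↦ ψ (s, p)) K) (s : ℝ) {p : 𝓑.carrier}
    (hp : p ∈ 𝓑.Mext) :
    ψ (s, p) ∉ frontier 𝓑.blackHoleRegion ∧
      ψ (s, p) ∉ frontier (𝓑.metric.chronologicalFuture 𝓑.timeOrientation 𝓑.Mext) := by
  obtain ⟨θ, hθ, hθ0, hθadd, hθX, -, -, -, hθF, hθP, -⟩ := 𝓑.exists_stationary_flow
  have hT : 𝓑.metric.IsKillingField 𝓑.killing := 𝓑.isStationaryKilling.isKillingField
  have hθ2 : ContMDiff (𝓘(ℝ, ℝ).prod (𝓡 4)) (𝓡 4) 2 θ := hθ.of_le (WithTop.coe_le_coe.mpr le_top)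
  have hh := isHomeomorph_flow hθ.continuous hθ0 hθadd 1
  -- the stationary orbit of `q := ψₛ p` is the `ψₛ`-image of the orbit of `p ∈ M_ext`
  have hcomm : ∀ t, θ (t, ψ (s, p)) = ψ (s, θ (t, p)) := fun t ↦
    flow_comm_of_mlieBracket_eq_zero hT.contMDiff hK.contMDiff hTK hθ2 hθX hθ0 hθadd hψK hψ0 t s p
  have htl : ∀ t, 𝓑.metric.IsTimelike (𝓑.killing (θ (t, ψ (s, p)))) ∧
      𝓑.timeOrientation.IsFutureDirected (𝓑.killing (θ (t, ψ (s, p)))) := fun t ↦ by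
    rw [hcomm t]
    exact isTimelike_killing_flow_of_mem_Mext hK hTK hψ hψ0 hψadd hψK s
      (𝓑.Mext_invariant (hθX p) (by simpa only [hθ0] using hp) t)
  have h1 : θ (1, ψ (s, p)) ∈ 𝓑.metric.chronologicalFuture 𝓑.timeOrientation {ψ (s, p)} := by
    have h : θ (1, ψ (s, p)) ∈
        𝓑.metric.chronologicalFuture 𝓑.timeOrientation {θ (0, ψ (s, p))} :=
      LorentzianMetric.apply_mem_chronologicalFuture_of_isMIntegralCurve (hθX _) zero_lt_one
        fun t _ ↦ htl t
    rwa [hθ0] at h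
  constructor
  · intro hfr
    have hfr' : ψ (s, p) ∈ frontier (𝓑.metric.chronologicalPast 𝓑.timeOrientation 𝓑.Mext) := by
      have h : frontier 𝓑.blackHoleRegion =
          frontier (𝓑.metric.chronologicalPast 𝓑.timeOrientation 𝓑.Mext) :=
        LorentzianMetric.frontier_blackHoleRegionOfEnd 𝓑.Mext
      exact h ▸ hfr
    have hfr1 : θ (1, ψ (s, p)) ∈
        frontier (𝓑.metric.chronologicalPast 𝓑.timeOrientation 𝓑.Mext) := by
      have h := Set.mem_image_of_mem (fun r ↦ θ (1, r)) hfr'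
      rwa [hh.image_frontier, hθP 1] at h
    exact (LorentzianMetric.isPastSet_chronologicalPast 𝓑.Mext).isAchronal_frontier _ hfr' _ hfr1 h1
  · intro hfr
    have hfut : 𝓑.metric.IsFutureSet 𝓑.timeOrientation
        (𝓑.metric.chronologicalFuture 𝓑.timeOrientation 𝓑.Mext) :=
      fun _ ⟨r, hr, h⟩ ↦ LorentzianMetric.mem_chronologicalFuture_trans hr ⟨r, rfl, h⟩
    have hfr1 : θ (1, ψ (s, p)) ∈
        frontier (𝓑.metric.chronologicalFuture 𝓑.timeOrientation 𝓑.Mext) := by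
      have h := Set.mem_image_of_mem (fun r ↦ θ (1, r)) hfr
      rwa [hh.image_frontier, hθF 1] at h
    exact hfut.isAchronal_frontier _ hfr _ hfr1 h1

/-- **The orbits through `M_ext` of a Killing flow commuting with the stationary flow stay in
`⟨⟨M_ext⟩⟩`** — for every stationary AF black hole and with NO asymptotic hypothesis on `K`: the
set `{s | ψₛ p ∈ ⟨⟨M_ext⟩⟩}` is open (`⟨⟨M_ext⟩⟩` is open), closed (a parameter in its closure
gives a point of `cl ⟨⟨M_ext⟩⟩`, and `∂⟨⟨M_ext⟩⟩ ⊆ 𝓗⁺ ∪ 𝓗⁻` is excluded by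
`flow_apply_not_mem_frontier_of_mem_Mext`) and contains `0` (`M_ext ⊆ ⟨⟨M_ext⟩⟩`), hence is all
of `ℝ`. Chruściel–Costa 2008 draw the corresponding statement for the axial flows from the
asymptotics of Killing vectors (§4.2, p. 13: "by the asymptotic analysis of [Chruściel–Maerten]
there exists `R` so that for `r ≥ R` the orbits of the `K_i`'s are entirely contained in
`M_ext`"); the present causal argument dispenses with it and makes the hypothesis
`ψₛ(M_ext) = M_ext` of `image_flow_doc_of_image_Mext` unnecessary (`image_flow_doc` below).
[cite: ChruscielCosta2008, §3 (p. 9), Lemma 3.6 and §4.2 (p. 13)] -/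
theorem flow_apply_mem_doc_of_mem_Mext (hK : 𝓑.metric.IsKillingField K)
    (hTK : ∀ x, VectorField.mlieBracket (𝓡 4) 𝓑.killing K x = 0)
    (hψ : ContMDiff (𝓘(ℝ, ℝ).prod (𝓡 4)) (𝓡 4) 2 ψ)
    (hψ0 : ∀ p, ψ (0, p) = p) (hψadd : ∀ s s' p, ψ (s, ψ (s', p)) = ψ (s + s', p))
    (hψK : ∀ p, IsMIntegralCurve (fun s ↦ ψ (s, p)) K) {p : 𝓑.carrier} (hp : p ∈ 𝓑.Mext)
    (s : ℝ) : ψ (s, p) ∈ 𝓑.doc := by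
  set S : Set ℝ := {s | ψ (s, p) ∈ 𝓑.doc} with hS
  have hcont : Continuous fun s : ℝ ↦ ψ (s, p) :=
    hψ.continuous.comp (continuous_id.prodMk continuous_const)
  have hdoc : IsOpen 𝓑.doc :=
    (LorentzianMetric.isOpen_chronologicalFuture_of_boundaryless 𝓑.metric 𝓑.timeOrientation
      𝓑.Mext).inter
      (LorentzianMetric.isOpen_chronologicalPast_of_boundaryless 𝓑.metric 𝓑.timeOrientation 𝓑.Mext)
  have hopen : IsOpen S := hdoc.preimage hcont
  have hclosed : IsClosed S := by
    refine isClosed_of_closure_subset fun s₀ hs₀ ↦ ?_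
    have hcl : ψ (s₀, p) ∈ closure 𝓑.doc := hcont.closure_preimage_subset _ hs₀
    by_contra hns
    have hns' : ψ (s₀, p) ∉ 𝓑.doc := hns
    have hfr : ψ (s₀, p) ∈ frontier 𝓑.doc := ⟨hcl, fun hint ↦ hns' (interior_subset hint)⟩
    rcases 𝓑.frontier_doc_subset hfr with h | h
    · exact (flow_apply_not_mem_frontier_of_mem_Mext hK hTK hψ hψ0 hψadd hψK s₀ hp).1 h
    · exact (flow_apply_not_mem_frontier_of_mem_Mext hK hTK hψ hψ0 hψadd hψK s₀ hp).2 h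
  have h0 : (0 : ℝ) ∈ S := by
    show ψ (0, p) ∈ 𝓑.doc
    rw [hψ0]
    exact 𝓑.Mext_subset_doc hp
  have huniv : S = Set.univ := IsClopen.eq_univ ⟨hclosed, hopen⟩ ⟨0, h0⟩
  have hs : s ∈ S := huniv ▸ Set.mem_univ s
  exact hs

/-- **`ψₛ(M_ext) ⊆ ⟨⟨M_ext⟩⟩`** for every Killing flow commuting with the stationary flow (set
form of `flow_apply_mem_doc_of_mem_Mext`). [cite: ChruscielCosta2008, §3 (p. 9) and Lemma 3.6] -/
theorem image_flow_Mext_subset_doc (hK : 𝓑.metric.IsKillingField K)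
    (hTK : ∀ x, VectorField.mlieBracket (𝓡 4) 𝓑.killing K x = 0)
    (hψ : ContMDiff (𝓘(ℝ, ℝ).prod (𝓡 4)) (𝓡 4) 2 ψ)
    (hψ0 : ∀ p, ψ (0, p) = p) (hψadd : ∀ s s' p, ψ (s, ψ (s', p)) = ψ (s + s', p))
    (hψK : ∀ p, IsMIntegralCurve (fun s ↦ ψ (s, p)) K) (s : ℝ) :
    (fun q ↦ ψ (s, q)) '' 𝓑.Mext ⊆ 𝓑.doc := by
  rintro _ ⟨p, hp, rfl⟩
  exact flow_apply_mem_doc_of_mem_Mext hK hTK hψ hψ0 hψadd hψK hp s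

/-- **`I^±(ψₛ(M_ext)) = I^±(M_ext)`.** `⊆`: `ψₛ(M_ext) ⊆ ⟨⟨M_ext⟩⟩` and `I^±(⟨⟨M_ext⟩⟩) = I^±(M_ext)`;
`⊇`: `M_ext ⊆ ψₛ(⟨⟨M_ext⟩⟩)` (the previous inclusion for `ψ₋ₛ`) and `I^±(ψₛ A) = ψₛ(I^±(A))`
(Killing flows commute with chronological futures and pasts,
`IsKillingField.image_flow_chronologicalFuture/Past`). So the translated end `ψₛ(M_ext)` defines
the same domain of outer communications, black-hole region and event horizon as `M_ext`.
[cite: ChruscielCosta2008, §2.2 (2.2) and Lemma 3.6] -/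
theorem chronologicalFuture_image_flow_Mext (hK : 𝓑.metric.IsKillingField K)
    (hTK : ∀ x, VectorField.mlieBracket (𝓡 4) 𝓑.killing K x = 0)
    (hψ : ContMDiff (𝓘(ℝ, ℝ).prod (𝓡 4)) (𝓡 4) 2 ψ)
    (hψ0 : ∀ p, ψ (0, p) = p) (hψadd : ∀ s s' p, ψ (s, ψ (s', p)) = ψ (s + s', p))
    (hψK : ∀ p, IsMIntegralCurve (fun s ↦ ψ (s, p)) K) (s : ℝ) :
    𝓑.metric.chronologicalFuture 𝓑.timeOrientation ((fun q ↦ ψ (s, q)) '' 𝓑.Mext) =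
        𝓑.metric.chronologicalFuture 𝓑.timeOrientation 𝓑.Mext ∧
      𝓑.metric.chronologicalPast 𝓑.timeOrientation ((fun q ↦ ψ (s, q)) '' 𝓑.Mext) =
        𝓑.metric.chronologicalPast 𝓑.timeOrientation 𝓑.Mext := by
  have hsub := image_flow_Mext_subset_doc hK hTK hψ hψ0 hψadd hψK s
  have hsub' : 𝓑.Mext ⊆ (fun q ↦ ψ (s, q)) '' 𝓑.doc := fun x hx ↦
    ⟨ψ (-s, x), flow_apply_mem_doc_of_mem_Mext hK hTK hψ hψ0 hψadd hψK hx (-s),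
      flow_apply_flow_neg hψ0 hψadd s x⟩
  constructor
  · refine Set.Subset.antisymm ((LorentzianMetric.chronologicalFuture_mono hsub).trans
      (LorentzianMetric.chronologicalFuture_docOfEnd_subset 𝓑.Mext)) ?_
    calc 𝓑.metric.chronologicalFuture 𝓑.timeOrientation 𝓑.Mext
        ⊆ 𝓑.metric.chronologicalFuture 𝓑.timeOrientation ((fun q ↦ ψ (s, q)) '' 𝓑.doc) :=
          LorentzianMetric.chronologicalFuture_mono hsub'
      _ = (fun q ↦ ψ (s, q)) '' 𝓑.metric.chronologicalFuture 𝓑.timeOrientation 𝓑.doc :=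
          (hK.image_flow_chronologicalFuture hψ hψ0 hψadd hψK s 𝓑.doc).symm
      _ = (fun q ↦ ψ (s, q)) '' 𝓑.metric.chronologicalFuture 𝓑.timeOrientation 𝓑.Mext := by
          rw [𝓑.chronologicalFuture_doc]
      _ = _ := hK.image_flow_chronologicalFuture hψ hψ0 hψadd hψK s 𝓑.Mext
  · refine Set.Subset.antisymm ((LorentzianMetric.chronologicalPast_mono hsub).trans
      (LorentzianMetric.chronologicalPast_docOfEnd_subset 𝓑.Mext)) ?_
    calc 𝓑.metric.chronologicalPast 𝓑.timeOrientation 𝓑.Mext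
        ⊆ 𝓑.metric.chronologicalPast 𝓑.timeOrientation ((fun q ↦ ψ (s, q)) '' 𝓑.doc) :=
          LorentzianMetric.chronologicalPast_mono hsub'
      _ = (fun q ↦ ψ (s, q)) '' 𝓑.metric.chronologicalPast 𝓑.timeOrientation 𝓑.doc :=
          (hK.image_flow_chronologicalPast hψ hψ0 hψadd hψK s 𝓑.doc).symm
      _ = (fun q ↦ ψ (s, q)) '' 𝓑.metric.chronologicalPast 𝓑.timeOrientation 𝓑.Mext := by
          rw [𝓑.chronologicalPast_doc]
      _ = _ := hK.image_flow_chronologicalPast hψ hψ0 hψadd hψK s 𝓑.Mext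

/-- **`ψₛ(I^±(M_ext)) = I^±(M_ext)`**: every Killing flow commuting with the stationary flow leaves
`I⁺(M_ext)` and `I⁻(M_ext)` invariant — the unconditional form of
`image_flow_chronological_of_image_Mext`. [cite: ChruscielCosta2008, Lemma 3.6 and §6.1] -/
theorem image_flow_chronological (hK : 𝓑.metric.IsKillingField K)
    (hTK : ∀ x, VectorField.mlieBracket (𝓡 4) 𝓑.killing K x = 0)
    (hψ : ContMDiff (𝓘(ℝ, ℝ).prod (𝓡 4)) (𝓡 4) 2 ψ)
    (hψ0 : ∀ p, ψ (0, p) = p) (hψadd : ∀ s s' p, ψ (s, ψ (s', p)) = ψ (s + s', p))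
    (hψK : ∀ p, IsMIntegralCurve (fun s ↦ ψ (s, p)) K) (s : ℝ) :
    (fun q ↦ ψ (s, q)) '' 𝓑.metric.chronologicalFuture 𝓑.timeOrientation 𝓑.Mext =
        𝓑.metric.chronologicalFuture 𝓑.timeOrientation 𝓑.Mext ∧
      (fun q ↦ ψ (s, q)) '' 𝓑.metric.chronologicalPast 𝓑.timeOrientation 𝓑.Mext =
        𝓑.metric.chronologicalPast 𝓑.timeOrientation 𝓑.Mext := by
  obtain ⟨hF, hP⟩ := chronologicalFuture_image_flow_Mext hK hTK hψ hψ0 hψadd hψK s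
  constructor
  · rw [hK.image_flow_chronologicalFuture hψ hψ0 hψadd hψK, hF]
  · rw [hK.image_flow_chronologicalPast hψ hψ0 hψadd hψK, hP]

/-- **The domain of outer communications is invariant under every Killing flow commuting with
the stationary flow**: `ψₛ(⟨⟨M_ext⟩⟩) = ⟨⟨M_ext⟩⟩`. For the axial flow this is the (tacit) fact that
the isometry group `ℝ × U(1)` of Chruściel–Costa 2008, §3 and §§5–6, acts on `⟨⟨M_ext⟩⟩` ("in
view of Theorem 4.6, the analysis of Section 5 applies", §7.1) — here for an arbitrary stationary AF
black hole carrying such a Killing field, the unconditional form of `image_flow_doc_of_image_Mext`.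
[cite: ChruscielCosta2008, §6.1 and §7.1] [cite: ChruscielCostaHeusler2012, §3.2.1 (p. 10)] -/
theorem image_flow_doc (hK : 𝓑.metric.IsKillingField K)
    (hTK : ∀ x, VectorField.mlieBracket (𝓡 4) 𝓑.killing K x = 0)
    (hψ : ContMDiff (𝓘(ℝ, ℝ).prod (𝓡 4)) (𝓡 4) 2 ψ)
    (hψ0 : ∀ p, ψ (0, p) = p) (hψadd : ∀ s s' p, ψ (s, ψ (s', p)) = ψ (s + s', p))
    (hψK : ∀ p, IsMIntegralCurve (fun s ↦ ψ (s, p)) K) (s : ℝ) :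
    (fun q ↦ ψ (s, q)) '' 𝓑.doc = 𝓑.doc := by
  obtain ⟨hF, hP⟩ := image_flow_chronological hK hTK hψ hψ0 hψadd hψK s
  show (fun q ↦ ψ (s, q)) '' 𝓑.metric.docOfEnd 𝓑.timeOrientation 𝓑.Mext =
    𝓑.metric.docOfEnd 𝓑.timeOrientation 𝓑.Mext
  rw [LorentzianMetric.docOfEnd,
    Set.image_inter (isHomeomorph_flow hψ.continuous hψ0 hψadd s).injective, hF, hP]

/-- **The black-hole region `𝓑 = M ∖ I⁻(M_ext)` is invariant under every Killing flow commuting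
with the stationary flow.** Chruściel–Costa 2008, (2.3) and §6.1. [cite: ChruscielCosta2008, §2.2 (2.3) and §6.1] -/
theorem image_flow_blackHoleRegion (hK : 𝓑.metric.IsKillingField K)
    (hTK : ∀ x, VectorField.mlieBracket (𝓡 4) 𝓑.killing K x = 0)
    (hψ : ContMDiff (𝓘(ℝ, ℝ).prod (𝓡 4)) (𝓡 4) 2 ψ)
    (hψ0 : ∀ p, ψ (0, p) = p) (hψadd : ∀ s s' p, ψ (s, ψ (s', p)) = ψ (s + s', p))
    (hψK : ∀ p, IsMIntegralCurve (fun s ↦ ψ (s, p)) K) (s : ℝ) :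
    (fun q ↦ ψ (s, q)) '' 𝓑.blackHoleRegion = 𝓑.blackHoleRegion := by
  obtain ⟨-, hP⟩ := image_flow_chronological hK hTK hψ hψ0 hψadd hψK s
  show (fun q ↦ ψ (s, q)) '' 𝓑.metric.blackHoleRegionOfEnd 𝓑.timeOrientation 𝓑.Mext =
    𝓑.metric.blackHoleRegionOfEnd 𝓑.timeOrientation 𝓑.Mext
  rw [LorentzianMetric.blackHoleRegionOfEnd,
    Set.image_compl_eq (isHomeomorph_flow hψ.continuous hψ0 hψadd s).bijective, hP]

/-- **The future event horizon is invariant under every Killing flow commuting with the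
stationary flow**: `ψₛ(𝓔⁺) = 𝓔⁺` — for the axial field, "`Y` is tangent to `𝓔⁺`", i.e. `𝓔⁺` is
invariant under `ℝ × U(1)` (Chruściel–Costa 2008, §4.1: the event horizon is "a null achronal
hypersurface invariant under the isometry group"; used in §4.4 and §5 for the horizon Killing
field `K₀ + Ω K₁`). Unconditional form of `image_flow_horizon_of_image_Mext`.
[cite: ChruscielCosta2008, §4.1 and §6.1] -/
theorem image_flow_horizon (hK : 𝓑.metric.IsKillingField K)
    (hTK : ∀ x, VectorField.mlieBracket (𝓡 4) 𝓑.killing K x = 0)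
    (hψ : ContMDiff (𝓘(ℝ, ℝ).prod (𝓡 4)) (𝓡 4) 2 ψ)
    (hψ0 : ∀ p, ψ (0, p) = p) (hψadd : ∀ s s' p, ψ (s, ψ (s', p)) = ψ (s + s', p))
    (hψK : ∀ p, IsMIntegralCurve (fun s ↦ ψ (s, p)) K) (s : ℝ) :
    (fun q ↦ ψ (s, q)) '' 𝓑.horizon = 𝓑.horizon := by
  obtain ⟨hF, hP⟩ := image_flow_chronological hK hTK hψ hψ0 hψadd hψK s
  have hh := isHomeomorph_flow hψ.continuous hψ0 hψadd s
  show (fun q ↦ ψ (s, q)) '' 𝓑.metric.futureEventHorizonOfEnd 𝓑.timeOrientation 𝓑.Mext =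
    𝓑.metric.futureEventHorizonOfEnd 𝓑.timeOrientation 𝓑.Mext
  rw [LorentzianMetric.futureEventHorizonOfEnd, Set.image_inter hh.injective, hh.image_frontier,
    hP, hF]

/-- Pointwise form: for a Killing flow `ψ` commuting with the stationary flow,
`ψₛ p ∈ ⟨⟨M_ext⟩⟩ ↔ p ∈ ⟨⟨M_ext⟩⟩`, `ψₛ p ∈ 𝓔⁺ ↔ p ∈ 𝓔⁺`, `ψₛ p ∈ 𝓑 ↔ p ∈ 𝓑`.
[cite: ChruscielCosta2008, §6.1] -/
theorem flow_mem_iff (hK : 𝓑.metric.IsKillingField K)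
    (hTK : ∀ x, VectorField.mlieBracket (𝓡 4) 𝓑.killing K x = 0)
    (hψ : ContMDiff (𝓘(ℝ, ℝ).prod (𝓡 4)) (𝓡 4) 2 ψ)
    (hψ0 : ∀ p, ψ (0, p) = p) (hψadd : ∀ s s' p, ψ (s, ψ (s', p)) = ψ (s + s', p))
    (hψK : ∀ p, IsMIntegralCurve (fun s ↦ ψ (s, p)) K) (s : ℝ) (p : 𝓑.carrier) :
    (ψ (s, p) ∈ 𝓑.doc ↔ p ∈ 𝓑.doc) ∧ (ψ (s, p) ∈ 𝓑.horizon ↔ p ∈ 𝓑.horizon) ∧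
      (ψ (s, p) ∈ 𝓑.blackHoleRegion ↔ p ∈ 𝓑.blackHoleRegion) := by
  have hinj := (isHomeomorph_flow hψ.continuous hψ0 hψadd s).injective
  have hdoc := image_flow_doc hK hTK hψ hψ0 hψadd hψK s
  have hhor := image_flow_horizon hK hTK hψ hψ0 hψadd hψK s
  have hbh := image_flow_blackHoleRegion hK hTK hψ hψ0 hψadd hψK s
  refine ⟨⟨fun h ↦ ?_, fun h ↦ ?_⟩, ⟨fun h ↦ ?_, fun h ↦ ?_⟩, ⟨fun h ↦ ?_, fun h ↦ ?_⟩⟩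
  · rw [← hdoc] at h
    exact hinj.mem_set_image.1 h
  · rw [← hdoc]
    exact Set.mem_image_of_mem _ h
  · rw [← hhor] at h
    exact hinj.mem_set_image.1 h
  · rw [← hhor]
    exact Set.mem_image_of_mem _ h
  · rw [← hbh] at h
    exact hinj.mem_set_image.1 h
  · rw [← hbh]
    exact Set.mem_image_of_mem _ h

/-- **A Killing field commuting with the stationary one is nowhere timelike on the event horizons
`𝓗⁺ = ∂𝓑` and `𝓗⁻ = ∂I⁺(M_ext)`.** Its flow preserves these achronal boundaries
(`image_flow_blackHoleRegion`, `image_flow_chronological`); were `K_q` timelike at a point `q` of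
one of them, the orbit of `q` — along which `g(K, K)` is constant
(`IsKillingField.val_self_apply_eq_of_isMIntegralCurve`) and the time orientation of `K` persists
(`….isFutureDirected/isPastDirected_apply_of_isMIntegralCurve`) — run forwards or backwards for
unit parameter time would be a future timelike curve between two of its points. Applies to `K = T`,
to an axial `Y` and to the combinations `T + Ω Y`: on the horizons these are spacelike, null or
zero (Chruściel–Costa 2008, §4.1: the horizons are "null achronal hypersurfaces … invariant under
the isometry group"). [cite: ChruscielCosta2008, §4.1 (first paragraph) and Lemma 3.6] [cite: HawkingEllis1973, §6.3, Prop. 6.3.1] -/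
theorem not_isTimelike_of_mem_frontier (hK : 𝓑.metric.IsKillingField K)
    (hTK : ∀ x, VectorField.mlieBracket (𝓡 4) 𝓑.killing K x = 0)
    (hψ : ContMDiff (𝓘(ℝ, ℝ).prod (𝓡 4)) (𝓡 4) 2 ψ)
    (hψ0 : ∀ p, ψ (0, p) = p) (hψadd : ∀ s s' p, ψ (s, ψ (s', p)) = ψ (s + s', p))
    (hψK : ∀ p, IsMIntegralCurve (fun s ↦ ψ (s, p)) K) {q : 𝓑.carrier}
    (hq : q ∈ frontier 𝓑.blackHoleRegion ∨
      q ∈ frontier (𝓑.metric.chronologicalFuture 𝓑.timeOrientation 𝓑.Mext)) :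
    ¬ 𝓑.metric.IsTimelike (K q) := by
  -- an achronal set `A ∋ q` invariant under the flow of `K`
  obtain ⟨A, hqA, hA, hAinv⟩ : ∃ A : Set 𝓑.carrier, q ∈ A ∧
      𝓑.metric.IsAchronal 𝓑.timeOrientation A ∧ ∀ s, (fun r ↦ ψ (s, r)) '' A = A := by
    obtain ⟨hF, hP⟩ := fun s ↦ image_flow_chronological hK hTK hψ hψ0 hψadd hψK s, trivial
    rcases hq with hq | hq
    · refine ⟨frontier 𝓑.blackHoleRegion, hq, 𝓑.isAchronal_frontier_blackHoleRegion, fun s ↦ ?_⟩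
      rw [(isHomeomorph_flow hψ.continuous hψ0 hψadd s).image_frontier,
        image_flow_blackHoleRegion hK hTK hψ hψ0 hψadd hψK s]
    · refine ⟨_, hq, ?_, fun s ↦ ?_⟩
      · have hfut : 𝓑.metric.IsFutureSet 𝓑.timeOrientation
            (𝓑.metric.chronologicalFuture 𝓑.timeOrientation 𝓑.Mext) :=
          fun _ ⟨r, hr, h⟩ ↦ LorentzianMetric.mem_chronologicalFuture_trans hr ⟨r, rfl, h⟩
        exact hfut.isAchronal_frontier
      · rw [(isHomeomorph_flow hψ.continuous hψ0 hψadd s).image_frontier,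
          (image_flow_chronological hK hTK hψ hψ0 hψadd hψK s).1]
  have hmemA : ∀ s, ψ (s, q) ∈ A := fun s ↦ by
    rw [← hAinv s]
    exact Set.mem_image_of_mem _ hqA
  intro ht
  have hc : 𝓑.metric.IsCausal (K q) := ⟨ht.le, fun h0 ↦ by
    have h := ht
    rw [LorentzianMetric.IsTimelike, h0] at h
    simp at h⟩
  -- `g(K, K)` is constant along the orbit `s ↦ ψₛ q`
  have hval : ∀ s, 𝓑.metric.val (ψ (s, q)) (K (ψ (s, q))) (K (ψ (s, q))) =
      𝓑.metric.val q (K q) (K q) := fun s ↦ by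
    have h := hK.val_self_apply_eq_of_isMIntegralCurve (hψK q) s 0
    rw [hψ0] at h
    exact h
  rcases 𝓑.timeOrientation.isFutureDirected_or_isPastDirected_of_isCausal hc with hfut | hpast
  · -- `ψ₁ q ∈ I⁺(q)`, both on the achronal set `A`
    have hfd : ∀ s, 𝓑.timeOrientation.IsFutureDirected (K (ψ (s, q))) := fun s ↦ by
      exact hK.isFutureDirected_apply_of_isMIntegralCurve (hψK q) (by rw [hψ0]; exact hfut) s
    have h1 : ψ (1, q) ∈ 𝓑.metric.chronologicalFuture 𝓑.timeOrientation {ψ (0, q)} :=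
      LorentzianMetric.apply_mem_chronologicalFuture_of_isMIntegralCurve (hψK q) zero_lt_one
        fun s _ ↦ ⟨by
          show 𝓑.metric.val (ψ (s, q)) (K (ψ (s, q))) (K (ψ (s, q))) < 0
          rw [hval s]; exact ht, hfd s⟩
    rw [hψ0] at h1
    exact hA q hqA _ (hmemA 1) h1
  · -- the reversed orbit `s ↦ ψ₋ₛ q`, an integral curve of `-K`, is future timelike
    have hδ : IsMIntegralCurve ((fun s ↦ ψ (s, q)) ∘ (· * (-1 : ℝ))) ((-1 : ℝ) • K) :=
      (hψK q).comp_mul (-1)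
    have hpd : ∀ s, 𝓑.timeOrientation.IsPastDirected (K (ψ (s, q))) := fun s ↦
      hK.isPastDirected_apply_of_isMIntegralCurve (hψK q) (by rw [hψ0]; exact hpast) s
    have h1 : ((fun s ↦ ψ (s, q)) ∘ (· * (-1 : ℝ))) 1 ∈
        𝓑.metric.chronologicalFuture 𝓑.timeOrientation
          {((fun s ↦ ψ (s, q)) ∘ (· * (-1 : ℝ))) 0} := by
      refine LorentzianMetric.apply_mem_chronologicalFuture_of_isMIntegralCurve hδ zero_lt_one
        fun s _ ↦ ⟨?_, ?_⟩
      · simp only [Function.comp_apply, Pi.smul_apply, neg_one_smul,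
          LorentzianMetric.isTimelike_neg_iff]
        show 𝓑.metric.val _ _ _ < 0
        rw [hval]; exact ht
      · simp only [Function.comp_apply, Pi.smul_apply, neg_one_smul,
          TimeOrientation.isFutureDirected_neg_iff]
        exact hpd _
    simp only [Function.comp_apply, one_mul, zero_mul, hψ0] at h1
    exact hA q hqA _ (hmemA (-1)) h1

/-- **On the future event horizon `𝓔⁺ ⊆ 𝓗⁺` a Killing field commuting with the stationary one is
not timelike** (`g(K, K) ≥ 0` there). Chruściel–Costa 2008, §4.1. [cite: ChruscielCosta2008, §4.1 (first paragraph)] -/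
theorem not_isTimelike_of_mem_horizon (hK : 𝓑.metric.IsKillingField K)
    (hTK : ∀ x, VectorField.mlieBracket (𝓡 4) 𝓑.killing K x = 0)
    (hψ : ContMDiff (𝓘(ℝ, ℝ).prod (𝓡 4)) (𝓡 4) 2 ψ)
    (hψ0 : ∀ p, ψ (0, p) = p) (hψadd : ∀ s s' p, ψ (s, ψ (s', p)) = ψ (s + s', p))
    (hψK : ∀ p, IsMIntegralCurve (fun s ↦ ψ (s, p)) K) {q : 𝓑.carrier} (hq : q ∈ 𝓑.horizon) :
    ¬ 𝓑.metric.IsTimelike (K q) := by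
  refine not_isTimelike_of_mem_frontier hK hTK hψ hψ0 hψadd hψK (Or.inl ?_)
  have h : frontier 𝓑.blackHoleRegion =
      frontier (𝓑.metric.chronologicalPast 𝓑.timeOrientation 𝓑.Mext) :=
    LorentzianMetric.frontier_blackHoleRegionOfEnd 𝓑.Mext
  rw [h]
  exact hq.1

end CommutingKillingFlow

/-- **The `U(1)` action of an axisymmetric Killing field commuting with `T` acts on `I^±(M_ext)`,
`⟨⟨M_ext⟩⟩`, `𝓑` and `𝓔⁺`, and `Y` is not timelike on `𝓔⁺`** — the `ℝ × U(1)` setting of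
Chruściel–Costa 2008, §§5–6, on the domain of outer communications of an ARBITRARY stationary AF
black hole with the symmetry hypothesis `IsStationaryAxisymmetric` of
`ChruscielCostaHeusler2012_axisymmetricUniqueness`, with no asymptotic condition on `Y`
(`exists_axial_flow` combined with `image_flow_chronological`, `image_flow_doc`,
`image_flow_blackHoleRegion`, `image_flow_horizon`, `flow_mem_iff`, `not_isTimelike_of_mem_horizon`).
[cite: ChruscielCosta2008, §6.1 (the ℝ × U(1) action)] [cite: ChruscielCostaHeusler2012, §3.2.1 (p. 10) and Thm. 3.2] -/
theorem exists_axial_flow_preserving [𝓑.metric.HasLeviCivita]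
    {Y : Π x : 𝓑.carrier, TangentSpace (𝓡 4) x} (hY : 𝓑.toSpacetime.IsAxisymmetricKilling Y)
    (hTY : ∀ x, VectorField.mlieBracket (𝓡 4) 𝓑.killing Y x = 0) :
    ∃ ψ : ℝ × 𝓑.carrier → 𝓑.carrier, ContMDiff (𝓘(ℝ, ℝ).prod (𝓡 4)) (𝓡 4) ∞ ψ ∧
      (∀ p, ψ (0, p) = p) ∧ (∀ s s' p, ψ (s, ψ (s', p)) = ψ (s + s', p)) ∧
      (∀ p, IsMIntegralCurve (fun s ↦ ψ (s, p)) Y) ∧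
      (∀ s p, ψ (s + 2 * Real.pi, p) = ψ (s, p)) ∧
      (∀ s, (fun q ↦ ψ (s, q)) '' 𝓑.metric.chronologicalFuture 𝓑.timeOrientation 𝓑.Mext =
        𝓑.metric.chronologicalFuture 𝓑.timeOrientation 𝓑.Mext) ∧
      (∀ s, (fun q ↦ ψ (s, q)) '' 𝓑.metric.chronologicalPast 𝓑.timeOrientation 𝓑.Mext =
        𝓑.metric.chronologicalPast 𝓑.timeOrientation 𝓑.Mext) ∧
      (∀ s, (fun q ↦ ψ (s, q)) '' 𝓑.doc = 𝓑.doc) ∧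
      (∀ s, (fun q ↦ ψ (s, q)) '' 𝓑.blackHoleRegion = 𝓑.blackHoleRegion) ∧
      (∀ s, (fun q ↦ ψ (s, q)) '' 𝓑.horizon = 𝓑.horizon) ∧
      (∀ s p, (ψ (s, p) ∈ 𝓑.doc ↔ p ∈ 𝓑.doc) ∧ (ψ (s, p) ∈ 𝓑.horizon ↔ p ∈ 𝓑.horizon)) ∧
      ∀ q ∈ 𝓑.horizon, ¬ 𝓑.metric.IsTimelike (Y q) := by
  obtain ⟨ψ, hψ, hψ0, hψadd, hψY, hper, -⟩ := exists_axial_flow hY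
  have hK : 𝓑.metric.IsKillingField Y := hY.1
  have hψ2 : ContMDiff (𝓘(ℝ, ℝ).prod (𝓡 4)) (𝓡 4) 2 ψ := hψ.of_le (WithTop.coe_le_coe.mpr le_top)
  refine ⟨ψ, hψ, hψ0, hψadd, hψY, hper,
    fun s ↦ (image_flow_chronological hK hTY hψ2 hψ0 hψadd hψY s).1,
    fun s ↦ (image_flow_chronological hK hTY hψ2 hψ0 hψadd hψY s).2,
    fun s ↦ image_flow_doc hK hTY hψ2 hψ0 hψadd hψY s,
    fun s ↦ image_flow_blackHoleRegion hK hTY hψ2 hψ0 hψadd hψY s,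
    fun s ↦ image_flow_horizon hK hTY hψ2 hψ0 hψadd hψY s,
    fun s p ↦ ⟨(flow_mem_iff hK hTY hψ2 hψ0 hψadd hψY s p).1,
      (flow_mem_iff hK hTY hψ2 hψ0 hψadd hψY s p).2.1⟩,
    fun q hq ↦ not_isTimelike_of_mem_horizon hK hTY hψ2 hψ0 hψadd hψY hq⟩

end StationaryAFBlackHole

/-- A set `C` invariant under the whole-line integral curves of a vector field `V` is invariant, as
an equality of sets, under every map `Φₜ` of a flow of `V` with the group law (`Φ₋ₜ` is the
inverse). [folklore] -/
theorem image_flow_eq_of_forall_isMIntegralCurve_mem {N : Type*} {E' : Type*}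
    [NormedAddCommGroup E'] [NormedSpace ℝ E'] {H' : Type*} [TopologicalSpace H']
    {I' : ModelWithCorners ℝ E' H'} [TopologicalSpace N] [ChartedSpace H' N]
    {V : Π x : N, TangentSpace I' x} {Φ : ℝ × N → N}
    (hΦ0 : ∀ p, Φ (0, p) = p) (hΦadd : ∀ t s p, Φ (t, Φ (s, p)) = Φ (t + s, p))
    (hΦV : ∀ p, IsMIntegralCurve (fun t ↦ Φ (t, p)) V) {C : Set N}
    (hC : ∀ γ : ℝ → N, IsMIntegralCurve γ V → γ 0 ∈ C → ∀ t, γ t ∈ C) (t : ℝ) :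
    (fun q ↦ Φ (t, q)) '' C = C := by
  ext c
  constructor
  · rintro ⟨c', hc', rfl⟩
    exact hC _ (hΦV c') (by simpa only [hΦ0] using hc') t
  · intro hc
    exact ⟨Φ (-t, c), hC _ (hΦV c) (by simpa only [hΦ0] using hc) (-t),
      flow_apply_flow_neg hΦ0 hΦadd t c⟩

namespace StationaryAFBlackHole

variable {𝓑 : StationaryAFBlackHole.{u}}

/-! ### Chruściel–Costa's §3 for the group `ℝ × U(1)`: Lemmas 3.4, 3.6, 3.7 and Corollary 3.8
for the Killing fields `a T + b Y` (the `s = 1` versions, `b = 0`, are in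
`StationaryBlackHoleUniquenessProofs.lean`) -/

section Combination

variable [𝓑.metric.HasLeviCivita] {Y : Π x : 𝓑.carrier, TangentSpace (𝓡 4) x}
  {ψ : ℝ × 𝓑.carrier → 𝓑.carrier}

omit [𝓑.metric.HasLeviCivita] in
/-- For a `2π`-periodic flow `ψ` and `b ∈ ℝ` there is `τ > 0` with `ψ_{τ b} = id` (`τ = 2π/|b|`,
or any `τ` if `b = 0`): for `s = 2`, i.e. `Y = b K₁` with `2π`-periodic `K₁`, the first case
"there exists `τ > 0` such that `φ_τ[Y]` is the identity" of the proof of Chruściel–Costa's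
Lemma 3.4 always applies. [cite: ChruscielCosta2008, Lemma 3.4 (proof, first case)] -/
theorem exists_pos_flow_mul_eq_self (hψ0 : ∀ p, ψ (0, p) = p)
    (hper : ∀ s p, ψ (s + 2 * Real.pi, p) = ψ (s, p)) (b : ℝ) :
    ∃ τ : ℝ, 0 < τ ∧ ∀ p, ψ (τ * b, p) = p := by
  rcases eq_or_ne b 0 with rfl | hb
  · exact ⟨1, one_pos, fun p ↦ by simp [hψ0]⟩
  · refine ⟨2 * Real.pi / |b|, div_pos Real.two_pi_pos (abs_pos.2 hb), fun p ↦ ?_⟩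
    rcases lt_or_gt_of_ne hb with hneg | hpos
    · have h : 2 * Real.pi / |b| * b = -(2 * Real.pi) := by
        rw [abs_of_neg hneg]; field_simp
      rw [h]
      have h' := hper (-(2 * Real.pi)) p
      rw [neg_add_cancel, hψ0] at h'
      exact h'.symm
    · have h : 2 * Real.pi / |b| * b = 2 * Real.pi := by
        rw [abs_of_pos hpos]; field_simp
      rw [h]
      have h' := hper 0 p
      rw [zero_add, hψ0] at h'
      exact h'

/-- **The flow of `a T + b Y`.** For a Killing field `Y` with `[T, Y] = 0` and a `C²` global flow
`ψ` of `Y` with the group law, and constants `a, b`, the maps `Φₜ := φ_{a t} ∘ ψ_{b t}` (`φ` the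
stationary flow) form a `C²` global flow with the group law whose curves are the integral curves of
`a T + b Y` — "since `K₀` and `Y` commute we have `φ_τ[K₀ + Y] = φ_τ[K₀] ∘ φ_τ[Y]`"
(Chruściel–Costa 2008, proof of Lemma 3.4; Lee 2012, Thm. 9.44; in the tree
`isMIntegralCurve_flow_flow_of_mlieBracket_eq_zero`, `flow_comm_of_mlieBracket_eq_zero`).
[cite: ChruscielCosta2008, Lemma 3.4 (proof)] [cite: LeeSmoothManifolds2013, Thm. 9.44] -/
theorem exists_combination_flow (hY : 𝓑.metric.IsKillingField Y)
    (hTY : ∀ x, VectorField.mlieBracket (𝓡 4) 𝓑.killing Y x = 0)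
    (hψ : ContMDiff (𝓘(ℝ, ℝ).prod (𝓡 4)) (𝓡 4) 2 ψ)
    (hψ0 : ∀ p, ψ (0, p) = p) (hψadd : ∀ s s' p, ψ (s, ψ (s', p)) = ψ (s + s', p))
    (hψY : ∀ p, IsMIntegralCurve (fun s ↦ ψ (s, p)) Y) (a b : ℝ) :
    ∃ (θ : ℝ × 𝓑.carrier → 𝓑.carrier) (Φ : ℝ × 𝓑.carrier → 𝓑.carrier),
      ContMDiff (𝓘(ℝ, ℝ).prod (𝓡 4)) (𝓡 4) 2 θ ∧ (∀ p, θ (0, p) = p) ∧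
      (∀ t s p, θ (t, θ (s, p)) = θ (t + s, p)) ∧
      (∀ p, IsMIntegralCurve (fun t ↦ θ (t, p)) 𝓑.killing) ∧
      (∀ t p, Φ (t, p) = θ (t * a, ψ (t * b, p))) ∧
      ContMDiff (𝓘(ℝ, ℝ).prod (𝓡 4)) (𝓡 4) 2 Φ ∧ (∀ p, Φ (0, p) = p) ∧
      (∀ t s p, Φ (t, Φ (s, p)) = Φ (t + s, p)) ∧
      (∀ p, IsMIntegralCurve (fun t ↦ Φ (t, p)) (a • 𝓑.killing + b • Y)) := by
  obtain ⟨θ, hθ, hθ0, hθadd, hθX, -⟩ := 𝓑.exists_stationary_flow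
  have hT : 𝓑.metric.IsKillingField 𝓑.killing := 𝓑.isStationaryKilling.isKillingField
  have hθ2 : ContMDiff (𝓘(ℝ, ℝ).prod (𝓡 4)) (𝓡 4) 2 θ := hθ.of_le (WithTop.coe_le_coe.mpr le_top)
  have hcomm : ∀ t s q, θ (t, ψ (s, q)) = ψ (s, θ (t, q)) := fun t s q ↦
    flow_comm_of_mlieBracket_eq_zero hT.contMDiff hY.contMDiff hTY hθ2 hθX hθ0 hθadd hψY hψ0 t s q
  refine ⟨θ, fun z ↦ θ (z.1 * a, ψ (z.1 * b, z.2)), hθ2, hθ0, hθadd, hθX, fun t p ↦ rfl,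
    ?_, fun p ↦ ?_, fun t s p ↦ ?_, fun p ↦ ?_⟩
  · -- smoothness of `(t, q) ↦ θ (t a, ψ (t b, q))`
    have h1 : ContMDiff (𝓘(ℝ, ℝ).prod (𝓡 4)) 𝓘(ℝ, ℝ) 2 fun z : ℝ × 𝓑.carrier ↦ z.1 * a :=
      ((contDiff_id.mul contDiff_const).contMDiff).comp contMDiff_fst
    have h2 : ContMDiff (𝓘(ℝ, ℝ).prod (𝓡 4)) 𝓘(ℝ, ℝ) 2 fun z : ℝ × 𝓑.carrier ↦ z.1 * b :=
      ((contDiff_id.mul contDiff_const).contMDiff).comp contMDiff_fst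
    have h3 : ContMDiff (𝓘(ℝ, ℝ).prod (𝓡 4)) (𝓡 4) 2 fun z : ℝ × 𝓑.carrier ↦ ψ (z.1 * b, z.2) :=
      hψ.comp (h2.prodMk contMDiff_snd)
    exact hθ2.comp (h1.prodMk h3)
  · show θ (0 * a, ψ (0 * b, p)) = p
    rw [zero_mul, zero_mul, hψ0, hθ0]
  · show θ (t * a, ψ (t * b, θ (s * a, ψ (s * b, p)))) = θ ((t + s) * a, ψ ((t + s) * b, p))
    rw [← hcomm, hθadd, hψadd, add_mul, add_mul]
  · exact isMIntegralCurve_flow_flow_of_mlieBracket_eq_zero hT.contMDiff hY.contMDiff hTY hθ2 hθX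
      hθ0 hθadd hψY a b p

/-- `a T + b Y` is a `C¹` section of `TM` (it is a Killing field,
`IsKillingField.linearCombination`). [folklore] -/
theorem combination_contMDiff_one (hY : 𝓑.metric.IsKillingField Y) (a b : ℝ) :
    ContMDiff (𝓡 4) (𝓡 4).tangent 1
      (fun x ↦ (⟨x, (a • 𝓑.killing + b • Y) x⟩ : TangentBundle (𝓡 4) 𝓑.carrier)) :=
  (𝓑.isStationaryKilling.isKillingField.linearCombination hY a b).contMDiff.of_le
    (WithTop.coe_le_coe.mpr le_top)

/-- **Lemma 3.4 (Chruściel–Costa 2008) for the group `ℝ × U(1)`: the orbits through `M_ext` of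
`K = a T + b Y`, `a > 0`, are future-oriented.** There is `τ > 0` (with `ψ_{τ b} = id`) such that
for every integral curve `γ` of `K` with `γ 0 ∈ M_ext` and every `t`, `γ (t + τ) ∈ I⁺(γ t)`:
`γ τ = φ_{τ a}(ψ_{τ b}(γ 0)) = φ_{τ a}(γ 0)` lies on the future timelike stationary orbit of
`γ 0 ∈ M_ext`, and the `≪`-preserving flow map `Φₜ` of `K` carries `γ 0 ≪ γ τ` to
`γ t ≪ γ (t + τ)`. Printed: "Suppose, first, that there exists `τ > 0` such that `φ_τ[Y]` is the
identity. Since `K₀` and `Y` commute we have `φ_τ[X] = φ_τ[K₀ + Y] = φ_τ[K₀] ∘ φ_τ[Y] = φ_τ[K₀]`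
… Setting `τ₀ = 0` and `τ₁ = τ`, the result follows." (The `s = 1` case `b = 0` is
`apply_mem_chronologicalFuture_of_isMIntegralCurve_of_mem_Mext` of
`StationaryBlackHoleUniquenessProofs.lean`.) [cite: ChruscielCosta2008, Lemma 3.4] -/
theorem apply_mem_chronologicalFuture_of_isMIntegralCurve_combination
    (hY : 𝓑.metric.IsKillingField Y)
    (hTY : ∀ x, VectorField.mlieBracket (𝓡 4) 𝓑.killing Y x = 0)
    (hψ : ContMDiff (𝓘(ℝ, ℝ).prod (𝓡 4)) (𝓡 4) 2 ψ)
    (hψ0 : ∀ p, ψ (0, p) = p) (hψadd : ∀ s s' p, ψ (s, ψ (s', p)) = ψ (s + s', p))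
    (hψY : ∀ p, IsMIntegralCurve (fun s ↦ ψ (s, p)) Y)
    (hper : ∀ s p, ψ (s + 2 * Real.pi, p) = ψ (s, p)) {a : ℝ} (ha : 0 < a) (b : ℝ) :
    ∃ τ : ℝ, 0 < τ ∧ ∀ {γ : ℝ → 𝓑.carrier}, IsMIntegralCurve γ (a • 𝓑.killing + b • Y) →
      γ 0 ∈ 𝓑.Mext → ∀ t, γ (t + τ) ∈ 𝓑.metric.chronologicalFuture 𝓑.timeOrientation {γ t} := by
  obtain ⟨τ, hτ, hτψ⟩ := exists_pos_flow_mul_eq_self hψ0 hper b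
  obtain ⟨θ, Φ, hθ2, hθ0, hθadd, hθX, hΦdef, hΦ2, hΦ0, hΦadd, hΦK⟩ :=
    exists_combination_flow hY hTY hψ hψ0 hψadd hψY a b
  refine ⟨τ, hτ, fun {γ} hγ hγ0 t ↦ ?_⟩
  have hK' : 𝓑.metric.IsKillingField (a • 𝓑.killing + b • Y) :=
    𝓑.isStationaryKilling.isKillingField.linearCombination hY a b
  have hK1 := combination_contMDiff_one (𝓑 := 𝓑) hY a b
  -- at the point of `M_ext`: `γ τ = Φ_τ (γ 0) = θ_{τ a} (γ 0) ∈ I⁺(γ 0)`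
  have h0 : γ τ ∈ 𝓑.metric.chronologicalFuture 𝓑.timeOrientation {γ 0} := by
    have hstep : γ τ = θ (τ * a, γ 0) := by
      rw [eq_flow_of_isMIntegralCurve hK1 hΦK hΦ0 hγ τ, hΦdef, hτψ]
    rw [hstep]
    have h := apply_mem_chronologicalFuture_of_mem_Mext (hθX (γ 0))
      (by simpa only [hθ0] using hγ0) (mul_pos hτ ha)
    simpa only [hθ0] using h
  -- translate by the `≪`-preserving flow map `Φ_t`
  have h := hK'.image_flow_chronologicalFuture_subset (τ := 𝓑.timeOrientation) hΦ2 hΦ0 hΦadd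
    hΦK t {γ 0} ⟨γ τ, h0, rfl⟩
  rw [Set.image_singleton] at h
  simp only at h
  have e1 : Φ (t, γ τ) = γ (t + τ) := by
    rw [eq_flow_of_isMIntegralCurve hK1 hΦK hΦ0 hγ (t + τ), ← hΦadd t τ,
      ← eq_flow_of_isMIntegralCurve hK1 hΦK hΦ0 hγ τ]
  have e2 : Φ (t, γ 0) = γ t := (eq_flow_of_isMIntegralCurve hK1 hΦK hΦ0 hγ t).symm
  rw [e1, e2] at h
  exact h

omit [𝓑.metric.HasLeviCivita] in
/-- Iterating a flow map which is the identity: if `ψ_c = id` then `ψ_{n c} = id` for every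
`n : ℕ` (group law). [folklore] -/
theorem flow_nat_mul_eq_self (hψadd : ∀ s s' p, ψ (s, ψ (s', p)) = ψ (s + s', p)) {c : ℝ}
    (hψ0 : ∀ p, ψ (0, p) = p) (hc : ∀ p, ψ (c, p) = p) (n : ℕ) (p : 𝓑.carrier) :
    ψ (n * c, p) = p := by
  induction n with
  | zero => simpa using hψ0 p
  | succ k ih =>
    have h : ((k + 1 : ℕ) : ℝ) * c = k * c + c := by push_cast; ring
    rw [h, ← hψadd, hc, ih]

/-- **Lemma 3.5 (Chruściel–Costa 2008) for the group `ℝ × U(1)`: the orbits through `⟨⟨M_ext⟩⟩` of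
`K = a T + b Y`, `a > 0`, are future-oriented** — for `p ∈ ⟨⟨M_ext⟩⟩` and the integral curve `γ`
of `K` through `p` there is `τ > 0` with `γ τ ∈ I⁺(p)`. Printed proof: "Let `p ∈ ⟨⟨M_ext⟩⟩`, thus
there exist points `p± ∈ M_ext` such that `p± ∈ I^±(p)` … It follows from Lemma 3.4 together with
asymptotic flatness that there exists `τ` such that `φ_τ[K](p₋) ∈ I⁺(p₊)` … Then the curve
`γ₊ · γ · φ_τ[K](γ₋)` is a timelike curve from `p` to `φ_τ(p)`." Here `τ = n τ₀` with
`ψ_{τ₀ b} = id` (`exists_pos_flow_mul_eq_self`), so that `φ_τ[K](p₋) = φ_{τ a}(p₋)` lies on the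
stationary orbit of `p₋`, which eventually enters `I⁺(p₊)`
(`exists_orbit_mem_chronologicalFuture`, the tree's rendering of "Lemma 3.4 together with
asymptotic flatness"); and `φ_τ[K]` preserves `≪`. (The `s = 1` version is
`exists_pos_apply_mem_chronologicalFuture_of_mem_doc`.) [cite: ChruscielCosta2008, Lemma 3.5] -/
theorem exists_pos_apply_mem_chronologicalFuture_of_mem_doc_combination
    (hY : 𝓑.metric.IsKillingField Y)
    (hTY : ∀ x, VectorField.mlieBracket (𝓡 4) 𝓑.killing Y x = 0)
    (hψ : ContMDiff (𝓘(ℝ, ℝ).prod (𝓡 4)) (𝓡 4) 2 ψ)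
    (hψ0 : ∀ p, ψ (0, p) = p) (hψadd : ∀ s s' p, ψ (s, ψ (s', p)) = ψ (s + s', p))
    (hψY : ∀ p, IsMIntegralCurve (fun s ↦ ψ (s, p)) Y)
    (hper : ∀ s p, ψ (s + 2 * Real.pi, p) = ψ (s, p)) {a : ℝ} (ha : 0 < a) (b : ℝ)
    {p : 𝓑.carrier} (hp : p ∈ 𝓑.doc) {γ : ℝ → 𝓑.carrier}
    (hγ : IsMIntegralCurve γ (a • 𝓑.killing + b • Y)) (hγ0 : γ 0 = p) :
    ∃ τ : ℝ, 0 < τ ∧ γ τ ∈ 𝓑.metric.chronologicalFuture 𝓑.timeOrientation {p} := by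
  obtain ⟨τ₀, hτ₀, hτ₀ψ⟩ := exists_pos_flow_mul_eq_self hψ0 hper b
  obtain ⟨θ, Φ, hθ2, hθ0, hθadd, hθX, hΦdef, hΦ2, hΦ0, hΦadd, hΦK⟩ :=
    exists_combination_flow hY hTY hψ hψ0 hψadd hψY a b
  have hK' : 𝓑.metric.IsKillingField (a • 𝓑.killing + b • Y) :=
    𝓑.isStationaryKilling.isKillingField.linearCombination hY a b
  have hK1 := combination_contMDiff_one (𝓑 := 𝓑) hY a b
  -- `p₋ ≪ p ≪ p₊`, `p± ∈ M_ext`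
  obtain ⟨pm, hpm, hrestm⟩ := hp.1
  have hppm : p ∈ 𝓑.metric.chronologicalFuture 𝓑.timeOrientation {pm} := ⟨pm, rfl, hrestm⟩
  obtain ⟨pp, hpp0, hrestp⟩ := hp.2
  have hppp : pp ∈ 𝓑.metric.chronologicalFuture 𝓑.timeOrientation {p} :=
    LorentzianMetric.mem_chronologicalFuture_of_mem_chronologicalPast ⟨pp, rfl, hrestp⟩
  -- the stationary orbit of `p₋` eventually enters `I⁺(p₊)`
  obtain ⟨T₀, hT₀⟩ := exists_orbit_mem_chronologicalFuture hpp0 hpm (hθX pm) (hθ0 pm)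
  obtain ⟨n, hn⟩ := exists_nat_ge (max (T₀ / (τ₀ * a)) 1)
  have hn1 : (1 : ℝ) ≤ n := (le_max_right _ _).trans hn
  have hnT : T₀ ≤ (n * τ₀) * a := by
    have h := (le_max_left _ _).trans hn
    rw [div_le_iff₀ (mul_pos hτ₀ ha)] at h
    linarith
  set τ : ℝ := n * τ₀ with hτ
  have hτpos : 0 < τ := mul_pos (by linarith) hτ₀
  refine ⟨τ, hτpos, ?_⟩
  -- `φ_τ[K](p₋) = φ_{τ a}(p₋) ∈ I⁺(p₊)`
  have hψτ : ∀ q, ψ (τ * b, q) = q := fun q ↦ by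
    have h := flow_nat_mul_eq_self (𝓑 := 𝓑) hψadd hψ0 hτ₀ψ n q
    rw [hτ, mul_assoc]
    exact h
  have h1 : Φ (τ, pm) ∈ 𝓑.metric.chronologicalFuture 𝓑.timeOrientation {pp} := by
    rw [hΦdef, hψτ]
    exact hT₀ _ hnT
  -- `φ_τ[K]` preserves `≪`: `φ_τ[K](p₋) ≪ φ_τ[K](p) = γ τ`
  have h2 : Φ (τ, p) ∈ 𝓑.metric.chronologicalFuture 𝓑.timeOrientation {Φ (τ, pm)} := by
    have h := hK'.image_flow_chronologicalFuture_subset (τ := 𝓑.timeOrientation) hΦ2 hΦ0 hΦadd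
      hΦK τ {pm} ⟨p, hppm, rfl⟩
    simpa only [Set.image_singleton] using h
  rw [eq_flow_of_isMIntegralCurve hK1 hΦK hΦ0 hγ τ, hγ0]
  exact LorentzianMetric.mem_chronologicalFuture_trans
    (LorentzianMetric.mem_chronologicalFuture_trans hppp h1) h2

/-- **Lemma 3.6 (Chruściel–Costa 2008, "essentially due to [Chruściel–Wald]") for the group
`ℝ × U(1)`, past form**: if `C` is invariant under the flow of `K = a T + b Y` (`a > 0`; every
integral curve of `K` starting in `C` stays in `C`) and `C` meets `I⁺(M_ext)`, then
`M_ext ⊆ I⁻(C)`. Printed proof: "The null achronal boundaries `İ^∓(C) ∩ M_ext` are invariant under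
the flow of `X`. This is compatible with Lemma 3.4 if and only if `İ^∓(C) ∩ M_ext = ∅`. If `C`
intersects `I⁺(M_ext)` then `I⁻(C) ∩ M_ext` is non-empty, hence `I⁻(C) ⊇ M_ext` since `M_ext` is
connected" — here: `Φₜ(I⁻(C)) = I⁻(Φₜ C) = I⁻(C)` for the flow `Φ` of the Killing field `K`
(`exists_combination_flow`), so `∂I⁻(C)` is `Φ`-invariant and achronal (Hawking–Ellis Prop. 6.3.1);
a point of `∂I⁻(C) ∩ M_ext` and its translate `Φ_τ` (Lemma 3.4,
`apply_mem_chronologicalFuture_of_isMIntegralCurve_combination`) would be chronologically related;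
and `M_ext` is connected (`isConnected_Mext`). [cite: ChruscielCosta2008, Lemma 3.6] -/
theorem Mext_subset_chronologicalPast_of_combination_invariant (hY : 𝓑.metric.IsKillingField Y)
    (hTY : ∀ x, VectorField.mlieBracket (𝓡 4) 𝓑.killing Y x = 0)
    (hψ : ContMDiff (𝓘(ℝ, ℝ).prod (𝓡 4)) (𝓡 4) 2 ψ)
    (hψ0 : ∀ p, ψ (0, p) = p) (hψadd : ∀ s s' p, ψ (s, ψ (s', p)) = ψ (s + s', p))
    (hψY : ∀ p, IsMIntegralCurve (fun s ↦ ψ (s, p)) Y)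
    (hper : ∀ s p, ψ (s + 2 * Real.pi, p) = ψ (s, p)) {a : ℝ} (ha : 0 < a) (b : ℝ)
    {C : Set 𝓑.carrier}
    (hC : ∀ γ : ℝ → 𝓑.carrier, IsMIntegralCurve γ (a • 𝓑.killing + b • Y) → γ 0 ∈ C →
      ∀ t, γ t ∈ C)
    (hne : (C ∩ 𝓑.metric.chronologicalFuture 𝓑.timeOrientation 𝓑.Mext).Nonempty) :
    𝓑.Mext ⊆ 𝓑.metric.chronologicalPast 𝓑.timeOrientation C := by
  obtain ⟨τ, -, hfo⟩ := apply_mem_chronologicalFuture_of_isMIntegralCurve_combination hY hTY hψ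
    hψ0 hψadd hψY hper ha b
  obtain ⟨θ, Φ, -, -, -, -, -, hΦ2, hΦ0, hΦadd, hΦK⟩ :=
    exists_combination_flow hY hTY hψ hψ0 hψadd hψY a b
  have hK' : 𝓑.metric.IsKillingField (a • 𝓑.killing + b • Y) :=
    𝓑.isStationaryKilling.isKillingField.linearCombination hY a b
  set W : Set 𝓑.carrier := 𝓑.metric.chronologicalPast 𝓑.timeOrientation C with hW
  have hWopen : IsOpen W :=
    LorentzianMetric.isOpen_chronologicalPast_of_boundaryless 𝓑.metric 𝓑.timeOrientation C
  have hWimg : ∀ t, (fun q ↦ Φ (t, q)) '' W = W := fun t ↦ by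
    rw [hW, hK'.image_flow_chronologicalPast hΦ2 hΦ0 hΦadd hΦK t C,
      image_flow_eq_of_forall_isMIntegralCurve_mem hΦ0 hΦadd hΦK hC t]
  have hfr : ∀ t, (fun q ↦ Φ (t, q)) '' frontier W = frontier W := fun t ↦ by
    rw [(isHomeomorph_flow hΦ2.continuous hΦ0 hΦadd t).image_frontier, hWimg t]
  -- `M_ext ∩ ∂W = ∅`: `∂W` is achronal and `Φ`-invariant, the `K`-orbits through `M_ext` are
  -- future-oriented
  have hdisj : ∀ x ∈ 𝓑.Mext, x ∉ frontier W := by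
    intro x hx hfx
    have h1 : Φ (τ, x) ∈ frontier W := by
      rw [← hfr τ]
      exact Set.mem_image_of_mem _ hfx
    have h2 : Φ (τ, x) ∈ 𝓑.metric.chronologicalFuture 𝓑.timeOrientation {x} := by
      have h := hfo (hΦK x) (by simpa only [hΦ0] using hx) 0
      simpa only [zero_add, hΦ0] using h
    exact (LorentzianMetric.isPastSet_chronologicalPast C).isAchronal_frontier x hfx _ h1 h2
  have hsub : 𝓑.Mext ⊆ W ∪ (closure W)ᶜ := by
    intro x hx
    by_cases hxW : x ∈ closure W
    · left
      by_contra h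
      exact hdisj x hx ⟨hxW, by rwa [hWopen.interior_eq]⟩
    · exact Or.inr hxW
  have hdis : Disjoint W (closure W)ᶜ := disjoint_compl_right.mono_left subset_closure
  rcases 𝓑.isConnected_Mext.isPreconnected.subset_or_subset hWopen
    isClosed_closure.isOpen_compl hdis hsub with h | h
  · exact h
  · exfalso
    obtain ⟨c, hcC, m, hm, hrest⟩ := hne
    have hmW : m ∈ W := LorentzianMetric.chronologicalPast_mono (Set.singleton_subset_iff.2 hcC)
      (LorentzianMetric.mem_chronologicalPast_of_mem_chronologicalFuture
        (⟨m, rfl, hrest⟩ : c ∈ 𝓑.metric.chronologicalFuture 𝓑.timeOrientation {m}))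
    exact h hm (subset_closure hmW)

/-- **Lemma 3.6 for the group `ℝ × U(1)`, future form**: if `C` is invariant under the flow of
`a T + b Y` (`a > 0`) and meets `I⁻(M_ext)`, then `M_ext ⊆ I⁺(C)` ("a similar argument applies if
`C` intersects `I⁻(M_ext)`"). [cite: ChruscielCosta2008, Lemma 3.6] -/
theorem Mext_subset_chronologicalFuture_of_combination_invariant (hY : 𝓑.metric.IsKillingField Y)
    (hTY : ∀ x, VectorField.mlieBracket (𝓡 4) 𝓑.killing Y x = 0)
    (hψ : ContMDiff (𝓘(ℝ, ℝ).prod (𝓡 4)) (𝓡 4) 2 ψ)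
    (hψ0 : ∀ p, ψ (0, p) = p) (hψadd : ∀ s s' p, ψ (s, ψ (s', p)) = ψ (s + s', p))
    (hψY : ∀ p, IsMIntegralCurve (fun s ↦ ψ (s, p)) Y)
    (hper : ∀ s p, ψ (s + 2 * Real.pi, p) = ψ (s, p)) {a : ℝ} (ha : 0 < a) (b : ℝ)
    {C : Set 𝓑.carrier}
    (hC : ∀ γ : ℝ → 𝓑.carrier, IsMIntegralCurve γ (a • 𝓑.killing + b • Y) → γ 0 ∈ C →
      ∀ t, γ t ∈ C)
    (hne : (C ∩ 𝓑.metric.chronologicalPast 𝓑.timeOrientation 𝓑.Mext).Nonempty) :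
    𝓑.Mext ⊆ 𝓑.metric.chronologicalFuture 𝓑.timeOrientation C := by
  obtain ⟨τ, -, hfo⟩ := apply_mem_chronologicalFuture_of_isMIntegralCurve_combination hY hTY hψ
    hψ0 hψadd hψY hper ha b
  obtain ⟨θ, Φ, -, -, -, -, -, hΦ2, hΦ0, hΦadd, hΦK⟩ :=
    exists_combination_flow hY hTY hψ hψ0 hψadd hψY a b
  have hK' : 𝓑.metric.IsKillingField (a • 𝓑.killing + b • Y) :=
    𝓑.isStationaryKilling.isKillingField.linearCombination hY a b
  set W : Set 𝓑.carrier := 𝓑.metric.chronologicalFuture 𝓑.timeOrientation C with hW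
  have hWopen : IsOpen W :=
    LorentzianMetric.isOpen_chronologicalFuture_of_boundaryless 𝓑.metric 𝓑.timeOrientation C
  have hWfut : 𝓑.metric.IsFutureSet 𝓑.timeOrientation W :=
    fun _ ⟨q, hq, h⟩ ↦ LorentzianMetric.mem_chronologicalFuture_trans hq ⟨q, rfl, h⟩
  have hWimg : ∀ t, (fun q ↦ Φ (t, q)) '' W = W := fun t ↦ by
    rw [hW, hK'.image_flow_chronologicalFuture hΦ2 hΦ0 hΦadd hΦK t C,
      image_flow_eq_of_forall_isMIntegralCurve_mem hΦ0 hΦadd hΦK hC t]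
  have hfr : ∀ t, (fun q ↦ Φ (t, q)) '' frontier W = frontier W := fun t ↦ by
    rw [(isHomeomorph_flow hΦ2.continuous hΦ0 hΦadd t).image_frontier, hWimg t]
  have hdisj : ∀ x ∈ 𝓑.Mext, x ∉ frontier W := by
    intro x hx hfx
    have h1 : Φ (τ, x) ∈ frontier W := by
      rw [← hfr τ]
      exact Set.mem_image_of_mem _ hfx
    have h2 : Φ (τ, x) ∈ 𝓑.metric.chronologicalFuture 𝓑.timeOrientation {x} := by
      have h := hfo (hΦK x) (by simpa only [hΦ0] using hx) 0
      simpa only [zero_add, hΦ0] using h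
    exact hWfut.isAchronal_frontier x hfx _ h1 h2
  have hsub : 𝓑.Mext ⊆ W ∪ (closure W)ᶜ := by
    intro x hx
    by_cases hxW : x ∈ closure W
    · left
      by_contra h
      exact hdisj x hx ⟨hxW, by rwa [hWopen.interior_eq]⟩
    · exact Or.inr hxW
  have hdis : Disjoint W (closure W)ᶜ := disjoint_compl_right.mono_left subset_closure
  rcases 𝓑.isConnected_Mext.isPreconnected.subset_or_subset hWopen
    isClosed_closure.isOpen_compl hdis hsub with h | h
  · exact h
  · exfalso
    obtain ⟨c, hcC, m, hm, hrest⟩ := hne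
    have hmW : m ∈ W := LorentzianMetric.chronologicalFuture_mono (Set.singleton_subset_iff.2 hcC)
      (LorentzianMetric.mem_chronologicalFuture_of_mem_chronologicalPast
        (⟨m, rfl, hrest⟩ : c ∈ 𝓑.metric.chronologicalPast 𝓑.timeOrientation {m}))
    exact h hm (subset_closure hmW)

/-- **Lemma 3.7 (Chruściel–Costa 2008) for the group `ℝ × U(1)`**: if no point of `⟨⟨M_ext⟩⟩` lies
on a closed timelike curve, then no non-empty set `N` invariant under the flow of `a T + b Y`
(`a > 0`) is contained in a compact subset `C` of `⟨⟨M_ext⟩⟩`. Printed proof (as for the `s = 1`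
tree version `not_nonempty_invariant_subset_compact`): by Lemma 3.6, `M_ext ⊆ I⁺(N)`, hence
`⟨⟨M_ext⟩⟩ ⊆ I⁺(N)`; a finite subcover `I⁺(p₁), …, I⁺(p_I)` of `C`; "each `pᵢ` must be in the
future of at least one `pⱼ`, and since there is a finite number of them one eventually gets a
closed timelike curve". [cite: ChruscielCosta2008, Lemma 3.7] -/
theorem not_nonempty_combination_invariant_subset_compact (hY : 𝓑.metric.IsKillingField Y)
    (hTY : ∀ x, VectorField.mlieBracket (𝓡 4) 𝓑.killing Y x = 0)
    (hψ : ContMDiff (𝓘(ℝ, ℝ).prod (𝓡 4)) (𝓡 4) 2 ψ)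
    (hψ0 : ∀ p, ψ (0, p) = p) (hψadd : ∀ s s' p, ψ (s, ψ (s', p)) = ψ (s + s', p))
    (hψY : ∀ p, IsMIntegralCurve (fun s ↦ ψ (s, p)) Y)
    (hper : ∀ s p, ψ (s + 2 * Real.pi, p) = ψ (s, p)) {a : ℝ} (ha : 0 < a) (b : ℝ)
    (hchr : ∀ p ∈ 𝓑.doc, p ∉ 𝓑.metric.chronologicalFuture 𝓑.timeOrientation {p})
    {N C : Set 𝓑.carrier} (hNC : N ⊆ C) (hCdoc : C ⊆ 𝓑.doc) (hCc : IsCompact C)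
    (hN : ∀ γ : ℝ → 𝓑.carrier, IsMIntegralCurve γ (a • 𝓑.killing + b • Y) → γ 0 ∈ N →
      ∀ t, γ t ∈ N)
    (hne : N.Nonempty) : False := by
  obtain ⟨n₀, hn₀⟩ := hne
  have h2 : 𝓑.Mext ⊆ 𝓑.metric.chronologicalFuture 𝓑.timeOrientation N :=
    Mext_subset_chronologicalFuture_of_combination_invariant hY hTY hψ hψ0 hψadd hψY hper ha b hN
      ⟨n₀, hn₀, (hCdoc (hNC hn₀)).2⟩
  have hdocN : 𝓑.doc ⊆ 𝓑.metric.chronologicalFuture 𝓑.timeOrientation N := fun x hx ↦ by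
    obtain ⟨m, hm, hrest⟩ := hx.1
    exact LorentzianMetric.mem_chronologicalFuture_trans (h2 hm) ⟨m, rfl, hrest⟩
  have hcov : C ⊆ ⋃ n ∈ N, 𝓑.metric.chronologicalFuture 𝓑.timeOrientation {n} := by
    rw [← LorentzianMetric.chronologicalFuture_eq_biUnion]
    exact hCdoc.trans hdocN
  obtain ⟨F, hFN, hFfin, hCF⟩ := hCc.elim_finite_subcover_image
    (fun n _ ↦ LorentzianMetric.isOpen_chronologicalFuture_of_boundaryless 𝓑.metric
      𝓑.timeOrientation {n}) hcov
  have hσ : ∀ c ∈ C, ∃ n ∈ F, c ∈ 𝓑.metric.chronologicalFuture 𝓑.timeOrientation {n} :=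
    fun c hc ↦ by simpa only [Set.mem_iUnion, exists_prop] using hCF hc
  haveI : Nonempty 𝓑.carrier := ⟨n₀⟩
  choose! σ hσF hσI using hσ
  have hFC : F ⊆ C := hFN.trans hNC
  have hqC : ∀ k : ℕ, σ^[k] n₀ ∈ C := by
    intro k
    induction k with
    | zero => exact hNC hn₀
    | succ k ih =>
      rw [Function.iterate_succ_apply']
      exact hFC (hσF _ ih)
  have hqF : ∀ k : ℕ, σ^[k + 1] n₀ ∈ F := fun k ↦ by
    rw [Function.iterate_succ_apply']
    exact hσF _ (hqC k)
  have hqI : ∀ k : ℕ,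
      σ^[k] n₀ ∈ 𝓑.metric.chronologicalFuture 𝓑.timeOrientation {σ^[k + 1] n₀} := fun k ↦ by
    rw [Function.iterate_succ_apply']
    exact hσI _ (hqC k)
  have hchain : ∀ i j : ℕ, i < j →
      σ^[i] n₀ ∈ 𝓑.metric.chronologicalFuture 𝓑.timeOrientation {σ^[j] n₀} := by
    intro i j hij
    induction hij with
    | refl => exact hqI i
    | step hle ih => exact LorentzianMetric.mem_chronologicalFuture_trans (hqI _) ih
  haveI : Finite F := hFfin.to_subtype
  obtain ⟨i, j, hne', heq⟩ :=
    Finite.exists_ne_map_eq_of_infinite (fun k : ℕ ↦ (⟨σ^[k + 1] n₀, hqF k⟩ : F))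
  have heq' : σ^[i + 1] n₀ = σ^[j + 1] n₀ := congrArg Subtype.val heq
  rcases lt_or_gt_of_ne hne' with h | h
  · have hc := hchain (i + 1) (j + 1) (by omega)
    rw [heq'] at hc
    exact hchr _ (hCdoc (hqC (j + 1))) hc
  · have hc := hchain (j + 1) (i + 1) (by omega)
    rw [← heq'] at hc
    exact hchr _ (hCdoc (hqC (i + 1))) hc

/-- **Corollary 3.8 (Chruściel–Costa 2008): "Killing vectors of the form `K₀ + Σᵢ αᵢ Kᵢ` have no
zeros in `⟨⟨M_ext⟩⟩`"** — here `a T + b Y`, `a > 0`, on a domain of outer communications without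
closed timelike curves through its points: a zero would be a compact invariant set (Lemma 3.7).
For `K = K₀ + Ω K₁` this is the opening step of the analysis of the Killing horizon and of the
ergoset (§4.4, §5) and of the rotating case (§7.1). [cite: ChruscielCosta2008, Cor. 3.8] -/
theorem combination_apply_ne_zero_of_mem_doc (hY : 𝓑.metric.IsKillingField Y)
    (hTY : ∀ x, VectorField.mlieBracket (𝓡 4) 𝓑.killing Y x = 0)
    (hψ : ContMDiff (𝓘(ℝ, ℝ).prod (𝓡 4)) (𝓡 4) 2 ψ)
    (hψ0 : ∀ p, ψ (0, p) = p) (hψadd : ∀ s s' p, ψ (s, ψ (s', p)) = ψ (s + s', p))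
    (hψY : ∀ p, IsMIntegralCurve (fun s ↦ ψ (s, p)) Y)
    (hper : ∀ s p, ψ (s + 2 * Real.pi, p) = ψ (s, p)) {a : ℝ} (ha : 0 < a) (b : ℝ)
    (hchr : ∀ p ∈ 𝓑.doc, p ∉ 𝓑.metric.chronologicalFuture 𝓑.timeOrientation {p})
    {x : 𝓑.carrier} (hx : x ∈ 𝓑.doc) : (a • 𝓑.killing + b • Y) x ≠ 0 := by
  intro h0
  refine not_nonempty_combination_invariant_subset_compact hY hTY hψ hψ0 hψadd hψY hper ha b hchr
    (subset_refl {x}) (Set.singleton_subset_iff.2 hx) isCompact_singleton ?_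
    (Set.singleton_nonempty x)
  intro γ hγ hγ0 t
  rw [Set.mem_singleton_iff] at hγ0 ⊢
  have h := isMIntegralCurve_Ioo_eq_of_contMDiff_boundaryless (t₀ := 0)
    (combination_contMDiff_one (𝓑 := 𝓑) hY a b) hγ (isMIntegralCurve_const h0) (by simpa using hγ0)
  exact congrFun h t

/-- **Corollary 3.8, `I⁺`-regular form**: in an `I⁺`-regular stationary AF black hole (strong
causality on `⟨⟨M_ext⟩⟩`) the Killing fields `a T + b Y`, `a > 0`, have no zeros in `⟨⟨M_ext⟩⟩`.
[cite: ChruscielCosta2008, Cor. 3.8 with Def. 1.1] -/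
theorem IsIPlusRegular.combination_apply_ne_zero_of_mem_doc (hreg : 𝓑.IsIPlusRegular)
    (hY : 𝓑.metric.IsKillingField Y)
    (hTY : ∀ x, VectorField.mlieBracket (𝓡 4) 𝓑.killing Y x = 0)
    (hψ : ContMDiff (𝓘(ℝ, ℝ).prod (𝓡 4)) (𝓡 4) 2 ψ)
    (hψ0 : ∀ p, ψ (0, p) = p) (hψadd : ∀ s s' p, ψ (s, ψ (s', p)) = ψ (s + s', p))
    (hψY : ∀ p, IsMIntegralCurve (fun s ↦ ψ (s, p)) Y)
    (hper : ∀ s p, ψ (s + 2 * Real.pi, p) = ψ (s, p)) {a : ℝ} (ha : 0 < a) (b : ℝ)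
    {x : 𝓑.carrier} (hx : x ∈ 𝓑.doc) : (a • 𝓑.killing + b • Y) x ≠ 0 :=
  StationaryAFBlackHole.combination_apply_ne_zero_of_mem_doc hY hTY hψ hψ0 hψadd hψY hper ha b
    (fun _ hp ↦ hreg.not_mem_chronologicalFuture_self hp) hx

end Combination

/-- **The candidate horizon Killing fields `T + Ω Y` of an `I⁺`-regular stationary-axisymmetric
black hole have no zeros in `⟨⟨M_ext⟩⟩`**, for every angular velocity `Ω` (Chruściel–Costa 2008,
Cor. 3.8 for `K₀ + Ω K₁`; the symmetry hypothesis is `IsStationaryAxisymmetric` of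
`ChruscielCostaHeusler2012_axisymmetricUniqueness`, the flow of `Y` being produced by
`exists_axial_flow`). [cite: ChruscielCosta2008, Cor. 3.8 and §4.4] [cite: ChruscielCostaHeusler2012, §3.2.1 (p. 10)] -/
theorem IsIPlusRegular.killing_add_smul_ne_zero_of_mem_doc [𝓑.metric.HasLeviCivita]
    (hreg : 𝓑.IsIPlusRegular) {Y : Π x : 𝓑.carrier, TangentSpace (𝓡 4) x}
    (hY : 𝓑.toSpacetime.IsAxisymmetricKilling Y)
    (hTY : ∀ x, VectorField.mlieBracket (𝓡 4) 𝓑.killing Y x = 0) (Ω : ℝ) {x : 𝓑.carrier}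
    (hx : x ∈ 𝓑.doc) : 𝓑.killing x + Ω • Y x ≠ 0 := by
  obtain ⟨ψ, hψ, hψ0, hψadd, hψY, hper, -⟩ := exists_axial_flow hY
  have hψ2 : ContMDiff (𝓘(ℝ, ℝ).prod (𝓡 4)) (𝓡 4) 2 ψ := hψ.of_le (WithTop.coe_le_coe.mpr le_top)
  have h := StationaryAFBlackHole.IsIPlusRegular.combination_apply_ne_zero_of_mem_doc hreg hY.1
    hTY hψ2 hψ0 hψadd hψY hper one_pos Ω hx
  simpa using h

/-- **Lemma 3.7, `I⁺`-regular stationary-axisymmetric form**: no non-empty set invariant under the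
flow of `a T + b Y` (`a > 0`, `Y` axisymmetric Killing commuting with `T`) lies in a compact subset
of `⟨⟨M_ext⟩⟩`. [cite: ChruscielCosta2008, Lemma 3.7] -/
theorem IsIPlusRegular.not_nonempty_invariant_subset_compact_of_isAxisymmetricKilling
    [𝓑.metric.HasLeviCivita] (hreg : 𝓑.IsIPlusRegular)
    {Y : Π x : 𝓑.carrier, TangentSpace (𝓡 4) x} (hY : 𝓑.toSpacetime.IsAxisymmetricKilling Y)
    (hTY : ∀ x, VectorField.mlieBracket (𝓡 4) 𝓑.killing Y x = 0) {a : ℝ} (ha : 0 < a) (b : ℝ)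
    {N C : Set 𝓑.carrier} (hNC : N ⊆ C) (hCdoc : C ⊆ 𝓑.doc) (hCc : IsCompact C)
    (hN : ∀ γ : ℝ → 𝓑.carrier, IsMIntegralCurve γ (a • 𝓑.killing + b • Y) → γ 0 ∈ N →
      ∀ t, γ t ∈ N)
    (hne : N.Nonempty) : False := by
  obtain ⟨ψ, hψ, hψ0, hψadd, hψY, hper, -⟩ := exists_axial_flow hY
  have hψ2 : ContMDiff (𝓘(ℝ, ℝ).prod (𝓡 4)) (𝓡 4) 2 ψ := hψ.of_le (WithTop.coe_le_coe.mpr le_top)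
  exact StationaryAFBlackHole.not_nonempty_combination_invariant_subset_compact hY.1 hTY hψ2 hψ0
    hψadd hψY hper ha b (fun _ hp ↦ hreg.not_mem_chronologicalFuture_self hp) hNC hCdoc hCc hN hne

/-- **Lemma 3.6, stationary-axisymmetric form** (both time directions): for `Y` axisymmetric
Killing commuting with `T` and `C` invariant under the flow of `a T + b Y`, `a > 0`:
`C ∩ I⁺(M_ext) ≠ ∅ → M_ext ⊆ I⁻(C)` and `C ∩ I⁻(M_ext) ≠ ∅ → M_ext ⊆ I⁺(C)`.
[cite: ChruscielCosta2008, Lemma 3.6] -/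
theorem Mext_subset_of_combination_invariant_of_isAxisymmetricKilling [𝓑.metric.HasLeviCivita]
    {Y : Π x : 𝓑.carrier, TangentSpace (𝓡 4) x} (hY : 𝓑.toSpacetime.IsAxisymmetricKilling Y)
    (hTY : ∀ x, VectorField.mlieBracket (𝓡 4) 𝓑.killing Y x = 0) {a : ℝ} (ha : 0 < a) (b : ℝ)
    {C : Set 𝓑.carrier}
    (hC : ∀ γ : ℝ → 𝓑.carrier, IsMIntegralCurve γ (a • 𝓑.killing + b • Y) → γ 0 ∈ C →
      ∀ t, γ t ∈ C) :
    ((C ∩ 𝓑.metric.chronologicalFuture 𝓑.timeOrientation 𝓑.Mext).Nonempty →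
        𝓑.Mext ⊆ 𝓑.metric.chronologicalPast 𝓑.timeOrientation C) ∧
      ((C ∩ 𝓑.metric.chronologicalPast 𝓑.timeOrientation 𝓑.Mext).Nonempty →
        𝓑.Mext ⊆ 𝓑.metric.chronologicalFuture 𝓑.timeOrientation C) := by
  obtain ⟨ψ, hψ, hψ0, hψadd, hψY, hper, -⟩ := exists_axial_flow hY
  have hψ2 : ContMDiff (𝓘(ℝ, ℝ).prod (𝓡 4)) (𝓡 4) 2 ψ := hψ.of_le (WithTop.coe_le_coe.mpr le_top)
  exact ⟨fun hne ↦ Mext_subset_chronologicalPast_of_combination_invariant hY.1 hTY hψ2 hψ0 hψadd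
      hψY hper ha b hC hne,
    fun hne ↦ Mext_subset_chronologicalFuture_of_combination_invariant hY.1 hTY hψ2 hψ0 hψadd
      hψY hper ha b hC hne⟩

/-! ### `W ≤ 0` on the event horizons (towards "W vanishes on `∂⟨⟨M_ext⟩⟩`", Chruściel–Costa
2008, Thms. 5.1/5.4) -/

section HorizonSign

variable [𝓑.metric.HasLeviCivita] {Y : Π x : 𝓑.carrier, TangentSpace (𝓡 4) x}
  {ψ : ℝ × 𝓑.carrier → 𝓑.carrier}

/-- **The area function is non-positive on the event horizons `𝓗⁺ = ∂𝓑` and `𝓗⁻ = ∂I⁺(M_ext)`**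
— for EVERY stationary AF black hole carrying a Killing field `Y` with `[T, Y] = 0` and complete
flow, with no smoothness of the horizon and no field equations: each `T + Ω Y`, `Ω ∈ ℝ`, is a
Killing field commuting with `T` with a global flow (`exists_combination_flow`), hence is not
timelike on `𝓗^±` (`not_isTimelike_of_mem_frontier`), and `areaFunction_nonpos_of_forall_not_isTimelike`
applies. This is the inequality half, on `∂⟨⟨M_ext⟩⟩ ⊆ 𝓗⁺ ∪ 𝓗⁻`, of the boundary clause "`W` …
vanishing precisely on the union of its boundary [of `⟨⟨M_ext⟩⟩`] with the set
`{g(K₁, K₁) = 0}`" of Chruściel–Costa 2008, Thm. 5.1 (Thm. 5.4: "vanishing on `∂⟨⟨M_ext⟩⟩ ∪ 𝒵̃`"),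
whose other half `W ≥ 0` on `⟨⟨M_ext⟩⟩` is the deep part of §5. [cite: ChruscielCosta2008, Thm. 5.1 and Thm. 5.4 (boundary clause), §4.1] -/
theorem areaFunction_nonpos_of_mem_frontier (hY : 𝓑.metric.IsKillingField Y)
    (hTY : ∀ x, VectorField.mlieBracket (𝓡 4) 𝓑.killing Y x = 0)
    (hψ : ContMDiff (𝓘(ℝ, ℝ).prod (𝓡 4)) (𝓡 4) 2 ψ)
    (hψ0 : ∀ p, ψ (0, p) = p) (hψadd : ∀ s s' p, ψ (s, ψ (s', p)) = ψ (s + s', p))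
    (hψY : ∀ p, IsMIntegralCurve (fun s ↦ ψ (s, p)) Y) {q : 𝓑.carrier}
    (hq : q ∈ frontier 𝓑.blackHoleRegion ∨
      q ∈ frontier (𝓑.metric.chronologicalFuture 𝓑.timeOrientation 𝓑.Mext)) :
    𝓑.metric.val q (𝓑.killing q) (Y q) ^ 2 -
        𝓑.metric.val q (𝓑.killing q) (𝓑.killing q) * 𝓑.metric.val q (Y q) (Y q) ≤ 0 := by
  have hT : 𝓑.metric.IsKillingField 𝓑.killing := 𝓑.isStationaryKilling.isKillingField
  refine LorentzianMetric.areaFunction_nonpos_of_forall_not_isTimelike fun Ω ↦ ?_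
  obtain ⟨θ, Φ, -, -, -, -, -, hΦ2, hΦ0, hΦadd, hΦK⟩ :=
    exists_combination_flow hY hTY hψ hψ0 hψadd hψY 1 Ω
  have hK' : 𝓑.metric.IsKillingField ((1 : ℝ) • 𝓑.killing + Ω • Y) := hT.linearCombination hY 1 Ω
  have hTK' : ∀ x, VectorField.mlieBracket (𝓡 4) 𝓑.killing ((1 : ℝ) • 𝓑.killing + Ω • Y) x = 0 :=
    fun x ↦ (hT.mlieBracket_combination_eq_zero hY hTY 1 Ω x).1
  have h := not_isTimelike_of_mem_frontier hK' hTK' hΦ2 hΦ0 hΦadd hΦK hq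
  simpa only [Pi.add_apply, Pi.smul_apply, one_smul] using h

/-- **`W ≤ 0` on the future event horizon `𝓔⁺`** of a stationary AF black hole with a commuting
Killing field `Y` with complete flow. Chruściel–Costa 2008, Thm. 5.4 (boundary clause, inequality
half). [cite: ChruscielCosta2008, Thm. 5.4 (boundary clause)] -/
theorem areaFunction_nonpos_of_mem_horizon (hY : 𝓑.metric.IsKillingField Y)
    (hTY : ∀ x, VectorField.mlieBracket (𝓡 4) 𝓑.killing Y x = 0)
    (hψ : ContMDiff (𝓘(ℝ, ℝ).prod (𝓡 4)) (𝓡 4) 2 ψ)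
    (hψ0 : ∀ p, ψ (0, p) = p) (hψadd : ∀ s s' p, ψ (s, ψ (s', p)) = ψ (s + s', p))
    (hψY : ∀ p, IsMIntegralCurve (fun s ↦ ψ (s, p)) Y) {q : 𝓑.carrier} (hq : q ∈ 𝓑.horizon) :
    𝓑.metric.val q (𝓑.killing q) (Y q) ^ 2 -
        𝓑.metric.val q (𝓑.killing q) (𝓑.killing q) * 𝓑.metric.val q (Y q) (Y q) ≤ 0 := by
  refine areaFunction_nonpos_of_mem_frontier hY hTY hψ hψ0 hψadd hψY (Or.inl ?_)
  have h : frontier 𝓑.blackHoleRegion =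
      frontier (𝓑.metric.chronologicalPast 𝓑.timeOrientation 𝓑.Mext) :=
    LorentzianMetric.frontier_blackHoleRegionOfEnd 𝓑.Mext
  rw [h]
  exact hq.1

/-- **`W ≤ 0` on the boundary of the domain of outer communications** (`∂⟨⟨M_ext⟩⟩ ⊆ 𝓗⁺ ∪ 𝓗⁻`).
Chruściel–Costa 2008, Thm. 5.4: "`W` … vanishing on `∂⟨⟨M_ext⟩⟩ ∪ 𝒵̃`" — the inequality half,
unconditionally. [cite: ChruscielCosta2008, Thm. 5.4 (boundary clause)] -/
theorem areaFunction_nonpos_of_mem_frontier_doc (hY : 𝓑.metric.IsKillingField Y)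
    (hTY : ∀ x, VectorField.mlieBracket (𝓡 4) 𝓑.killing Y x = 0)
    (hψ : ContMDiff (𝓘(ℝ, ℝ).prod (𝓡 4)) (𝓡 4) 2 ψ)
    (hψ0 : ∀ p, ψ (0, p) = p) (hψadd : ∀ s s' p, ψ (s, ψ (s', p)) = ψ (s + s', p))
    (hψY : ∀ p, IsMIntegralCurve (fun s ↦ ψ (s, p)) Y) {q : 𝓑.carrier}
    (hq : q ∈ frontier 𝓑.doc) :
    𝓑.metric.val q (𝓑.killing q) (Y q) ^ 2 -
        𝓑.metric.val q (𝓑.killing q) (𝓑.killing q) * 𝓑.metric.val q (Y q) (Y q) ≤ 0 :=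
  areaFunction_nonpos_of_mem_frontier hY hTY hψ hψ0 hψadd hψY (𝓑.frontier_doc_subset hq)

/-- **Axisymmetric form**: for `Y` axisymmetric Killing commuting with `T`, `W ≤ 0` on `𝓔⁺` and on
`∂⟨⟨M_ext⟩⟩`, and `g(Y, Y) ≥ 0` on `𝓔⁺`. Chruściel–Costa 2008, Thm. 5.4 (boundary clause) and §4.1.
[cite: ChruscielCosta2008, Thm. 5.4 (boundary clause) and §4.1] -/
theorem areaFunction_nonpos_of_isAxisymmetricKilling
    (hY : 𝓑.toSpacetime.IsAxisymmetricKilling Y)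
    (hTY : ∀ x, VectorField.mlieBracket (𝓡 4) 𝓑.killing Y x = 0) :
    (∀ q ∈ 𝓑.horizon, 𝓑.metric.val q (𝓑.killing q) (Y q) ^ 2 -
        𝓑.metric.val q (𝓑.killing q) (𝓑.killing q) * 𝓑.metric.val q (Y q) (Y q) ≤ 0) ∧
      (∀ q ∈ frontier 𝓑.doc, 𝓑.metric.val q (𝓑.killing q) (Y q) ^ 2 -
        𝓑.metric.val q (𝓑.killing q) (𝓑.killing q) * 𝓑.metric.val q (Y q) (Y q) ≤ 0) ∧
      ∀ q ∈ 𝓑.horizon, 0 ≤ 𝓑.metric.val q (Y q) (Y q) := by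
  obtain ⟨ψ, hψ, hψ0, hψadd, hψY, -, -⟩ := exists_axial_flow hY
  have hψ2 : ContMDiff (𝓘(ℝ, ℝ).prod (𝓡 4)) (𝓡 4) 2 ψ := hψ.of_le (WithTop.coe_le_coe.mpr le_top)
  refine ⟨fun q hq ↦ areaFunction_nonpos_of_mem_horizon hY.1 hTY hψ2 hψ0 hψadd hψY hq,
    fun q hq ↦ areaFunction_nonpos_of_mem_frontier_doc hY.1 hTY hψ2 hψ0 hψadd hψY hq,
    fun q hq ↦ ?_⟩
  have h := not_isTimelike_of_mem_horizon hY.1 hTY hψ2 hψ0 hψadd hψY hq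
  rw [LorentzianMetric.IsTimelike, not_lt] at h
  exact h

/-- **The area function is continuous** (the metric, `T` and `Y` are smooth). [folklore] -/
theorem continuous_areaFunction (hY : 𝓑.metric.IsKillingField Y) :
    Continuous fun p : 𝓑.carrier ↦ 𝓑.metric.val p (𝓑.killing p) (Y p) ^ 2 -
      𝓑.metric.val p (𝓑.killing p) (𝓑.killing p) * 𝓑.metric.val p (Y p) (Y p) := by
  have hT := 𝓑.isStationaryKilling.isKillingField.contMDiff
  have hYs := hY.contMDiff
  have h : ∀ {A B : Π x : 𝓑.carrier, TangentSpace (𝓡 4) x},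
      ContMDiff (𝓡 4) (𝓡 4).tangent ∞ (fun x ↦ (⟨x, A x⟩ : TangentBundle (𝓡 4) 𝓑.carrier)) →
      ContMDiff (𝓡 4) (𝓡 4).tangent ∞ (fun x ↦ (⟨x, B x⟩ : TangentBundle (𝓡 4) 𝓑.carrier)) →
      Continuous fun x ↦ 𝓑.metric.val x (A x) (B x) := fun hA hB ↦
    (show ContMDiff (𝓡 4) 𝓘(ℝ, ℝ) ∞ (fun x ↦ 𝓑.metric.toPseudoRiemannianMetric.val x (_) (_)) from
      fun x ↦ 𝓑.metric.toPseudoRiemannianMetric.contMDiffAt_val_apply le_rfl (hA x) (hB x)).continuous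
  exact ((h hT hYs).pow 2).sub ((h hT hT).mul (h hYs hYs))

/-- **`W = 0` at the horizon points approached from the non-ergo part of `⟨⟨M_ext⟩⟩`.** For an
`I⁺`-regular stationary AF black hole with an axisymmetric Killing field `Y` commuting with `T`:
at every `q ∈ 𝓔⁺` lying in the closure of `{p ∈ ⟨⟨M_ext⟩⟩ | g(T, T)(p) ≤ 0}` (e.g. every point of
`𝓔⁺` if the ergoregion stays away from the horizon), `W(q) = 0` — since `W ≤ 0` on `𝓔⁺`
(`areaFunction_nonpos_of_mem_horizon`) while `W ≥ 0` wherever `T` is causal or zero and `Y`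
spacelike (`areaFunction_nonneg_of_mem_doc_of_val_killing_nonpos`), a closed condition. A partial,
unconditional form of "`W` … vanishing on `∂⟨⟨M_ext⟩⟩`" (Chruściel–Costa 2008, Thms. 5.1, 5.4,
5.6), whose full strength needs `W ≥ 0` on the ergoset (§5.3–5.6). [cite: ChruscielCosta2008, Thm. 5.4 (boundary clause) and (5.37)] -/
theorem areaFunction_eq_zero_of_mem_horizon_of_mem_closure (hreg : 𝓑.IsIPlusRegular)
    (hY : 𝓑.toSpacetime.IsAxisymmetricKilling Y)
    (hTY : ∀ x, VectorField.mlieBracket (𝓡 4) 𝓑.killing Y x = 0) {q : 𝓑.carrier}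
    (hq : q ∈ 𝓑.horizon)
    (hcl : q ∈ closure {p ∈ 𝓑.doc | 𝓑.metric.val p (𝓑.killing p) (𝓑.killing p) ≤ 0}) :
    𝓑.metric.val q (𝓑.killing q) (Y q) ^ 2 -
        𝓑.metric.val q (𝓑.killing q) (𝓑.killing q) * 𝓑.metric.val q (Y q) (Y q) = 0 := by
  refine le_antisymm ((areaFunction_nonpos_of_isAxisymmetricKilling hY hTY).1 q hq) ?_
  have hclosed : IsClosed {p : 𝓑.carrier | 0 ≤ 𝓑.metric.val p (𝓑.killing p) (Y p) ^ 2 -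
      𝓑.metric.val p (𝓑.killing p) (𝓑.killing p) * 𝓑.metric.val p (Y p) (Y p)} :=
    isClosed_le continuous_const (continuous_areaFunction hY.1)
  have hsub : {p ∈ 𝓑.doc | 𝓑.metric.val p (𝓑.killing p) (𝓑.killing p) ≤ 0} ⊆
      {p : 𝓑.carrier | 0 ≤ 𝓑.metric.val p (𝓑.killing p) (Y p) ^ 2 -
        𝓑.metric.val p (𝓑.killing p) (𝓑.killing p) * 𝓑.metric.val p (Y p) (Y p)} :=
    fun p hp ↦ areaFunction_nonneg_of_mem_doc_of_val_killing_nonpos hreg hY hp.1 hp.2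
  exact closure_minimal hsub hclosed hcl

/-- **Along the event horizons the orbit planes `Span{T, Y}` contain no timelike vector.** For a
stationary AF black hole with a Killing field `Y`, `[T, Y] = 0`, with complete flow, and a point
`q` of `𝓗⁺ = ∂𝓑` or `𝓗⁻ = ∂I⁺(M_ext)`: no combination `a T_q + b Y_q` is timelike — each
`a T + b Y` with `a > 0`, as well as `Y` itself, is a Killing field commuting with `T` with a global
flow (`exists_combination_flow`), hence not timelike on `𝓗^±` (`not_isTimelike_of_mem_frontier`);
`a < 0` is the case `-(a T + b Y)`. So along the horizons the Killing orbits are null, spacelike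
or degenerate, never timelike (Chruściel–Costa 2008, §4.1: "null achronal hypersurfaces … invariant
under the isometry group"; on `𝓔⁺` they are in fact null, `W = 0`, by Thm. 5.4 — not proved here,
cf. `areaFunction_nonpos_of_mem_frontier`). [cite: ChruscielCosta2008, §4.1 and Thm. 5.4 (boundary clause)] -/
theorem not_isTimelike_combination_of_mem_frontier (hY : 𝓑.metric.IsKillingField Y)
    (hTY : ∀ x, VectorField.mlieBracket (𝓡 4) 𝓑.killing Y x = 0)
    (hψ : ContMDiff (𝓘(ℝ, ℝ).prod (𝓡 4)) (𝓡 4) 2 ψ)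
    (hψ0 : ∀ p, ψ (0, p) = p) (hψadd : ∀ s s' p, ψ (s, ψ (s', p)) = ψ (s + s', p))
    (hψY : ∀ p, IsMIntegralCurve (fun s ↦ ψ (s, p)) Y) {q : 𝓑.carrier}
    (hq : q ∈ frontier 𝓑.blackHoleRegion ∨
      q ∈ frontier (𝓑.metric.chronologicalFuture 𝓑.timeOrientation 𝓑.Mext)) (a b : ℝ) :
    ¬ 𝓑.metric.IsTimelike (a • 𝓑.killing q + b • Y q) := by
  have hT : 𝓑.metric.IsKillingField 𝓑.killing := 𝓑.isStationaryKilling.isKillingField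
  -- the case `a > 0`, for any `b`
  have hpos : ∀ {a : ℝ}, 0 < a → ∀ b : ℝ, ¬ 𝓑.metric.IsTimelike (a • 𝓑.killing q + b • Y q) := by
    intro a _ b
    obtain ⟨θ, Φ, -, -, -, -, -, hΦ2, hΦ0, hΦadd, hΦK⟩ :=
      exists_combination_flow hY hTY hψ hψ0 hψadd hψY a b
    have hK' : 𝓑.metric.IsKillingField (a • 𝓑.killing + b • Y) := hT.linearCombination hY a b
    have hTK' : ∀ x, VectorField.mlieBracket (𝓡 4) 𝓑.killing (a • 𝓑.killing + b • Y) x = 0 :=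
      fun x ↦ (hT.mlieBracket_combination_eq_zero hY hTY a b x).1
    have h := not_isTimelike_of_mem_frontier hK' hTK' hΦ2 hΦ0 hΦadd hΦK hq
    simpa only [Pi.add_apply, Pi.smul_apply] using h
  rcases lt_trichotomy a 0 with ha | rfl | ha
  · -- `a < 0`: `a T + b Y = -((-a) T + (-b) Y)`
    intro ht
    refine hpos (neg_pos.2 ha) (-b) ?_
    have h : (-a) • 𝓑.killing q + (-b) • Y q = -(a • 𝓑.killing q + b • Y q) := by
      simp only [neg_smul, neg_add]
    rw [h, LorentzianMetric.isTimelike_neg_iff]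
    exact ht
  · -- `a = 0`: the multiple `b Y` of the axial field
    intro ht
    rw [zero_smul, zero_add] at ht
    have hYq := not_isTimelike_of_mem_frontier hY hTY hψ hψ0 hψadd hψY hq
    apply hYq
    simp only [LorentzianMetric.IsTimelike, map_smul, FunLike.coe_smul, Pi.smul_apply,
      smul_eq_mul] at ht ⊢
    rcases eq_or_ne b 0 with rfl | hb
    · simp at ht
    · nlinarith [mul_self_pos.2 hb]
  · exact hpos ha b

/-- **The stationary Killing field is nowhere timelike on the event horizons** `𝓗⁺ = ∂𝓑`,
`𝓗⁻ = ∂I⁺(M_ext)`, in particular on `𝓔⁺` — for EVERY stationary AF black hole: its own flow is a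
Killing flow commuting with it (`[T, T] = 0`) preserving the achronal horizons
(`not_isTimelike_of_mem_frontier` with `K = T`). Chruściel–Costa 2008, §4.1 ("`𝓔⁺` … a null
achronal hypersurface invariant under the isometry group"; the rotating/non-rotating alternative of
§7: `T` is null or spacelike on `𝓔⁺`). [cite: ChruscielCosta2008, §4.1 and §7 (p. 34)] -/
theorem not_isTimelike_killing_of_mem_frontier {q : 𝓑.carrier}
    (hq : q ∈ frontier 𝓑.blackHoleRegion ∨
      q ∈ frontier (𝓑.metric.chronologicalFuture 𝓑.timeOrientation 𝓑.Mext)) :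
    ¬ 𝓑.metric.IsTimelike (𝓑.killing q) := by
  obtain ⟨θ, hθ, hθ0, hθadd, hθX, -⟩ := 𝓑.exists_stationary_flow
  have hT : 𝓑.metric.IsKillingField 𝓑.killing := 𝓑.isStationaryKilling.isKillingField
  have hθ2 : ContMDiff (𝓘(ℝ, ℝ).prod (𝓡 4)) (𝓡 4) 2 θ := hθ.of_le (WithTop.coe_le_coe.mpr le_top)
  exact not_isTimelike_of_mem_frontier hT
    (fun x ↦ by rw [VectorField.mlieBracket_self]; rfl) hθ2 hθ0 hθadd hθX hq

/-- **`T` is null or spacelike (or zero) at every point of the future event horizon `𝓔⁺`.**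
Chruściel–Costa 2008, §4.1 and §7 (p. 34). [cite: ChruscielCosta2008, §4.1 and §7 (p. 34)] -/
theorem not_isTimelike_killing_of_mem_horizon {q : 𝓑.carrier} (hq : q ∈ 𝓑.horizon) :
    ¬ 𝓑.metric.IsTimelike (𝓑.killing q) := by
  refine 𝓑.not_isTimelike_killing_of_mem_frontier (Or.inl ?_)
  have h : frontier 𝓑.blackHoleRegion =
      frontier (𝓑.metric.chronologicalPast 𝓑.timeOrientation 𝓑.Mext) :=
    LorentzianMetric.frontier_blackHoleRegionOfEnd 𝓑.Mext
  rw [h]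
  exact hq.1

end HorizonSign

/-! ### The linear isotropy at axis points (Chruściel–Costa 2008, §6.1; Beig–Chruściel 1997, Thm. 1.1 (3)) -/

section AxisIsotropy

variable [𝓑.metric.HasLeviCivita] {Y : Π x : 𝓑.carrier, TangentSpace (𝓡 4) x}

/-- **The axis is a non-degenerate zero set: `∇Y(p) ≠ 0` at every zero `p` of an axisymmetric
Killing field** (indeed of any complete Killing field which is not identically zero): a complete
Killing field on a connected manifold is determined by its one-jet at a point (O'Neill 1983, Ch. 9,
Lemma 9.28; in the tree `IsKillingField.eq_zero_of_oneJet_eq_zero`). Hence the linear isotropy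
action `dψₛ|_p = exp(s ∇Y(p))` at an axis point is non-trivial — the starting point of the analysis
of the `U(1)` action near its axis `𝒜` (Chruściel–Costa 2008, §6.1: "the structure of the orbit
space near 𝒜"). [cite: ChruscielCosta2008, §6.1] [cite: ONeillSemiRiemannian1983, Ch. 9, Lemma 9.28] -/
theorem leviCivita_ne_zero_of_apply_eq_zero (hY : 𝓑.toSpacetime.IsAxisymmetricKilling Y)
    {p : 𝓑.carrier} (hp : Y p = 0) : 𝓑.metric.toPseudoRiemannianMetric.leviCivita Y p ≠ 0 := by
  obtain ⟨hK, hcomp, -, ⟨x₁, hx₁⟩, -⟩ := hY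
  intro hd
  exact hx₁ (by rw [hK.eq_zero_of_oneJet_eq_zero hcomp hp hd]; rfl)

/-- **Periodic linear isotropy at the axis: `exp(2π ∇Y(p)) = 1`** at every zero `p` of an
axisymmetric Killing field `Y`. The `C^∞` global flow `ψ` of `Y` fixes `p`, its differential there
is `dψₛ|_p = exp(s ∇Y(p))` (the linear isotropy representation; in the tree
`mfderiv_flow_eq_exp_of_apply_eq_zero`), and `ψ_{2π} = id` since all orbits are `2π`-periodic. So
the `g_p`-skew endomorphism `∇Y(p) ≠ 0` (`leviCivita_ne_zero_of_apply_eq_zero`) generates a closed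
one-parameter subgroup `U(1) ⊆ SO(T_pM, g_p)` — a rotation. Chruściel–Costa 2008, §6.1 (the
isotropy groups of the `U(1)` action); Beig–Chruściel 1997, Thm. 1.1 (3) and §1 ("`λ` generates
space-rotations"); the converse bookkeeping is `BeigChrusciel1997_axisymmetricCombination.iff_exp_axis`
of `KillingAlgebraAsymptoticallyFlatProofs.lean`. [cite: ChruscielCosta2008, §6.1] [cite: BeigChrusciel1997, Thm. 1.1 (3)] -/
theorem exp_two_pi_smul_leviCivita_eq_one (hY : 𝓑.toSpacetime.IsAxisymmetricKilling Y)
    {p : 𝓑.carrier} (hp : Y p = 0) :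
    NormedSpace.exp (𝔸 := E4 →L[ℝ] E4)
        ((2 * Real.pi) • 𝓑.metric.toPseudoRiemannianMetric.leviCivita Y p) = 1 := by
  obtain ⟨ψ, hψ, hψ0, -, hψY, hper, -⟩ := exists_axial_flow hY
  have hid : (fun q ↦ ψ (2 * Real.pi, q)) = id := funext fun q ↦ by
    have h := hper 0 q
    rw [zero_add, hψ0] at h
    exact h
  rw [← PseudoRiemannianMetric.mfderiv_flow_eq_exp_of_apply_eq_zero
    (g := 𝓑.metric.toPseudoRiemannianMetric) hY.1.contMDiff
    (hψ.of_le (ENat.LEInfty.out : (2 : ℕ∞ω) ≤ ∞)) hψ0 hψY hp (2 * Real.pi), hid, mfderiv_id]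
  rfl

/-- **At an axis point the linear isotropy fixes the stationary Killing vector**:
`exp(s ∇Y(p)) T_p = T_p` for all `s` — `exp(s ∇Y(p)) = dψₛ|_p` (`mfderiv_flow_eq_exp_of_apply_eq_zero`),
`dψₛ T_p = T_{ψₛ p}` (the flows commute, `mfderiv_flow_killing_eq`) and `ψₛ p = p`
(`IsKillingField.flow_apply_eq_of_apply_eq_zero`); infinitesimally `∇Y(p)(T_p) = ∇_T Y (p) = 0`
(`axis_leviCivita_and_mfderiv_areaFunction`). So the isotropy rotations act on `T_p^⊥`; for
`p ∈ M_ext`, where `T_p` is timelike, `∇Y(p)` is a non-zero infinitesimal rotation of the Euclidean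
`3`-space `T_p^⊥` (Beig–Chruściel 1997, §1: "`λ^μ_ν p^ν = 0`, so that `λ` generates
space-rotations"). [cite: BeigChrusciel1997, §1] [cite: ChruscielCosta2008, §5.3 (p. 25) and §6.1] -/
theorem exp_smul_leviCivita_apply_killing (hY : 𝓑.toSpacetime.IsAxisymmetricKilling Y)
    (hTY : ∀ x, VectorField.mlieBracket (𝓡 4) 𝓑.killing Y x = 0) {p : 𝓑.carrier} (hp : Y p = 0)
    (s : ℝ) :
    NormedSpace.exp (𝔸 := E4 →L[ℝ] E4) (s • 𝓑.metric.toPseudoRiemannianMetric.leviCivita Y p)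
        (𝓑.killing p) = 𝓑.killing p := by
  obtain ⟨ψ, hψ, hψ0, hψadd, hψY, -, -⟩ := exists_axial_flow hY
  have hψ2 : ContMDiff (𝓘(ℝ, ℝ).prod (𝓡 4)) (𝓡 4) 2 ψ := hψ.of_le (WithTop.coe_le_coe.mpr le_top)
  -- `exp(s ∇Y(p)) = dψₛ|_p`, `dψₛ T_p = T_{ψₛ p}` and `ψₛ p = p`
  rw [← PseudoRiemannianMetric.mfderiv_flow_eq_exp_of_apply_eq_zero
    (g := 𝓑.metric.toPseudoRiemannianMetric) hY.1.contMDiff hψ2 hψ0 hψY hp s]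
  have h := mfderiv_flow_killing_eq hY.1 hTY hψ2 hψ0 hψadd hψY s p
  have hfix : ψ (s, p) = p := hY.1.flow_apply_eq_of_apply_eq_zero hψ0 hψY hp s
  rw [hfix] at h
  exact h

end AxisIsotropy

/-! ### The axial field on the (open) asymptotic region `M_ext` -/

section MextAxis

variable [𝓑.metric.HasLeviCivita] {Y : Π x : 𝓑.carrier, TangentSpace (𝓡 4) x}

/-- **An axisymmetric Killing field does not vanish identically on `M_ext`**: `M_ext` is open
(`isOpen_Mext`, `StationaryAsymptoticRegionOpen.lean`) and non-empty, and a complete Killing field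
vanishing on a non-empty open set has vanishing one-jet at a point of it, hence vanishes identically
(`IsKillingField.eq_zero_of_oneJet_eq_zero`) — excluded by non-triviality. So `M_ext ⊄ 𝒜`: the
Killing orbits are two-dimensional and timelike somewhere in the asymptotic region (next lemma).
Chruściel–Costa 2008, §5 (p. 18: "`W` is clearly positive in a region where `K₀` is timelike and
`K₁` is spacelike … in particular on `M_ext ∖ 𝒜 ≠ ∅`"). [cite: ChruscielCosta2008, §5 (p. 18)] [cite: ONeillSemiRiemannian1983, Ch. 9, Lemma 9.28] -/
theorem exists_mem_Mext_apply_ne_zero (hY : 𝓑.toSpacetime.IsAxisymmetricKilling Y) :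
    ∃ x ∈ 𝓑.Mext, Y x ≠ 0 := by
  obtain ⟨hK, hcomp, -, ⟨x₁, hx₁⟩, -⟩ := hY
  by_contra h
  push Not at h
  obtain ⟨x₀, hx₀⟩ := 𝓑.Mext_nonempty
  have hev : ∀ᶠ x in 𝓝 x₀, Y x = (0 : Π x : 𝓑.carrier, TangentSpace (𝓡 4) x) x :=
    Filter.eventually_of_mem (𝓑.Mext_mem_nhds hx₀) fun x hx ↦ h x hx
  have hcov : IsCovariantDerivativeOn E4 𝓑.metric.toPseudoRiemannianMetric.leviCivitaFun univ :=
    Fact.out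
  have hd : 𝓑.metric.toPseudoRiemannianMetric.leviCivita Y x₀ = 0 := by
    rw [PseudoRiemannianMetric.leviCivita_apply]
    rw [hcov.congr_of_eventuallyEq (hK.mdifferentiableAt x₀) (mdifferentiableAt_zeroSection ..)
      Filter.univ_mem hev]
    exact hcov.zero (mem_univ _)
  have hzero := hK.eq_zero_of_oneJet_eq_zero hcomp (h x₀ hx₀) hd
  exact hx₁ (by rw [hzero]; rfl)

/-- **For an `I⁺`-regular stationary-axisymmetric black hole the area function is positive
somewhere in `M_ext`**: at a point of `M_ext` off the axis (`exists_mem_Mext_apply_ne_zero`),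
`W > 0` (`areaFunction_pos_of_mem_Mext`). In particular `W ≢ 0`, and the set `{W > 0} ⊇ M_ext ∖ 𝒜`
on which the Killing orbits are timelike `2`-surfaces is a non-empty open subset of `⟨⟨M_ext⟩⟩`
(Chruściel–Costa 2008, §5, p. 18; the starting point of Thm. 5.4/5.6, which upgrade this to
`W > 0` on all of `⟨⟨M_ext⟩⟩ ∖ 𝒜`). [cite: ChruscielCosta2008, §5 (p. 18) and Thm. 5.6] -/
theorem exists_mem_Mext_areaFunction_pos (hreg : 𝓑.IsIPlusRegular)
    (hY : 𝓑.toSpacetime.IsAxisymmetricKilling Y) :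
    ∃ p ∈ 𝓑.Mext, 0 < 𝓑.metric.val p (𝓑.killing p) (Y p) ^ 2 -
      𝓑.metric.val p (𝓑.killing p) (𝓑.killing p) * 𝓑.metric.val p (Y p) (Y p) := by
  obtain ⟨p, hp, hYp⟩ := 𝓑.exists_mem_Mext_apply_ne_zero hY
  exact ⟨p, hp, 𝓑.areaFunction_pos_of_mem_Mext hreg hY hp hYp⟩

end MextAxis

/-! ### Consequences on `⟨⟨M_ext⟩⟩`: independence of `T`, `Y` off the axis; the orbits of
`a T + b Y` through `⟨⟨M_ext⟩⟩` are lines (Chruściel–Costa 2008, §5.2, p. 19, and §4.2) -/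

/-- **On the domain of outer communications of an `I⁺`-regular stationary-axisymmetric black hole,
`T` and `Y` are linearly independent off the axis**: `𝒵_dgt ∩ ⟨⟨M_ext⟩⟩ = 𝒵̃ ∩ ⟨⟨M_ext⟩⟩` with
`𝒵_dgt = {K₀ ∧ K₁ = 0}` and, for `s = 2`, `𝒵̃ = {g(K₁, K₁) = 0}`, which on `⟨⟨M_ext⟩⟩` is the axis
`{Y = 0}` (`val_self_eq_zero_iff_of_isAxisymmetricKilling_of_mem_doc`) — Chruściel–Costa 2008,
§5.2, p. 19: "In our analysis below we will be mainly interested in what happens in `⟨⟨M_ext⟩⟩`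
where, by Corollary 3.8, we have `𝒵̃ ∩ ⟨⟨M_ext⟩⟩ = 𝒵_dgt ∩ ⟨⟨M_ext⟩⟩`". Indeed a relation
`a T_p + b Y_p = 0` with `a ≠ 0` is a zero at `p ∈ ⟨⟨M_ext⟩⟩` of the Killing field `±(a T + b Y)`,
excluded by Cor. 3.8 (`IsIPlusRegular.combination_apply_ne_zero_of_mem_doc`), and with `a = 0` it
forces `Y_p = 0`. (On `M_ext` this was `linearIndependent_killing_axial_of_mem_Mext`, via `W > 0`.)
[cite: ChruscielCosta2008, §5.2 (p. 19, "𝒵̃ ∩ ⟨⟨M_ext⟩⟩ = 𝒵_dgt ∩ ⟨⟨M_ext⟩⟩") and Cor. 3.8] -/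
theorem IsIPlusRegular.linearIndependent_killing_axial_of_mem_doc [𝓑.metric.HasLeviCivita]
    (hreg : 𝓑.IsIPlusRegular) {Y : Π x : 𝓑.carrier, TangentSpace (𝓡 4) x}
    (hY : 𝓑.toSpacetime.IsAxisymmetricKilling Y)
    (hTY : ∀ x, VectorField.mlieBracket (𝓡 4) 𝓑.killing Y x = 0) {p : 𝓑.carrier}
    (hp : p ∈ 𝓑.doc) (hYp : Y p ≠ 0) : LinearIndependent ℝ ![𝓑.killing p, Y p] := by
  obtain ⟨ψ, hψ, hψ0, hψadd, hψY, hper, -⟩ := exists_axial_flow hY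
  have hψ2 : ContMDiff (𝓘(ℝ, ℝ).prod (𝓡 4)) (𝓡 4) 2 ψ := hψ.of_le (WithTop.coe_le_coe.mpr le_top)
  have key : ∀ {a : ℝ}, 0 < a → ∀ b : ℝ, a • 𝓑.killing p + b • Y p ≠ 0 := fun {a} ha b ↦
    StationaryAFBlackHole.IsIPlusRegular.combination_apply_ne_zero_of_mem_doc hreg hY.1 hTY hψ2
      hψ0 hψadd hψY hper ha b hp
  refine LinearIndependent.pair_iff.2 fun a b hab ↦ ?_
  rcases lt_trichotomy a 0 with ha | rfl | ha
  · exfalso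
    refine key (neg_pos.2 ha) (-b) ?_
    have h : (-a) • 𝓑.killing p + (-b) • Y p = -(a • 𝓑.killing p + b • Y p) := by
      simp only [neg_smul, neg_add]
    rw [h, hab, neg_zero]
  · simp only [zero_smul, zero_add] at hab
    exact ⟨rfl, (smul_eq_zero.1 hab).resolve_right hYp⟩
  · exact absurd hab (key ha b)

/-- **The orbits of `a T + b Y` (`a > 0`) through `⟨⟨M_ext⟩⟩` are injective curves** in an
`I⁺`-regular stationary-axisymmetric black hole: such an orbit stays in `⟨⟨M_ext⟩⟩` (invariance of
the d.o.c. under the flow of the commuting Killing field `a T + b Y`, `flow_mem_iff`), and a global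
integral curve is injective unless periodic (Mathlib's `IsMIntegralCurve.periodic_xor_injective`),
in which case its image would be a compact invariant subset of `⟨⟨M_ext⟩⟩`, excluded by Lemma 3.7
(`IsIPlusRegular.not_nonempty_invariant_subset_compact_of_isAxisymmetricKilling`). For `b = 0` this
extends the freeness of the stationary `ℝ`-action from `M_ext`
(`IsIPlusRegular.injective_of_isMIntegralCurve`) to all of `⟨⟨M_ext⟩⟩`; for `K = K₀ + Ω K₁` it
says that the orbits of the candidate horizon Killing fields in `⟨⟨M_ext⟩⟩` are lines
(Chruściel–Costa 2008, Lemma 3.7 and §4.2: "every orbit of `K₀` intersects `𝒞⁺` at most once").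
[cite: ChruscielCosta2008, Lemma 3.7 and §4.2 (proof of Thm. 4.5)] -/
theorem IsIPlusRegular.injective_of_isMIntegralCurve_combination [𝓑.metric.HasLeviCivita]
    (hreg : 𝓑.IsIPlusRegular) {Y : Π x : 𝓑.carrier, TangentSpace (𝓡 4) x}
    (hY : 𝓑.toSpacetime.IsAxisymmetricKilling Y)
    (hTY : ∀ x, VectorField.mlieBracket (𝓡 4) 𝓑.killing Y x = 0) {a : ℝ} (ha : 0 < a) (b : ℝ)
    {γ : ℝ → 𝓑.carrier} (hγ : IsMIntegralCurve γ (a • 𝓑.killing + b • Y)) (h0 : γ 0 ∈ 𝓑.doc) :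
    Function.Injective γ := by
  obtain ⟨ψ, hψ, hψ0, hψadd, hψY, hper, -⟩ := exists_axial_flow hY
  have hψ2 : ContMDiff (𝓘(ℝ, ℝ).prod (𝓡 4)) (𝓡 4) 2 ψ := hψ.of_le (WithTop.coe_le_coe.mpr le_top)
  obtain ⟨θ, Φ, -, -, -, -, -, hΦ2, hΦ0, hΦadd, hΦK⟩ :=
    exists_combination_flow hY.1 hTY hψ2 hψ0 hψadd hψY a b
  have hK' : 𝓑.metric.IsKillingField (a • 𝓑.killing + b • Y) :=
    𝓑.isStationaryKilling.isKillingField.linearCombination hY.1 a b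
  have hTK' : ∀ x, VectorField.mlieBracket (𝓡 4) 𝓑.killing (a • 𝓑.killing + b • Y) x = 0 :=
    fun x ↦ ((combination_commutes_and_norm_invariant hY hTY a b).1 x).1
  have hK1 := combination_contMDiff_one (𝓑 := 𝓑) hY.1 a b
  -- the orbit stays in `⟨⟨M_ext⟩⟩` (invariance under the flow of the commuting Killing field)
  have hmem : ∀ u, γ u ∈ 𝓑.doc := fun u ↦ by
    rw [eq_flow_of_isMIntegralCurve hK1 hΦK hΦ0 hγ u]
    exact (flow_mem_iff hK' hTK' hΦ2 hΦ0 hΦadd hΦK u (γ 0)).1.2 h0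
  rcases hγ.periodic_xor_injective hK1 with ⟨⟨P, hP, hperγ⟩, -⟩ | ⟨hinj, -⟩
  · -- a closed orbit would be a compact invariant subset of `⟨⟨M_ext⟩⟩` (Lemma 3.7)
    exfalso
    refine hreg.not_nonempty_invariant_subset_compact_of_isAxisymmetricKilling hY hTY ha b
      (N := Set.range γ) (C := γ '' Set.Icc 0 P) ?_ ?_ (isCompact_Icc.image hγ.continuous) ?_
      (Set.range_nonempty γ)
    · rintro _ ⟨u, rfl⟩
      obtain ⟨v, hv, huv⟩ := hperγ.exists_mem_Ico₀ hP u
      exact ⟨v, Set.Ico_subset_Icc_self hv, huv.symm⟩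
    · rintro _ ⟨u, -, rfl⟩
      exact hmem u
    · rintro δ hδ ⟨u₀, hu₀⟩ t
      exact ⟨t + u₀, (apply_eq_apply_add_of_isMIntegralCurve hK1 hγ hδ hu₀.symm t).symm⟩
  · exact hinj

/-- **No closed orbits of `a T + b Y` (`a > 0`) through `⟨⟨M_ext⟩⟩`** in an `I⁺`-regular
stationary-axisymmetric black hole. Chruściel–Costa 2008, Lemma 3.7. [cite: ChruscielCosta2008, Lemma 3.7] -/
theorem IsIPlusRegular.not_periodic_of_isMIntegralCurve_combination [𝓑.metric.HasLeviCivita]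
    (hreg : 𝓑.IsIPlusRegular) {Y : Π x : 𝓑.carrier, TangentSpace (𝓡 4) x}
    (hY : 𝓑.toSpacetime.IsAxisymmetricKilling Y)
    (hTY : ∀ x, VectorField.mlieBracket (𝓡 4) 𝓑.killing Y x = 0) {a : ℝ} (ha : 0 < a) (b : ℝ)
    {γ : ℝ → 𝓑.carrier} (hγ : IsMIntegralCurve γ (a • 𝓑.killing + b • Y)) (h0 : γ 0 ∈ 𝓑.doc)
    {c : ℝ} (hc : c ≠ 0) : ¬ Function.Periodic γ c := by
  intro hp
  have h0c : (0 : ℝ) + c = 0 :=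
    hreg.injective_of_isMIntegralCurve_combination hY hTY ha b hγ h0 (hp 0)
  exact hc (by simpa using h0c)

/-- **The stationary flow acts freely on the whole domain of outer communications** of an
`I⁺`-regular stationary-axisymmetric black hole: every orbit of `T` through `⟨⟨M_ext⟩⟩` — also
through the ergoregion, where `T` fails to be timelike — is an injective curve (the case
`a = 1, b = 0` of `injective_of_isMIntegralCurve_combination`). Chruściel–Costa 2008, Lemma 3.7,
Cor. 3.8 and §4.2. [cite: ChruscielCosta2008, Lemma 3.7 and §4.2 (proof of Thm. 4.5)] -/
theorem IsIPlusRegular.injective_of_isMIntegralCurve_of_mem_doc [𝓑.metric.HasLeviCivita]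
    (hreg : 𝓑.IsIPlusRegular) {Y : Π x : 𝓑.carrier, TangentSpace (𝓡 4) x}
    (hY : 𝓑.toSpacetime.IsAxisymmetricKilling Y)
    (hTY : ∀ x, VectorField.mlieBracket (𝓡 4) 𝓑.killing Y x = 0)
    {γ : ℝ → 𝓑.carrier} (hγ : IsMIntegralCurve γ 𝓑.killing) (h0 : γ 0 ∈ 𝓑.doc) :
    Function.Injective γ := by
  have hγ' : IsMIntegralCurve γ ((1 : ℝ) • 𝓑.killing + (0 : ℝ) • Y) := by
    simpa only [one_smul, zero_smul, add_zero] using hγ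
  exact hreg.injective_of_isMIntegralCurve_combination hY hTY one_pos 0 hγ' h0

end StationaryAFBlackHole

/-! ### Theorem 3.2 under the printed hypothesis "a second Killing vector field"
(Chruściel–Costa–Heusler 2012, §3.2.1, via Beig–Chruściel 1997) -/

/-- **Chruściel–Costa–Heusler's Thm. 3.2 with the printed, weaker symmetry hypothesis.** CCH 2012,
§3.2.1 (p. 10) assume only "a second Killing vector field" besides stationarity and invoke
Beig–Chruściel 1997 (Thm. 1.2) to produce an axisymmetric combination `η = a T + b K` with periodic
orbits and an axis. Combining the two named facts of the tree —
`ChruscielCostaHeusler2012_axisymmetricUniqueness` (Thm. 3.2 at `IsStationaryAxisymmetric`) and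
`BeigChrusciel1997_axisymmetricCombination` (through
`BeigChrusciel1997_axisymmetricCombination.isStationaryAxisymmetric`) — gives the
Alexakis–Ionescu–Klainerman schema at the predicate "`I⁺`-regular with connected non-degenerate
horizon, and carrying a complete Killing field `K` commuting with `T` and not a constant multiple of
`T`". [cite: ChruscielCostaHeusler2012, §3.2.1 (p. 10) and Thm. 3.2] [cite: BeigChrusciel1997, Thm. 1.2] -/
theorem ChruscielCostaHeusler2012_axisymmetricUniqueness.of_secondKilling
    (h : ChruscielCostaHeusler2012_axisymmetricUniqueness.{u})
    (hBC : BeigChrusciel1997_axisymmetricCombination.{u}) :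
    AlexakisIonescuKlainermanRigidity.{u} fun 𝓑 ↦ 𝓑.IsIPlusRegularNonDegenerate ∧
      ∀ [𝓑.metric.HasLeviCivita], ∃ K : Π x : 𝓑.carrier, TangentSpace (𝓡 4) x,
        𝓑.metric.IsKillingField K ∧ IsCompleteVectorField K ∧
        (∀ x, VectorField.mlieBracket (𝓡 4) 𝓑.killing K x = 0) ∧ ¬ ∃ c : ℝ, K = c • 𝓑.killing := by
  intro 𝓑 _ _ hF hP hres h𝓑 hvac
  obtain ⟨hreg, hK⟩ := h𝓑
  obtain ⟨K, hK, hKc, hcomm, hrot⟩ := hK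
  exact h 𝓑 hF hP hres ⟨hreg, hBC.isStationaryAxisymmetric 𝓑 hreg hvac hK hKc hcomm hrot⟩ hvac

/-- Hypothesis form of `ChruscielCostaHeusler2012_axisymmetricUniqueness.of_secondKilling`: given
the two named facts, an `I⁺`-regular vacuum stationary AF black hole with connected non-degenerate
horizon carrying a complete second Killing field `K` with `[T, K] = 0`, `K ∉ ℝ T`, has domain of
outer communications isometric to a subextremal Kerr exterior. Chruściel–Costa–Heusler 2012,
Thm. 3.2 with §3.2.1. [cite: ChruscielCostaHeusler2012, Thm. 3.2 and §3.2.1 (p. 10)] -/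
theorem ChruscielCostaHeusler2012_axisymmetricUniqueness.apply_of_secondKilling
    (h : ChruscielCostaHeusler2012_axisymmetricUniqueness.{u})
    (hBC : BeigChrusciel1997_axisymmetricCombination.{u})
    (𝓑 : StationaryAFBlackHole.{u}) [𝓑.metric.HasLeviCivita] [Kerr.Facts]
    (hF : 𝓑.metric.isOpen_chronologicalFuture 𝓑.timeOrientation)
    (hP : 𝓑.metric.isOpen_chronologicalPast 𝓑.timeOrientation)
    (hres : PseudoRiemannianMetric.contMDiff_restrict (I := 𝓡 4) (n := ∞) (M := 𝓑.carrier))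
    (hreg : 𝓑.IsIPlusRegularNonDegenerate)
    {K : Π x : 𝓑.carrier, TangentSpace (𝓡 4) x} (hK : 𝓑.metric.IsKillingField K)
    (hKc : IsCompleteVectorField K)
    (hcomm : ∀ x, VectorField.mlieBracket (𝓡 4) 𝓑.killing K x = 0)
    (hrot : ¬ ∃ c : ℝ, K = c • 𝓑.killing)
    (hvac : 𝓑.metric.toPseudoRiemannianMetric.IsRicciFlat) :
    𝓑.IsIsometricToKerrExterior hF hP hres :=
  h 𝓑 hF hP hres ⟨hreg, hBC.isStationaryAxisymmetric 𝓑 hreg hvac hK hKc hcomm hrot⟩ hvac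


end Literature.Geometry.Lorentzian

end
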